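import Literature.Barriers.QuantumFields.FiniteTemperatureInfraredExplicit
import Literature.Barriers.QuantumFields.FiniteTemperatureReflection
import Literature.Barriers.QuantumFields.FiniteTemperaturePolyakovDiagonal
import Literature.Barriers.QuantumFields.FiniteTemperatureSpatialReflection
import Literature.Probability.LatticeModels.CycleConvexityInfrared
import Literature.Probability.LatticeModels.TorusTransferSpectral
import Literature.MathematicalPhysics.QuantumFieldTheory.GaussianDoubleCommutatorBounds
import HarnessLib

/-!
# Proof of Borgs–Seiler's infrared bound with its printed rate
# (`BorgsSeilerInfraredBoundExplicit_holds`)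

This file discharges the named fact `Literature.Barriers.QuantumFields.BorgsSeilerInfraredBoundExplicit`
of the sibling `FiniteTemperatureInfraredExplicit.lean` — Borgs–Seiler, Comm. Math. Phys. 91 (1983),
Lemma III.6 / Cor. III.7 with the printed rate `f(J_E) = (1 + 2χ(1)/J_E)^{L₀} − 1`: for a compact
group `G` with a continuous unitary `N × N` representation `ρ`, every `d`, `L₀ ≥ 1`, every even
spatial period `L ≥ 4`, `J_E, J_M > 0`, every lattice momentum `k` and direction `i`,
`(1 − cos pᵢ) Re Ĝ_L(k) ≤ (1 + 2N/J_E)^{L₀} − 1` — as the theorem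
`BorgsSeilerInfraredBoundExplicit_holds` (last declaration). Everything is proved; no named fact
is introduced. (Faithfulness of `ρ` and `N ≥ 1`, hypotheses of the fact, are not used.)

## Strategy (the printed proof, §III.2 pp. 349–353, and where we deviate)

Fix the direction `i`, write `L = 2n + 2` (`n ≥ 1`), slice the spatial torus along `i`
(`Torus.ins`), let `A_s = Σ_y c(y) χ(g_{L_{ins_i(s,y)}})` be the transversally smeared Polyakov
loop of the slice `s` ((III.27)) and `g(m) = ∫ A_0 conj(A_m) e^{−S}` the two-point chain.

* STEP A (Lemma III.8). Printed: spectral theory of the non-negative transfer matrix in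
  direction `i`. DEVIATION: reflection positivity in the lattice hyperplanes (`θ₀`) and in the
  half-way hyperplanes (`θ₁`) is used only through the forms `⟨F, F∘θ⟩ ≥ 0` for
  `F = A_a + z A_b` (`siteForm_nonneg`, `linkForm_nonneg`); they make the chain real
  (`chain_im_eq_zero`) and CONVEX off the origin (`chain_laplacian_nonneg`), and the cycle
  identity `one_sub_re_stdAddChar_mul_re_sum_le` of `CycleConvexityInfrared` gives
  `(1 − cos pᵢ) Re Σ_m e(−pᵢm) g(m) ≤ 2g(0) − g(1) − g(−1) = ∫ |A_0 − A_1|² e^{−S}` ((III.32), constant `1`).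
* STEP B ((III.33)–(III.59)). The plane between the slices `0` and `1` carries the Gaussian kernel
  `T = exp(−(J_E/2)‖ρ(u₀) − ρ(u₁)‖²)` of the electric crossing plaquettes ((III.34)–(III.35);
  `exp_elec0_eq`, after the gauge decoupling `decouple` of the crossing links, our substitute for
  the axial gauge). DEVIATION in (III.36)–(III.58): instead of the operators `D_k` and the sum over
  broken loops we use the exact Gaussian (Cameron–Martin) identity
  `|F(w) − F(w')|² T = B T − 𝒦` of `GaussianDoubleCommutatorKernel` (`dcKernel_identity_smearedPoly`):
  `𝒦` is a Gram kernel, and `‖B‖ ≤ ((1 + 2N/J_E)^{L₀} − 1) Σ|c|²` on unitary inputs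
  (`norm_covKernel_smearedPoly_le`, the broken-loop count of (III.49)–(III.58)). The Gram term is
  non-negative against the rest of the weight by Fubini and reflection positivity in the half-way
  plane (`re_integral_exp_bRest_mul_dcKernel_nonneg`, replacing (III.41)); this needs the
  insertion to depend on positive links only, which the gauge decoupling provides. Result: `stepB`.
* ASSEMBLY ((III.28)–(III.31)): `Σ_m e(−kᵢm) g(m) = Z L^{d'} κ̂(k)`, `κ̂(k) = Σ_x K(0,x) conj χ_k(x)`
  (`sum_stdAddChar_mul_chain`), `Re Ĝ_L(k) = (Re κ̂(k) + Re κ̂(−k))/2`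
  (`re_torusFourier_polyakovCorrelation`), `infrared_hatK`, `infrared_bound_even`, the fact.

## Part I — slice reflections with offset and gauge decoupling (namespace `FiniteTemperature.SliceRP`)

Reflection positivity in a SPATIAL direction `i` of the finite-temperature Wilson theory of
`FiniteTemperatureDeconfinement.lean` (configurations `FiniteTemperature.Config d L₀ L G`, weight
`FiniteTemperature.weight ρ J_E J_M`, product Haar measure `FiniteTemperature.haar`), companion to
`FiniteTemperatureReflection.lean` / `FiniteTemperaturePolyakovDiagonal{,Odd}.lean` (TIME
reflection) and independent of the sibling `FiniteTemperatureSpatialReflection.lean` (bond/site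
reflections `spaceReflect`, `spaceSiteReflect`, which randomise crossing links — only its
`plaquette_swap` is used here; the crossing links are instead decoupled by a partial gauge
transformation, which is what a NON-product insertion across the plane requires). For an offset `c : ℤ/L`, `σ_c` replaces `yᵢ` by `c − yᵢ` (`c = 0`: lattice
hyperplanes `yᵢ ∈ {0, L/2}`; `c = 1`: hyperplanes half-way between lattice planes);
`spaceReflect i c` relabels links by `σ_c` and inverts the links in direction `i`
(`measurePreserving_spaceReflect`, `polyakovTrace_spaceReflect`). `measurePreserving_skewShift`
(two-sided translations on a block of coordinates preserve `∏dg`), `gaugeAct` (gauge covariance),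
the GAUGE DECOUPLING `decouple` of the crossing links of `θ₁` (`measurePreserving_decouple`,
`polyakovTrace_decouple`, `plaquette_decouple_*`, `conj_decouple_time_of_slice_zero`), the action
sorted by slices (`inTerm`, `spTerm`, `axTerm`, `minusAction_eq_sum_terms`), the link planes
(`bPlus`, `xCross`, **`minusAction_decouple : −S(decouple U) = B₊(U) + B₊(θ₁U) + X(U)`**, `posLinks`,
`linkCoupling`/`lcoef`, **`linkRP_core`**) and the site planes (`bPlus0`, `bPlane0`,
**`minusAction_site_split`**, `posLinks0`, `sharedLinks0`, **`siteRP_core`**), both cores feeding the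
tree's abstract mechanism (`LatticeRP.integral_mul_conj_mul_exp_nonneg`,
`…integral_splice_mul_conj_comp_of_shared_nonneg`) with an EMPTY crossing block.

## Part II — the chain, Step A, Step B, assembly

* `sliceObs` (`A_s`), `pair`, `chain` (`g`), `pair_eq_chain` (translation invariance),
  `integral_twoTerm_spaceReflect`; `siteForm_nonneg`, `linkForm_nonneg` (the latter through
  `integral_comp_decouple`, `minusAction_decouple` and `xCross_eq'`), `chain_im_eq_zero`,
  `chain_laplacian_nonneg`.
* The crossing energy as link couplings: `eTerm`, `axTerm_eq`, `crossE`/`crossM`/`crossH`, `Jw`,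
  `elec0`, `xCross_eq`, `xCross_eq'`, `cross_subset_posLinks`.
* Slice data in real coordinates: `tOf`, `sliceMat`, `wv = realify ∘ sliceMat`
  (`polyakovTrace_eq_polyTrace`, `sliceObs_eq_smearedPoly`, `norm_wv_le`, `wv_one_spaceReflect`,
  `dependsOn_wv`), `elec0_eq`/`exp_elec0_eq` (electric crossing energy = `e^{c₀} T_{J_E}(wv₀, wv₁)`).
* Gram term: `continuous_dcFeature`, `norm_dcFeature_le`, `integrable_exp_mul_sum_abs` (Gaussian
  exponential moments), `bRest` (`B'`), `gramIntegrand`, `integrable_gramIntegrand`,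
  `integral_gramIntegrand_nonneg`, `re_integral_exp_bRest_mul_dcKernel_nonneg`.
* Step B: `c0`, `wT`, `weight_decouple`, `stepB_pointwise`, `integral_normSq_sub_eq`, **`stepB`**.
* Assembly: `hatK` (`κ̂`), `planeObs`, `sum_stdAddChar_mul_sliceObs`, `sum_stdAddChar_mul_chain`,
  `re_torusFourier_polyakovCorrelation`, **`infrared_hatK`**, **`infrared_bound_even`**, and
  **`BorgsSeilerInfraredBoundExplicit_holds`**.

## References

* C. Borgs, E. Seiler, *Lattice Yang–Mills theory at nonzero temperature and the confinement
  problem*, Commun. Math. Phys. 91 (1983) 329–380, doi:10.1007/bf01208780 (held; PDF page =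
  printed − 328): §II.2 (reflection positivity in lattice planes and in half-way planes,
  pp. 331–332), §III.1 (p. 344), §III.2 Lemma III.6 (III.27)–(III.30), Cor. III.7 (III.31)
  (pp. 348–349), Lemma III.8 and the proof (III.32)–(III.60) (pp. 349–353).
* K. Osterwalder, E. Seiler, Ann. Phys. 110 (1978) 440–471, §2; J. Fröhlich, B. Simon, T. Spencer,
  Commun. Math. Phys. 50 (1976) 79–95, §3.
[BorgsSeiler1983]
-/

noncomputable section

open MeasureTheory Filter Topology
open scoped ComplexConjugate ComplexOrder Matrix
open Literature.MathematicalPhysics.QuantumFieldTheory (haarProbability)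
open Literature.MathematicalPhysics.QuantumFieldTheory.LatticeRP (splice splice_apply piMeasure)

namespace Literature.Barriers.QuantumFields

namespace FiniteTemperature

/-! The declarations of this file live in the sub-namespace `FiniteTemperature.SliceRP` (the
slice-reflection apparatus), to keep them apart from the bond/site reflections `spaceReflect`,
`spaceSiteReflect` of the sibling file `FiniteTemperatureSpatialReflection.lean`. -/
namespace SliceRP

variable {d L₀ L : ℕ} {G : Type*} [Group G] {N : ℕ}

/-! ### The reflection of the spatial torus in direction `i` -/

/-- The reflection `σ_c` of `(ℤ/L)^d` in direction `i` with offset `c`: the `i`-th coordinate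
`yᵢ` becomes `c − yᵢ`, the others are unchanged (`c = 0`: reflection in the lattice hyperplanes
`yᵢ ∈ {0, L/2}`; `c = 1`: in the hyperplanes half-way between lattice planes). [folklore] -/
def sigma (i : Fin d) (c : ZMod L) (y : Fin d → ZMod L) : Fin d → ZMod L :=
  Function.update y i (c - y i)

variable (i : Fin d) (c : ZMod L)

/-- The reflected `i`-th coordinate. [folklore] -/
@[simp] theorem sigma_apply_self (y : Fin d → ZMod L) : sigma i c y i = c - y i := by
  simp [sigma]

/-- The other coordinates are unchanged. [folklore] -/
@[simp] theorem sigma_apply_of_ne {j : Fin d} (hj : j ≠ i) (y : Fin d → ZMod L) :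
    sigma i c y j = y j := by
  simp [sigma, hj]

/-- `σ_c` is an involution. [folklore] -/
@[simp] theorem sigma_sigma (y : Fin d → ZMod L) : sigma i c (sigma i c y) = y := by
  funext j
  by_cases hj : j = i
  · subst hj; simp
  · simp [hj]

/-- `σ_c` commutes with the shifts in the other directions. [folklore] -/
theorem sigma_add_single_of_ne {j : Fin d} (hj : j ≠ i) (y : Fin d → ZMod L) (a : ZMod L) :
    sigma i c (y + Pi.single j a) = sigma i c y + Pi.single j a := by
  funext k
  by_cases hk : k = i
  · subst hk
    simp [Ne.symm hj]
  · by_cases hkj : k = j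
    · subst hkj; simp [hk]
    · simp [hk, hkj]

/-- `σ_c` anti-commutes with the shift in direction `i`: `σ(y + eᵢ) = σ(y) − eᵢ`. [folklore] -/
theorem sigma_add_single_self (y : Fin d → ZMod L) (a : ZMod L) :
    sigma i c (y + Pi.single i a) = sigma i c y - Pi.single i a := by
  funext k
  by_cases hk : k = i
  · subst hk; simp; ring
  · simp [hk]

/-- `σ` as a permutation of the spatial torus. [folklore] -/
def sigmaEquiv : Equiv.Perm (Fin d → ZMod L) where
  toFun := sigma i c
  invFun := sigma i c
  left_inv := sigma_sigma i c
  right_inv := sigma_sigma i c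

/-! ### The reflection of links and configurations -/

/-- The reflection on (positively oriented) links: a link at `(t, y)` in a direction `μ ≠ i`
goes to the same kind of link at `(t, σ y)`; the link from `(t, y)` to `(t, y + eᵢ)` goes to the
link from `(t, σ y − eᵢ)` to `(t, σ y)` (to be traversed backwards). [folklore] -/
def spaceReflectLink : Site d L₀ L × Dir d → Site d L₀ L × Dir d :=
  fun e => if e.2 = some i then ((e.1.1, sigma i c e.1.2 - Pi.single i 1), some i)
    else ((e.1.1, sigma i c e.1.2), e.2)

/-- `spaceReflectLink` on links in direction `i`. [folklore] -/
@[simp] theorem spaceReflectLink_self (t : ZMod L₀) (y : Fin d → ZMod L) :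
    spaceReflectLink i c (((t, y), some i) : Site d L₀ L × Dir d) =
      ((t, sigma i c y - Pi.single i 1), some i) := by
  simp [spaceReflectLink]

/-- `spaceReflectLink` on the other links. [folklore] -/
@[simp] theorem spaceReflectLink_of_ne (t : ZMod L₀) (y : Fin d → ZMod L) {μ : Dir d}
    (hμ : μ ≠ some i) : spaceReflectLink i c (((t, y), μ) : Site d L₀ L × Dir d) =
      ((t, sigma i c y), μ) := by
  simp [spaceReflectLink, hμ]

/-- `σ(σ y − eᵢ) − eᵢ = y`. [folklore] -/
theorem sigma_sigma_sub_single (y : Fin d → ZMod L) :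
    sigma i c (sigma i c y - Pi.single i 1) - Pi.single i 1 = y := by
  have h : sigma i c y - Pi.single i 1 = sigma i c y + Pi.single i (-1 : ZMod L) := by
    rw [Pi.single_neg, sub_eq_add_neg]
  rw [h, sigma_add_single_self, sigma_sigma, Pi.single_neg, sub_neg_eq_add, add_sub_cancel_right]

/-- `spaceReflectLink` is an involution. [folklore] -/
theorem spaceReflectLink_spaceReflectLink (e : Site d L₀ L × Dir d) :
    spaceReflectLink i c (spaceReflectLink i c e) = e := by
  rcases e with ⟨⟨t, y⟩, μ⟩
  by_cases hμ : μ = some i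
  · subst hμ
    rw [spaceReflectLink_self, spaceReflectLink_self, sigma_sigma_sub_single]
  · rw [spaceReflectLink_of_ne i c t y hμ, spaceReflectLink_of_ne i c t _ hμ, sigma_sigma]

/-- `spaceReflectLink` as a permutation of the links. [folklore] -/
def spaceReflectLinkEquiv : Equiv.Perm (Site d L₀ L × Dir d) where
  toFun := spaceReflectLink i c
  invFun := spaceReflectLink i c
  left_inv := spaceReflectLink_spaceReflectLink i c
  right_inv := spaceReflectLink_spaceReflectLink i c

/-- **The spatial reflection on configurations**: `(θU)(e) = U(θe)` for links not in direction
`i`, `(θU)(e) = U(θe)⁻¹` for links in direction `i`. [cite: BorgsSeiler1983, §II.2 (pp. 331–332); §III.1 (p. 344)] -/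
def spaceReflect (U : Config d L₀ L G) : Config d L₀ L G :=
  fun e => if e.2 = some i then (U (spaceReflectLink i c e))⁻¹ else U (spaceReflectLink i c e)

/-- `spaceReflect` on links in direction `i`. [folklore] -/
@[simp] theorem spaceReflect_self (U : Config d L₀ L G) (t : ZMod L₀) (y : Fin d → ZMod L) :
    spaceReflect i c U ((t, y), some i) = (U ((t, sigma i c y - Pi.single i 1), some i))⁻¹ := by
  simp [spaceReflect]

/-- `spaceReflect` on the other links. [folklore] -/
@[simp] theorem spaceReflect_of_ne (U : Config d L₀ L G) (t : ZMod L₀) (y : Fin d → ZMod L)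
    {μ : Dir d} (hμ : μ ≠ some i) :
    spaceReflect i c U ((t, y), μ) = U ((t, sigma i c y), μ) := by
  simp [spaceReflect, hμ, spaceReflectLink_of_ne i c t y hμ]

/-- The spatial reflection is an involution. [folklore] -/
theorem spaceReflect_spaceReflect (U : Config d L₀ L G) :
    spaceReflect i c (spaceReflect i c U) = U := by
  funext e
  rcases e with ⟨⟨t, y⟩, μ⟩
  by_cases hμ : μ = some i
  · subst hμ
    rw [spaceReflect_self, spaceReflect_self, inv_inv, sigma_sigma_sub_single]
  · rw [spaceReflect_of_ne i c _ t y hμ, spaceReflect_of_ne i c _ t _ hμ, sigma_sigma]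

/-- Coordinatewise inversion of the link variables in direction `i`. [folklore] -/
def invDir (e : Site d L₀ L × Dir d) (g : G) : G := if e.2 = some i then g⁻¹ else g

/-- `spaceReflect` = relabelling by `spaceReflectLink` followed by inversion of the direction-`i`
coordinates. [folklore] -/
theorem spaceReflect_eq (U : Config d L₀ L G) :
    spaceReflect i c U = fun e => invDir i e (U (spaceReflectLink i c e)) := by
  funext e
  by_cases he : e.2 = some i <;> simp [spaceReflect, invDir, he]

variable [TopologicalSpace G] [IsTopologicalGroup G] [CompactSpace G] [MeasurableSpace G]
  [BorelSpace G]

omit [TopologicalSpace G] [IsTopologicalGroup G] [CompactSpace G] [BorelSpace G] [Group G] in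
/-- Relabelling by `spaceReflectLink` as a measurable equivalence. [folklore] -/
def spaceReflectRelabelEquiv : Config d L₀ L G ≃ᵐ Config d L₀ L G :=
  MeasurableEquiv.piCongrLeft (fun _ : Site d L₀ L × Dir d => G) (spaceReflectLinkEquiv i c).symm

omit [TopologicalSpace G] [IsTopologicalGroup G] [CompactSpace G] [BorelSpace G] [Group G] in
/-- The relabelling equivalence is `U ↦ U ∘ spaceReflectLink`. [folklore] -/
theorem coe_spaceReflectRelabelEquiv :
    ⇑(spaceReflectRelabelEquiv (L₀ := L₀) (G := G) i c) = fun U e => U (spaceReflectLink i c e) := by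
  funext U; funext e
  rw [spaceReflectRelabelEquiv, MeasurableEquiv.coe_piCongrLeft, Equiv.piCongrLeft_apply_eq_cast,
    cast_eq]
  rfl

/-- **The spatial reflection preserves the a-priori measure** `∏ dg`. [folklore] -/
theorem measurePreserving_spaceReflect [NeZero L₀] [NeZero L] :
    MeasurePreserving (spaceReflect (G := G) i c) (haar d L₀ L G) (haar d L₀ L G) := by
  have h1 : MeasurePreserving (spaceReflectRelabelEquiv (L₀ := L₀) (G := G) i c)
      (haar d L₀ L G) (haar d L₀ L G) :=
    measurePreserving_piCongrLeft
      (fun _ : Site d L₀ L × Dir d =>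
        Literature.MathematicalPhysics.QuantumFieldTheory.haarProbability G)
      (spaceReflectLinkEquiv i c).symm
  have h2 : MeasurePreserving (fun (V : Config d L₀ L G) e => invDir i e (V e))
      (haar d L₀ L G) (haar d L₀ L G) := by
    unfold haar
    refine measurePreserving_pi _ _ fun e => ?_
    by_cases he : e.2 = some i
    · have : invDir (G := G) i e = Inv.inv := by funext g; simp [invDir, he]
      rw [this]
      exact Measure.measurePreserving_inv _
    · have : invDir (G := G) i e = id := by funext g; simp [invDir, he]
      rw [this]
      exact MeasurePreserving.id _
  have h := h2.comp h1
  have hcomp : (fun (V : Config d L₀ L G) e => invDir i e (V e)) ∘ ⇑(spaceReflectRelabelEquiv i c) =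
      spaceReflect (L₀ := L₀) (G := G) i c := by
    funext U
    rw [Function.comp_apply, coe_spaceReflectRelabelEquiv, spaceReflect_eq]
  rwa [hcomp] at h

/-! ### Plaquettes under the reflection -/

/- `plaquette_swap` (reversing a plaquette inverts its holonomy) is taken from the sibling
`FiniteTemperatureSpatialReflection.lean` (`FiniteTemperature.plaquette_swap`). -/

/-- The reflected site `x̂ = (t, σ y)`. [folklore] -/
def hatSite (x : Site d L₀ L) : Site d L₀ L := (x.1, sigma i c x.2)

omit [TopologicalSpace G] [IsTopologicalGroup G] [CompactSpace G] [MeasurableSpace G]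
  [BorelSpace G] [Group G] in
/-- `x̂` commutes with the shifts in directions other than `i` (including time). [folklore] -/
theorem hatSite_shift_of_ne (x : Site d L₀ L) {μ : Dir d} (hμ : μ ≠ some i) :
    hatSite i c (x.shift μ) = (hatSite i c x).shift μ := by
  rcases μ with _ | j
  · rfl
  · have hj : j ≠ i := fun h => hμ (by rw [h])
    simp only [hatSite, Site.shift]
    rw [sigma_add_single_of_ne i c hj]

omit [TopologicalSpace G] [IsTopologicalGroup G] [CompactSpace G] [MeasurableSpace G]
  [BorelSpace G] [Group G] in
/-- `x̂` and the shift in direction `i`: `(x + eᵢ)^ = x̂ − eᵢ`, i.e. `(x + eᵢ)^ + eᵢ = x̂`. [folklore] -/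
theorem hatSite_shift_self (x : Site d L₀ L) :
    hatSite i c (x.shift (some i)) = ((hatSite i c x).1, (hatSite i c x).2 - Pi.single i 1) := by
  simp only [hatSite, Site.shift]
  rw [sigma_add_single_self]

/-- The site one step back in direction `i` from `x̂`. [folklore] -/
def hatBack (x : Site d L₀ L) : Site d L₀ L := (x.1, sigma i c x.2 - Pi.single i 1)

omit [TopologicalSpace G] [IsTopologicalGroup G] [CompactSpace G] [MeasurableSpace G]
  [BorelSpace G] [Group G] in
/-- `hatBack x + eᵢ = x̂`. [folklore] -/
theorem hatBack_shift_self (x : Site d L₀ L) : (hatBack i c x).shift (some i) = hatSite i c x := by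
  simp [hatBack, hatSite, Site.shift]

omit [TopologicalSpace G] [IsTopologicalGroup G] [CompactSpace G] [MeasurableSpace G]
  [BorelSpace G] [Group G] in
/-- `hatBack` commutes with the shifts in directions other than `i`. [folklore] -/
theorem hatBack_shift_of_ne (x : Site d L₀ L) {μ : Dir d} (hμ : μ ≠ some i) :
    hatBack i c (x.shift μ) = (hatBack i c x).shift μ := by
  rcases μ with _ | j
  · rfl
  · have hj : j ≠ i := fun h => hμ (by rw [h])
    simp only [hatBack, Site.shift]
    rw [sigma_add_single_of_ne i c hj]
    refine Prod.ext rfl ?_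
    simp only
    abel

omit [TopologicalSpace G] [IsTopologicalGroup G] [CompactSpace G] [MeasurableSpace G]
  [BorelSpace G] in
/-- `θU` on a link not in direction `i`, in terms of `x̂`. [folklore] -/
theorem spaceReflect_apply_of_ne (U : Config d L₀ L G) (x : Site d L₀ L) {μ : Dir d} (hμ : μ ≠ some i) :
    spaceReflect i c U (x, μ) = U (hatSite i c x, μ) := by
  rcases x with ⟨t, y⟩
  exact spaceReflect_of_ne i c U t y hμ

omit [TopologicalSpace G] [IsTopologicalGroup G] [CompactSpace G] [MeasurableSpace G]
  [BorelSpace G] in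
/-- `θU` on a link in direction `i`, in terms of `hatBack`. [folklore] -/
theorem spaceReflect_apply_self (U : Config d L₀ L G) (x : Site d L₀ L) :
    spaceReflect i c U (x, some i) = (U (hatBack i c x, some i))⁻¹ := by
  rcases x with ⟨t, y⟩
  exact spaceReflect_self i c U t y

omit [TopologicalSpace G] [IsTopologicalGroup G] [CompactSpace G] [MeasurableSpace G]
  [BorelSpace G] in
/-- **Plaquettes not containing the direction `i` are relabelled**:
`plaquette (θU) x μ ν = plaquette U x̂ μ ν` for `μ, ν ≠ i`. [folklore] -/
theorem plaquette_spaceReflect_of_ne_of_ne (U : Config d L₀ L G) (x : Site d L₀ L) {μ ν : Dir d}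
    (hμ : μ ≠ some i) (hν : ν ≠ some i) :
    plaquette (spaceReflect i c U) x μ ν = plaquette U (hatSite i c x) μ ν := by
  simp only [plaquette, spaceReflect_apply_of_ne i c U _ hμ, spaceReflect_apply_of_ne i c U _ hν,
    hatSite_shift_of_ne i c x hμ, hatSite_shift_of_ne i c x hν]

omit [TopologicalSpace G] [IsTopologicalGroup G] [CompactSpace G] [MeasurableSpace G]
  [BorelSpace G] in
/-- **Plaquettes containing the direction `i`**: for `ν ≠ i`,
`plaquette (θU) x i ν = a⁻¹ P⁻¹ a` where `P = plaquette U (hatBack x) i ν` is the corresponding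
plaquette one slice back and `a` its first link. [folklore] -/
theorem plaquette_spaceReflect_some_self (U : Config d L₀ L G) (x : Site d L₀ L) {ν : Dir d}
    (hν : ν ≠ some i) :
    plaquette (spaceReflect i c U) x (some i) ν =
      (U (hatBack i c x, some i))⁻¹ * (plaquette U (hatBack i c x) (some i) ν)⁻¹ *
        U (hatBack i c x, some i) := by
  have h1 : hatSite i c (x.shift (some i)) = hatBack i c x := by
    rw [hatSite_shift_self]; rfl
  simp only [plaquette, spaceReflect_apply_self, spaceReflect_apply_of_ne i c U _ hν, h1,
    hatBack_shift_of_ne i c x hν, hatBack_shift_self, mul_inv_rev, inv_inv, mul_assoc,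
    inv_mul_cancel, mul_one]

variable (ρ : G →* Matrix (Fin N) (Fin N) ℂ)

omit [TopologicalSpace G] [IsTopologicalGroup G] [CompactSpace G] [MeasurableSpace G]
  [BorelSpace G] in
/-- `Re tr ρ` of a plaquette of `θU` not containing `i`. [folklore] -/
theorem trace_re_plaquette_spaceReflect_of_ne_of_ne (U : Config d L₀ L G) (x : Site d L₀ L)
    {μ ν : Dir d} (hμ : μ ≠ some i) (hν : ν ≠ some i) :
    (ρ (plaquette (spaceReflect i c U) x μ ν)).trace.re = (ρ (plaquette U (hatSite i c x) μ ν)).trace.re := by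
  rw [plaquette_spaceReflect_of_ne_of_ne i c U x hμ hν]

omit [TopologicalSpace G] [IsTopologicalGroup G] [CompactSpace G] [MeasurableSpace G]
  [BorelSpace G] in
/-- `Re tr ρ` of a plaquette of `θU` in the plane `(i, ν)` (unitary `ρ`). [folklore] -/
theorem trace_re_plaquette_spaceReflect_some_self (hρu : ∀ g, ρ g ∈ Matrix.unitaryGroup (Fin N) ℂ)
    (U : Config d L₀ L G) (x : Site d L₀ L) {ν : Dir d} (hν : ν ≠ some i) :
    (ρ (plaquette (spaceReflect i c U) x (some i) ν)).trace.re =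
      (ρ (plaquette U (hatBack i c x) (some i) ν)).trace.re := by
  rw [plaquette_spaceReflect_some_self i c U x hν, trace_re_rep_conj, trace_re_rep_inv ρ hρu]

omit [TopologicalSpace G] [IsTopologicalGroup G] [CompactSpace G] [MeasurableSpace G]
  [BorelSpace G] in
/-- `Re tr ρ` of a plaquette of `θU` in the plane `(μ, i)` (unitary `ρ`). [folklore] -/
theorem trace_re_plaquette_spaceReflect_self_right (hρu : ∀ g, ρ g ∈ Matrix.unitaryGroup (Fin N) ℂ)
    (U : Config d L₀ L G) (x : Site d L₀ L) {μ : Dir d} (hμ : μ ≠ some i) :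
    (ρ (plaquette (spaceReflect i c U) x μ (some i))).trace.re =
      (ρ (plaquette U (hatBack i c x) μ (some i))).trace.re := by
  rw [plaquette_swap, trace_re_rep_inv ρ hρu, trace_re_plaquette_spaceReflect_some_self i c ρ hρu U x hμ,
    plaquette_swap U, trace_re_rep_inv ρ hρu]

/-! ### Time-like paths and Polyakov loops under the reflection -/

omit [TopologicalSpace G] [IsTopologicalGroup G] [CompactSpace G] [MeasurableSpace G]
  [BorelSpace G] in
/-- Time-like holonomies are relabelled: `timeHolonomy (θU) n (t, y) = timeHolonomy U n (t, σ y)`.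
[folklore] -/
theorem timeHolonomy_spaceReflect (U : Config d L₀ L G) (n : ℕ) (t : ZMod L₀) (y : Fin d → ZMod L) :
    timeHolonomy (spaceReflect i c U) n (t, y) = timeHolonomy U n (t, sigma i c y) := by
  induction n generalizing t with
  | zero => rfl
  | succ n ih =>
      simp only [timeHolonomy, Site.shift]
      rw [spaceReflect_of_ne i c U t y (by simp), ih]

omit [TopologicalSpace G] [IsTopologicalGroup G] [CompactSpace G] [MeasurableSpace G]
  [BorelSpace G] in
/-- **Polyakov loops are relabelled**: `P_y(θU) = P_{σ y}(U)`. [folklore] -/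
theorem polyakovLine_spaceReflect (U : Config d L₀ L G) (y : Fin d → ZMod L) :
    polyakovLine (spaceReflect i c U) y = polyakovLine U (sigma i c y) :=
  timeHolonomy_spaceReflect i c U L₀ 0 y

omit [TopologicalSpace G] [IsTopologicalGroup G] [CompactSpace G] [MeasurableSpace G]
  [BorelSpace G] in
/-- Traced Polyakov loops are relabelled: `χ(P_y)(θU) = χ(P_{σ y})(U)`. [folklore] -/
theorem polyakovTrace_spaceReflect (U : Config d L₀ L G) (y : Fin d → ZMod L) :
    polyakovTrace ρ (spaceReflect i c U) y = polyakovTrace ρ U (sigma i c y) := by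
  unfold polyakovTrace; rw [polyakovLine_spaceReflect]

/-! ### Gauge skew shifts preserve the a-priori measure

A change of variables `U(ℓ) ↦ a_ℓ(U) · U(ℓ) · b_ℓ(U)` on a block `A` of links whose multipliers
read only links OUTSIDE `A` preserves the product Haar measure (condition on the coordinates off
`A`; on the fibre it is a product of two-sided translations). -/

section SkewShift

variable {ι : Type*} [Fintype ι] [DecidableEq ι]

omit [TopologicalSpace G] [IsTopologicalGroup G] [CompactSpace G] [BorelSpace G] in
/-- **Two-sided gauge skew shifts preserve the product Haar measure.** Let `μ₀` be a left- and
right-invariant probability measure on a measurable group `G`, `A` a set of coordinates of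
`ι → G`, and `a_ℓ, b_ℓ : (ι → G) → G` measurable multipliers depending only on the coordinates
outside `A`. Then `U ↦ (ℓ ↦ if ℓ ∈ A then a_ℓ(U) U(ℓ) b_ℓ(U) else U(ℓ))` preserves `⨂ μ₀`.
[folklore] -/
theorem measurePreserving_skewShift [MeasurableMul₂ G] (μ₀ : Measure G) [IsProbabilityMeasure μ₀]
    [μ₀.IsMulLeftInvariant] [μ₀.IsMulRightInvariant] (A : Finset ι)
    (a b : ι → (ι → G) → G) (ha : ∀ ℓ, Measurable (a ℓ)) (hb : ∀ ℓ, Measurable (b ℓ))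
    (haA : ∀ ℓ, DependsOn (a ℓ) ((Aᶜ : Finset ι) : Set ι))
    (hbA : ∀ ℓ, DependsOn (b ℓ) ((Aᶜ : Finset ι) : Set ι)) :
    MeasurePreserving (fun (U : ι → G) (ℓ : ι) => if ℓ ∈ A then a ℓ U * U ℓ * b ℓ U else U ℓ)
      (Measure.pi fun _ : ι => μ₀) (Measure.pi fun _ : ι => μ₀) := by
  classical
  -- split the coordinates: base = off `A`, fibre = `A`
  set e := MeasurableEquiv.piEquivPiSubtypeProd (fun _ : ι => G) (fun ℓ => ℓ ∉ A) with he
  have hpres : MeasurePreserving e (Measure.pi fun _ : ι => μ₀)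
      ((Measure.pi fun _ : {ℓ : ι // ℓ ∉ A} => μ₀).prod (Measure.pi fun _ : {ℓ : ι // ¬ ℓ ∉ A} => μ₀)) :=
    measurePreserving_piEquivPiSubtypeProd (fun _ : ι => μ₀) (fun ℓ => ℓ ∉ A)
  -- the multipliers as functions of the base
  set emb : ({ℓ : ι // ℓ ∉ A} → G) → (ι → G) := fun r => e.symm (r, fun _ => 1) with hemb
  have hemb_m : Measurable emb := e.symm.measurable.comp (measurable_id.prodMk measurable_const)
  have hread : ∀ (ℓ : ι) (r : {ℓ : ι // ℓ ∉ A} → G) (f : {ℓ : ι // ¬ ℓ ∉ A} → G),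
      a ℓ (e.symm (r, f)) = a ℓ (emb r) ∧ b ℓ (e.symm (r, f)) = b ℓ (emb r) := by
    intro ℓ r f
    have hagree : ∀ j ∈ ((Aᶜ : Finset ι) : Set ι), (e.symm (r, f)) j = (emb r) j := by
      intro j hj
      have hj' : j ∉ A := by simpa using hj
      simp [he, hemb, MeasurableEquiv.piEquivPiSubtypeProd, Equiv.piEquivPiSubtypeProd, hj']
    exact ⟨haA ℓ hagree, hbA ℓ hagree⟩
  -- the skew product on the split coordinates
  set g : ({ℓ : ι // ℓ ∉ A} → G) → ({ℓ : ι // ¬ ℓ ∉ A} → G) → ({ℓ : ι // ¬ ℓ ∉ A} → G) :=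
    fun r f j => a j (emb r) * f j * b j (emb r) with hg
  have hgm : Measurable (Function.uncurry g) := by
    refine measurable_pi_lambda _ fun j => ?_
    exact (((ha j).comp (hemb_m.comp measurable_fst)).mul
      ((measurable_pi_apply j).comp measurable_snd)).mul ((hb j).comp (hemb_m.comp measurable_fst))
  have hgr : ∀ r, Measure.map (g r) (Measure.pi fun _ : {ℓ : ι // ¬ ℓ ∉ A} => μ₀) =
      Measure.pi fun _ : {ℓ : ι // ¬ ℓ ∉ A} => μ₀ := fun r =>
    (measurePreserving_pi (fun _ : {ℓ : ι // ¬ ℓ ∉ A} => μ₀) (fun _ => μ₀) fun j =>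
      ((measurePreserving_mul_right μ₀ (b j (emb r))).comp
        (measurePreserving_mul_left μ₀ (a j (emb r))))).map_eq
  have hskew : MeasurePreserving (fun p : ({ℓ : ι // ℓ ∉ A} → G) × ({ℓ : ι // ¬ ℓ ∉ A} → G) =>
      (p.1, g p.1 p.2)) ((Measure.pi fun _ => μ₀).prod (Measure.pi fun _ => μ₀))
      ((Measure.pi fun _ => μ₀).prod (Measure.pi fun _ => μ₀)) :=
    (MeasurePreserving.id _).skew_product hgm (Filter.Eventually.of_forall hgr)
  have htot := hpres.symm _ |>.comp (hskew.comp hpres)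
  convert htot using 1
  funext U
  funext ℓ
  simp only [Function.comp_apply]
  have hU : e.symm (e U) = U := e.symm_apply_apply U
  by_cases hℓ : ℓ ∈ A
  · have hℓ' : ¬ ℓ ∉ A := fun h => h hℓ
    have h1 := (hread ℓ (e U).1 (e U).2).1
    have h2 := (hread ℓ (e U).1 (e U).2).2
    rw [Prod.mk.eta, hU] at h1 h2
    have h1' : a ℓ U = a ℓ (emb fun x => U ↑x) := h1
    have h2' : b ℓ U = b ℓ (emb fun x => U ↑x) := h2
    simp [he, hg, MeasurableEquiv.piEquivPiSubtypeProd, Equiv.piEquivPiSubtypeProd, hℓ]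
    rw [h1', h2']
  · simp [he, MeasurableEquiv.piEquivPiSubtypeProd, Equiv.piEquivPiSubtypeProd, hℓ]

end SkewShift

/-! ### Gauge transformations of links, plaquettes and time-like paths -/

section Gauge

omit [TopologicalSpace G] [IsTopologicalGroup G] [CompactSpace G] [MeasurableSpace G] [BorelSpace G]

/-- The gauge transformation of a configuration by `g : sites → G`:
`(g · U)(x, μ) = g(x) U(x, μ) g(x + e_μ)⁻¹`. [folklore] -/
def gaugeAct (g : Site d L₀ L → G) (U : Config d L₀ L G) : Config d L₀ L G :=
  fun e => g e.1 * U e * (g (e.1.shift e.2))⁻¹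

/-- Pointwise form of `gaugeAct`. [folklore] -/
@[simp] theorem gaugeAct_apply (g : Site d L₀ L → G) (U : Config d L₀ L G) (x : Site d L₀ L) (μ : Dir d) :
    gaugeAct g U (x, μ) = g x * U (x, μ) * (g (x.shift μ))⁻¹ := rfl

/-- Elementary shifts commute. [folklore] -/
theorem Site.shift_shift_comm (x : Site d L₀ L) (μ ν : Dir d) :
    (x.shift μ).shift ν = (x.shift ν).shift μ := by
  rcases μ with _ | j <;> rcases ν with _ | k <;> simp only [Site.shift, add_right_comm]

/-- **Plaquettes are gauge covariant**: `U_P(g · U) = g(x) U_P(U) g(x)⁻¹`. [folklore] -/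
theorem plaquette_gaugeAct (g : Site d L₀ L → G) (U : Config d L₀ L G) (x : Site d L₀ L) (μ ν : Dir d) :
    plaquette (gaugeAct g U) x μ ν = g x * plaquette U x μ ν * (g x)⁻¹ := by
  simp only [plaquette, gaugeAct_apply, mul_inv_rev, inv_inv, Site.shift_shift_comm x ν μ, mul_assoc,
    inv_mul_cancel_left]

/-- A plaquette depends only on its four links. [folklore] -/
theorem plaquette_congr {U V : Config d L₀ L G} (x : Site d L₀ L) (μ ν : Dir d)
    (h1 : U (x, μ) = V (x, μ)) (h2 : U (x.shift μ, ν) = V (x.shift μ, ν))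
    (h3 : U (x.shift ν, μ) = V (x.shift ν, μ)) (h4 : U (x, ν) = V (x, ν)) :
    plaquette U x μ ν = plaquette V x μ ν := by
  simp only [plaquette, h1, h2, h3, h4]

/-- **Time-like paths are gauge covariant**: `H(g · U) = g(start) H(U) g(end)⁻¹`. [folklore] -/
theorem timeHolonomy_gaugeAct (g : Site d L₀ L → G) (U : Config d L₀ L G) (n : ℕ) (t : ZMod L₀)
    (y : Fin d → ZMod L) :
    timeHolonomy (gaugeAct g U) n (t, y) = g (t, y) * timeHolonomy U n (t, y) * (g (t + n, y))⁻¹ := by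
  induction n generalizing t with
  | zero => simp [timeHolonomy]
  | succ n ih =>
      calc timeHolonomy (gaugeAct g U) (n + 1) (t, y)
          = gaugeAct g U ((t, y), none) * timeHolonomy (gaugeAct g U) n (t + 1, y) := rfl
        _ = g (t, y) * U ((t, y), none) * (g (t + 1, y))⁻¹ *
              (g (t + 1, y) * timeHolonomy U n (t + 1, y) * (g (t + 1 + n, y))⁻¹) := by
            rw [ih]; rfl
        _ = g (t, y) * (U ((t, y), none) * timeHolonomy U n (t + 1, y)) * (g (t + 1 + n, y))⁻¹ := by
            simp only [mul_assoc, inv_mul_cancel_left]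
        _ = g (t, y) * timeHolonomy U (n + 1) (t, y) * (g (t + ((n + 1 : ℕ) : ZMod L₀), y))⁻¹ := by
            push_cast
            rw [show t + 1 + (n : ZMod L₀) = t + (n + 1) by ring]
            rfl


/-- Traced Polyakov loops are gauge invariant. [folklore] -/
theorem polyakovTrace_gaugeAct [NeZero L₀] (g : Site d L₀ L → G) (U : Config d L₀ L G) (y : Fin d → ZMod L) :
    polyakovTrace ρ (gaugeAct g U) y = polyakovTrace ρ U y := by
  unfold polyakovTrace polyakovLine
  rw [timeHolonomy_gaugeAct, ZMod.natCast_self, add_zero, map_mul, map_mul, Matrix.trace_mul_cycle,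
    ← map_mul, inv_mul_cancel, map_one, Matrix.one_mul]

end Gauge

/-! ### The link reflection (`c = 1`, `L = 2n + 2`): slices, crossing links and the gauge
decoupling of the crossing links -/

section LinkDecouple

variable {n : ℕ}

omit [TopologicalSpace G] [IsTopologicalGroup G] [CompactSpace G] [MeasurableSpace G] [BorelSpace G]

/-- The slice (the `i`-th spatial coordinate) of a site. [folklore] -/
def slice (x : Site d L₀ (2 * n + 2)) : ZMod (2 * n + 2) := x.2 i

/-- The site one step back in direction `i`. [folklore] -/
def back (x : Site d L₀ (2 * n + 2)) : Site d L₀ (2 * n + 2) := (x.1, x.2 - Pi.single i 1)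

omit [Group G] in
/-- `back x + eᵢ = x`. [folklore] -/
@[simp] theorem back_shift_self (x : Site d L₀ (2 * n + 2)) : (back i x).shift (some i) = x := by
  simp [back, Site.shift]

omit [Group G] in
/-- `back (x + eᵢ) = x`. [folklore] -/
@[simp] theorem back_shift_self' (x : Site d L₀ (2 * n + 2)) : back i (x.shift (some i)) = x := by
  simp [back, Site.shift]

omit [Group G] in
/-- The slice of a shifted site. [folklore] -/
theorem slice_shift_some_self (x : Site d L₀ (2 * n + 2)) : slice i (x.shift (some i)) = slice i x + 1 := by
  simp [slice, Site.shift]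

omit [Group G] in
/-- Shifts in the other directions (and in time) preserve the slice. [folklore] -/
theorem slice_shift_of_ne (x : Site d L₀ (2 * n + 2)) {μ : Dir d} (hμ : μ ≠ some i) :
    slice i (x.shift μ) = slice i x := by
  rcases μ with _ | j
  · rfl
  · have hj : j ≠ i := fun h => hμ (by rw [h])
    simp [slice, Site.shift, Ne.symm hj]

omit [Group G] in
/-- The slice of `back x`. [folklore] -/
theorem slice_back (x : Site d L₀ (2 * n + 2)) : slice i (back i x) = slice i x - 1 := by
  simp [slice, back]

omit [Group G] in
/-- Small residues are distinct in `ℤ_{2n+2}`: `n + 2 ≠ 0` for `1 ≤ n`. [folklore] -/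
theorem natCast_add_two_ne_zero (hn : 1 ≤ n) : (n : ZMod (2 * n + 2)) + 2 ≠ 0 := by
  intro h
  have h' : ((n + 2 : ℕ) : ZMod (2 * n + 2)) = ((0 : ℕ) : ZMod (2 * n + 2)) := by push_cast; exact h
  have := natCast_injective_of_lt_even (n := n) (by omega) (by omega) h'
  omega

omit [Group G] in
/-- `n + 1 ≠ 0` in `ℤ_{2n+2}`. [folklore] -/
theorem natCast_add_one_ne_zero : (n : ZMod (2 * n + 2)) + 1 ≠ 0 := by
  intro h
  have h' : ((n + 1 : ℕ) : ZMod (2 * n + 2)) = ((0 : ℕ) : ZMod (2 * n + 2)) := by push_cast; exact h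
  have := natCast_injective_of_lt_even (n := n) (by omega) (by omega) h'
  omega

omit [Group G] in
/-- `n + 1 ≠ n + 2` in `ℤ_{2n+2}`. [folklore] -/
theorem natCast_add_one_ne_add_two (hn : 1 ≤ n) : (n : ZMod (2 * n + 2)) + 1 ≠ n + 2 := by
  intro h
  have h' : ((n + 1 : ℕ) : ZMod (2 * n + 2)) = ((n + 2 : ℕ) : ZMod (2 * n + 2)) := by push_cast; exact h
  have := natCast_injective_of_lt_even (n := n) (by omega) (by omega) h'
  omega

omit [Group G] in
/-- `1 ≠ n + 2` in `ℤ_{2n+2}` for `1 ≤ n`. [folklore] -/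
theorem one_ne_natCast_add_two (hn : 1 ≤ n) : (1 : ZMod (2 * n + 2)) ≠ n + 2 := by
  intro h
  have h' : ((1 : ℕ) : ZMod (2 * n + 2)) = ((n + 2 : ℕ) : ZMod (2 * n + 2)) := by push_cast; exact h
  have := natCast_injective_of_lt_even (n := n) (by omega) (by omega) h'
  omega

omit [Group G] in
/-- `1 ≠ 0` in `ℤ_{2n+2}`. [folklore] -/
theorem one_ne_zero_zmod : (1 : ZMod (2 * n + 2)) ≠ 0 := by
  intro h
  have h' : ((1 : ℕ) : ZMod (2 * n + 2)) = ((0 : ℕ) : ZMod (2 * n + 2)) := by push_cast; exact h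
  have := natCast_injective_of_lt_even (n := n) (by omega) (by omega) h'
  omega

/-- A link is a CROSSING link of the link reflection: a link in direction `i` starting in the
slice `0` or in the slice `n + 1`. [folklore] -/
def IsCrossing (e : Site d L₀ (2 * n + 2) × Dir d) : Prop :=
  e.2 = some i ∧ (slice i e.1 = 0 ∨ slice i e.1 = (n + 1 : ℕ))

/-- `IsCrossing` is decidable. [folklore] -/
instance (e : Site d L₀ (2 * n + 2) × Dir d) : Decidable (IsCrossing (i := i) e) := by
  unfold IsCrossing; infer_instance

/-- The partial gauge function of the decoupling: `V₀(x)` (the crossing link starting at `x`) on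
the slice `0`, `V₁(x − eᵢ)⁻¹` (the inverse of the crossing link ending at `x`) on the slice
`n + 2`, and `1` elsewhere. [folklore] -/
def decoupleGauge (U : Config d L₀ (2 * n + 2) G) (x : Site d L₀ (2 * n + 2)) : G :=
  if slice i x = 0 then U (x, some i)
    else if slice i x = (n + 2 : ℕ) then (U (back i x, some i))⁻¹ else 1

/-- **The gauge decoupling of the crossing links**: the partial gauge transformation by
`decoupleGauge U` applied to every NON-crossing link (the crossing links are kept). [folklore] -/
def decouple (U : Config d L₀ (2 * n + 2) G) : Config d L₀ (2 * n + 2) G :=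
  fun e => if IsCrossing i e then U e else gaugeAct (decoupleGauge i U) U e

/-- `decouple` on a crossing link. [folklore] -/
theorem decouple_apply_of_isCrossing (U : Config d L₀ (2 * n + 2) G) {e : Site d L₀ (2 * n + 2) × Dir d}
    (he : IsCrossing i e) : decouple i U e = U e := by
  simp [decouple, he]

/-- `decouple` on a non-crossing link. [folklore] -/
theorem decouple_apply_of_not_isCrossing (U : Config d L₀ (2 * n + 2) G)
    {e : Site d L₀ (2 * n + 2) × Dir d} (he : ¬ IsCrossing i e) :
    decouple i U e = gaugeAct (decoupleGauge i U) U e := by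
  simp [decouple, he]

/-- **Non-crossing plaquettes are conjugated by the decoupling**: if none of the four links of
the plaquette at `x` in the plane `(μ, ν)` is crossing, then
`U_P(decouple U) = g(x) U_P(U) g(x)⁻¹`. [folklore] -/
theorem plaquette_decouple_of_not_isCrossing (U : Config d L₀ (2 * n + 2) G) (x : Site d L₀ (2 * n + 2))
    (μ ν : Dir d) (h1 : ¬ IsCrossing i (x, μ)) (h2 : ¬ IsCrossing i (x.shift μ, ν))
    (h3 : ¬ IsCrossing i (x.shift ν, μ)) (h4 : ¬ IsCrossing i (x, ν)) :
    plaquette (decouple i U) x μ ν =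
      decoupleGauge i U x * plaquette U x μ ν * (decoupleGauge i U x)⁻¹ := by
  rw [plaquette_congr (V := gaugeAct (decoupleGauge i U) U) x μ ν
    (decouple_apply_of_not_isCrossing i U h1) (decouple_apply_of_not_isCrossing i U h2)
    (decouple_apply_of_not_isCrossing i U h3) (decouple_apply_of_not_isCrossing i U h4),
    plaquette_gaugeAct]


/-- `Re tr ρ` of a non-crossing plaquette is unchanged by the decoupling. [folklore] -/
theorem trace_re_plaquette_decouple_of_not_isCrossing (U : Config d L₀ (2 * n + 2) G)
    (x : Site d L₀ (2 * n + 2)) (μ ν : Dir d) (h1 : ¬ IsCrossing i (x, μ))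
    (h2 : ¬ IsCrossing i (x.shift μ, ν)) (h3 : ¬ IsCrossing i (x.shift ν, μ)) (h4 : ¬ IsCrossing i (x, ν)) :
    (ρ (plaquette (decouple i U) x μ ν)).trace.re = (ρ (plaquette U x μ ν)).trace.re := by
  rw [plaquette_decouple_of_not_isCrossing i U x μ ν h1 h2 h3 h4]
  have := trace_re_rep_conj ρ (decoupleGauge i U x)⁻¹ (plaquette U x μ ν)
  rwa [inv_inv] at this


/-- **The crossing plaquettes at the slice `0` become free of the crossing links**: for
`slice x = 0` and `ν ≠ i`, with `1 ≤ n`,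
`U_P(decouple U)(x; i, ν) = V₀(x) · U(x + eᵢ, ν) U(x, ν)⁻¹ · V₀(x)⁻¹`. [folklore] -/
theorem plaquette_decouple_crossing_zero (hn : 1 ≤ n) (U : Config d L₀ (2 * n + 2) G)
    (x : Site d L₀ (2 * n + 2)) (hx : slice i x = 0) {ν : Dir d} (hν : ν ≠ some i) :
    plaquette (decouple i U) x (some i) ν =
      U (x, some i) * (U (x.shift (some i), ν) * (U (x, ν))⁻¹) * (U (x, some i))⁻¹ := by
  have hxν : slice i (x.shift ν) = 0 := by rw [slice_shift_of_ne i x hν, hx]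
  have hc1 : IsCrossing i (x, some i) := ⟨rfl, Or.inl hx⟩
  have hc3 : IsCrossing i (x.shift ν, some i) := ⟨rfl, Or.inl hxν⟩
  have hnc2 : ¬ IsCrossing i (x.shift (some i), ν) := fun h => hν h.1
  have hnc4 : ¬ IsCrossing i (x, ν) := fun h => hν h.1
  have h1slice : slice i (x.shift (some i)) = 1 := by rw [slice_shift_some_self, hx, zero_add]
  have h10 := one_ne_zero_zmod (n := n)
  have h1n := one_ne_natCast_add_two (n := n) hn
  have hg1 : decoupleGauge i U (x.shift (some i)) = 1 := by
    simp [decoupleGauge, h1slice, h10, h1n]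
  have hg1' : decoupleGauge i U ((x.shift ν).shift (some i)) = 1 := by
    have : slice i ((x.shift ν).shift (some i)) = 1 := by rw [slice_shift_some_self, hxν, zero_add]
    simp [decoupleGauge, this, h10, h1n]
  have hg0 : decoupleGauge i U x = U (x, some i) := by simp [decoupleGauge, hx]
  have hg0' : decoupleGauge i U (x.shift ν) = U (x.shift ν, some i) := by simp [decoupleGauge, hxν]
  simp only [plaquette, decouple_apply_of_isCrossing i U hc1, decouple_apply_of_isCrossing i U hc3,
    decouple_apply_of_not_isCrossing i U hnc2, decouple_apply_of_not_isCrossing i U hnc4, gaugeAct_apply,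
    hg1, hg1', hg0, hg0', Site.shift_shift_comm x (some i) ν, inv_one, one_mul, mul_one, mul_inv_rev,
    inv_inv, mul_assoc, inv_mul_cancel_left]

/-- **The crossing plaquettes at the slice `n + 1` become free of the crossing links**: for
`slice x = n + 1` and `ν ≠ i`, with `1 ≤ n`,
`U_P(decouple U)(x; i, ν) = U(x + eᵢ, ν) U(x, ν)⁻¹`. [folklore] -/
theorem plaquette_decouple_crossing_half (hn : 1 ≤ n) (U : Config d L₀ (2 * n + 2) G)
    (x : Site d L₀ (2 * n + 2)) (hx : slice i x = (n + 1 : ℕ)) {ν : Dir d} (hν : ν ≠ some i) :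
    plaquette (decouple i U) x (some i) ν = U (x.shift (some i), ν) * (U (x, ν))⁻¹ := by
  have hxν : slice i (x.shift ν) = (n + 1 : ℕ) := by rw [slice_shift_of_ne i x hν, hx]
  have hc1 : IsCrossing i (x, some i) := ⟨rfl, Or.inr hx⟩
  have hc3 : IsCrossing i (x.shift ν, some i) := ⟨rfl, Or.inr hxν⟩
  have hnc2 : ¬ IsCrossing i (x.shift (some i), ν) := fun h => hν h.1
  have hnc4 : ¬ IsCrossing i (x, ν) := fun h => hν h.1
  have hx' : slice i x = (n : ZMod (2 * n + 2)) + 1 := by push_cast at hx; exact hx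
  have hxν' : slice i (x.shift ν) = (n : ZMod (2 * n + 2)) + 1 := by push_cast at hxν; exact hxν
  have h2slice : slice i (x.shift (some i)) = (n : ZMod (2 * n + 2)) + 2 := by
    rw [slice_shift_some_self, hx']; ring
  have hn20 := natCast_add_two_ne_zero (n := n) hn
  have hn10 := natCast_add_one_ne_zero (n := n)
  have hn12 := natCast_add_one_ne_add_two (n := n) hn
  have hg2 : decoupleGauge i U (x.shift (some i)) = (U (x, some i))⁻¹ := by
    simp [decoupleGauge, h2slice, hn20]
  have hg2' : decoupleGauge i U ((x.shift ν).shift (some i)) = (U (x.shift ν, some i))⁻¹ := by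
    have : slice i ((x.shift ν).shift (some i)) = (n : ZMod (2 * n + 2)) + 2 := by
      rw [slice_shift_some_self, hxν']; ring
    simp [decoupleGauge, this, hn20]
  have hg0 : decoupleGauge i U x = 1 := by simp [decoupleGauge, hx', hn10, hn12]
  have hg0' : decoupleGauge i U (x.shift ν) = 1 := by simp [decoupleGauge, hxν', hn10, hn12]
  simp only [plaquette, decouple_apply_of_isCrossing i U hc1, decouple_apply_of_isCrossing i U hc3,
    decouple_apply_of_not_isCrossing i U hnc2, decouple_apply_of_not_isCrossing i U hnc4, gaugeAct_apply,
    hg2, hg2', hg0, hg0', Site.shift_shift_comm x (some i) ν, inv_one, one_mul, mul_one, inv_inv,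
    mul_assoc, mul_inv_cancel_left]

/-- Time-like links are never crossing. [folklore] -/
theorem not_isCrossing_none (x : Site d L₀ (2 * n + 2)) : ¬ IsCrossing i (x, none) := fun h =>
  Option.some_ne_none i h.1.symm


/-- **Traced Polyakov loops are unchanged by the decoupling.** [folklore] -/
theorem polyakovTrace_decouple [NeZero L₀] (U : Config d L₀ (2 * n + 2) G) (y : Fin d → ZMod (2 * n + 2)) :
    polyakovTrace ρ (decouple i U) y = polyakovTrace ρ U y := by
  have h : polyakovTrace ρ (decouple i U) y = polyakovTrace ρ (gaugeAct (decoupleGauge i U) U) y := by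
    unfold polyakovTrace polyakovLine
    rw [timeHolonomy_congr (V := gaugeAct (decoupleGauge i U) U) L₀ 0 y fun j _ =>
      decouple_apply_of_not_isCrossing i U (not_isCrossing_none i _)]
  rw [h, polyakovTrace_gaugeAct]


/-- **The twisted slice-`0` time-like links become untwisted**: for `slice x = 0`,
`V₀(x)⁻¹ · (decouple U)(x, time) · V₀(x + e_time) = U(x, time)`. [folklore] -/
theorem conj_decouple_time_of_slice_zero (U : Config d L₀ (2 * n + 2) G) (x : Site d L₀ (2 * n + 2))
    (hx : slice i x = 0) :
    (U (x, some i))⁻¹ * decouple i U (x, none) * U (x.shift none, some i) = U (x, none) := by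
  have hx' : slice i (x.shift none) = 0 := by rw [slice_shift_of_ne i x (by simp), hx]
  rw [decouple_apply_of_not_isCrossing i U (not_isCrossing_none i x), gaugeAct_apply]
  simp [decoupleGauge, hx, hx', mul_assoc]

end LinkDecouple

/-! ### The decoupling preserves the a-priori measure -/

section DecoupleMeasure

variable {n : ℕ} [SecondCountableTopology G]

omit [CompactSpace G] [SecondCountableTopology G] in
/-- The partial gauge function is measurable in the configuration. [folklore] -/
theorem measurable_decoupleGauge (x : Site d L₀ (2 * n + 2)) :
    Measurable fun U : Config d L₀ (2 * n + 2) G => decoupleGauge i U x := by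
  unfold decoupleGauge
  split_ifs
  · exact measurable_pi_apply _
  · exact (measurable_pi_apply _).inv
  · exact measurable_const

omit [TopologicalSpace G] [IsTopologicalGroup G] [CompactSpace G] [MeasurableSpace G] [BorelSpace G]
  [SecondCountableTopology G] in
/-- The partial gauge function reads only crossing links. [folklore] -/
theorem dependsOn_decoupleGauge [NeZero L₀] (x : Site d L₀ (2 * n + 2)) :
    DependsOn (fun U : Config d L₀ (2 * n + 2) G => decoupleGauge i U x)
      ((Finset.univ.filter fun e => IsCrossing i e : Finset (Site d L₀ (2 * n + 2) × Dir d)) :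
        Set (Site d L₀ (2 * n + 2) × Dir d)) := by
  intro U V h
  unfold decoupleGauge
  split_ifs with h0 h2
  · exact h _ (by simp only [Finset.coe_filter, Finset.mem_univ, true_and, Set.mem_setOf_eq]; exact ⟨rfl, Or.inl h0⟩)
  · have : slice i (back i x) = (n + 1 : ℕ) := by
      rw [slice_back, h2]; push_cast; ring
    show (U (back i x, some i))⁻¹ = (V (back i x, some i))⁻¹
    rw [h _ (by simp only [Finset.coe_filter, Finset.mem_univ, true_and, Set.mem_setOf_eq]; exact ⟨rfl, Or.inr this⟩)]
  · rfl

/-- **The gauge decoupling preserves the a-priori measure.** [folklore] -/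
theorem measurePreserving_decouple [NeZero L₀] :
    MeasurePreserving (decouple (L₀ := L₀) (G := G) i) (haar d L₀ (2 * n + 2) G) (haar d L₀ (2 * n + 2) G) := by
  classical
  have key := measurePreserving_skewShift (ι := Site d L₀ (2 * n + 2) × Dir d) (G := G)
    (Literature.MathematicalPhysics.QuantumFieldTheory.haarProbability G)
    (Finset.univ.filter fun e => ¬ IsCrossing i e)
    (fun e U => decoupleGauge i U e.1) (fun e U => (decoupleGauge i U (e.1.shift e.2))⁻¹)
    (fun e => measurable_decoupleGauge i e.1) (fun e => (measurable_decoupleGauge i _).inv)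
    (fun e => (dependsOn_decoupleGauge i e.1).mono fun f hf => by
      simp only [Finset.coe_filter, Finset.mem_univ, true_and, Set.mem_setOf_eq] at hf
      simp [hf])
    (fun e => by
      have h := dependsOn_decoupleGauge (L₀ := L₀) (G := G) i (e.1.shift e.2)
      intro U V hUV
      have e1 : decoupleGauge i U (e.1.shift e.2) = decoupleGauge i V (e.1.shift e.2) :=
        h (fun f hf => hUV f (by
          simp only [Finset.coe_filter, Finset.mem_univ, true_and, Set.mem_setOf_eq] at hf
          simp [hf]))
      show (decoupleGauge i U (e.1.shift e.2))⁻¹ = (decoupleGauge i V (e.1.shift e.2))⁻¹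
      rw [e1])
  unfold haar
  convert key using 1
  funext U e
  by_cases he : IsCrossing i e
  · rw [decouple_apply_of_isCrossing i U he]; simp [he]
  · rw [decouple_apply_of_not_isCrossing i U he]; simp [he, gaugeAct]

end DecoupleMeasure

/-! ### The Wilson action sorted by slices: in-slice and spanning plaquette terms -/

section Terms

variable {n : ℕ} (JE JM : ℝ)

/-- The in-slice plaquette terms based at `x` (planes not containing the direction `i`):
`J_E Σ_{j ≠ i} Re tr ρ(U_{x;0j}) + J_M Σ_{j<k, i ∉ {j,k}} Re tr ρ(U_{x;jk})`. [folklore] -/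
def inTerm (U : Config d L₀ (2 * n + 2) G) (x : Site d L₀ (2 * n + 2)) : ℝ :=
  JE * ∑ j ∈ Finset.univ.filter (fun j : Fin d => j ≠ i), (ρ (plaquette U x none (some j))).trace.re +
    JM * ∑ p ∈ Finset.univ.filter (fun p : {p : Fin d × Fin d // p.1 < p.2} => p.1.1 ≠ i ∧ p.1.2 ≠ i),
      (ρ (plaquette U x (some p.1.1) (some p.1.2))).trace.re

/-- The spanning plaquette terms based at `x` (planes containing the direction `i`; these
plaquettes span the slices of `x` and of `x + eᵢ`). [folklore] -/
def spTerm (U : Config d L₀ (2 * n + 2) G) (x : Site d L₀ (2 * n + 2)) : ℝ :=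
  JE * (ρ (plaquette U x none (some i))).trace.re +
    JM * ∑ p ∈ Finset.univ.filter (fun p : {p : Fin d × Fin d // p.1 < p.2} => p.1.1 = i ∨ p.1.2 = i),
      (ρ (plaquette U x (some p.1.1) (some p.1.2))).trace.re

/-- The "other" direction of a spatial plane containing `i`. [folklore] -/
def otherDir (p : {p : Fin d × Fin d // p.1 < p.2}) : Fin d := if p.1.1 = i then p.1.2 else p.1.1

/-- The axial (crossing-link-free) form of the spanning terms: each plaquette in a plane
`(i, ν)` based at `x` is replaced by the "degenerate plaquette" `U(x + eᵢ, ν) U(x, ν)⁻¹`.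
[folklore] -/
def axTerm (U : Config d L₀ (2 * n + 2) G) (x : Site d L₀ (2 * n + 2)) : ℝ :=
  JE * (ρ (U (x.shift (some i), none) * (U (x, none))⁻¹)).trace.re +
    JM * ∑ p ∈ Finset.univ.filter (fun p : {p : Fin d × Fin d // p.1 < p.2} => p.1.1 = i ∨ p.1.2 = i),
      (ρ (U (x.shift (some i), some (otherDir i p)) * (U (x, some (otherDir i p)))⁻¹)).trace.re

omit [TopologicalSpace G] [IsTopologicalGroup G] [CompactSpace G] [MeasurableSpace G] [BorelSpace G] in
/-- **The action as a sum of in-slice and spanning terms.** [folklore] -/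
theorem minusAction_eq_sum_terms [NeZero L₀] (U : Config d L₀ (2 * n + 2) G) :
    minusAction ρ JE JM U = ∑ x, (inTerm i ρ JE JM U x + spTerm i ρ JE JM U x) := by
  unfold minusAction inTerm spTerm
  rw [Finset.sum_add_distrib, Finset.mul_sum, Finset.mul_sum]
  have hE : ∀ x : Site d L₀ (2 * n + 2), ∑ j, (ρ (plaquette U x none (some j))).trace.re =
      ∑ j ∈ Finset.univ.filter (fun j : Fin d => j ≠ i), (ρ (plaquette U x none (some j))).trace.re +
        (ρ (plaquette U x none (some i))).trace.re := by
    intro x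
    rw [← Finset.sum_filter_add_sum_filter_not Finset.univ (fun j : Fin d => j ≠ i)]
    congr 1
    have : Finset.univ.filter (fun j : Fin d => ¬ j ≠ i) = {i} := by ext j; simp
    rw [this, Finset.sum_singleton]
  have hM : ∀ x : Site d L₀ (2 * n + 2),
      ∑ p : {p : Fin d × Fin d // p.1 < p.2}, (ρ (plaquette U x (some p.1.1) (some p.1.2))).trace.re =
      ∑ p ∈ Finset.univ.filter (fun p : {p : Fin d × Fin d // p.1 < p.2} => p.1.1 ≠ i ∧ p.1.2 ≠ i),
          (ρ (plaquette U x (some p.1.1) (some p.1.2))).trace.re +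
        ∑ p ∈ Finset.univ.filter (fun p : {p : Fin d × Fin d // p.1 < p.2} => p.1.1 = i ∨ p.1.2 = i),
          (ρ (plaquette U x (some p.1.1) (some p.1.2))).trace.re := by
    intro x
    rw [← Finset.sum_filter_add_sum_filter_not Finset.univ
      (fun p : {p : Fin d × Fin d // p.1 < p.2} => p.1.1 ≠ i ∧ p.1.2 ≠ i)]
    congr 1
    refine Finset.sum_congr ?_ fun _ _ => rfl
    ext p; simp only [Finset.mem_filter, Finset.mem_univ, true_and, not_and_or, not_not]
  simp_rw [hE, hM, mul_add, Finset.sum_add_distrib]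
  simp only [Finset.mul_sum]
  ring

omit [TopologicalSpace G] [IsTopologicalGroup G] [CompactSpace G] [MeasurableSpace G] [BorelSpace G] in
/-- **In-slice terms are unchanged by the decoupling** (in-slice plaquettes contain no link in
direction `i`). [folklore] -/
theorem inTerm_decouple (U : Config d L₀ (2 * n + 2) G) (x : Site d L₀ (2 * n + 2)) :
    inTerm i ρ JE JM (decouple i U) x = inTerm i ρ JE JM U x := by
  unfold inTerm
  congr 1
  · congr 1
    refine Finset.sum_congr rfl fun j hj => ?_
    have hj' : (some j : Dir d) ≠ some i := by
      simp only [Finset.mem_filter, Finset.mem_univ, true_and] at hj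
      exact fun h => hj (Option.some_injective _ h)
    exact trace_re_plaquette_decouple_of_not_isCrossing i ρ U x _ _ (not_isCrossing_none i x)
      (fun h => hj' h.1) (not_isCrossing_none i _) (fun h => hj' h.1)
  · congr 1
    refine Finset.sum_congr rfl fun p hp => ?_
    simp only [Finset.mem_filter, Finset.mem_univ, true_and] at hp
    have h1 : (some p.1.1 : Dir d) ≠ some i := fun h => hp.1 (Option.some_injective _ h)
    have h2 : (some p.1.2 : Dir d) ≠ some i := fun h => hp.2 (Option.some_injective _ h)
    exact trace_re_plaquette_decouple_of_not_isCrossing i ρ U x _ _ (fun h => h1 h.1)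
      (fun h => h2 h.1) (fun h => h1 h.1) (fun h => h2 h.1)

omit [TopologicalSpace G] [IsTopologicalGroup G] [CompactSpace G] [MeasurableSpace G] [BorelSpace G] in
/-- **Spanning terms away from the crossing slices are unchanged by the decoupling.** [folklore] -/
theorem spTerm_decouple_of_not_crossing (U : Config d L₀ (2 * n + 2) G) (x : Site d L₀ (2 * n + 2))
    (hx0 : slice i x ≠ 0) (hx1 : slice i x ≠ (n + 1 : ℕ)) :
    spTerm i ρ JE JM (decouple i U) x = spTerm i ρ JE JM U x := by
  have hnc : ∀ {μ : Dir d} (hμ : μ ≠ some i), ¬ IsCrossing i (x.shift μ, some i) := by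
    intro μ hμ h
    rw [IsCrossing, slice_shift_of_ne i x hμ] at h
    rcases h.2 with h0 | h1
    · exact hx0 h0
    · exact hx1 h1
  have hncx : ¬ IsCrossing i (x, some i) := fun h => by
    rcases h.2 with h0 | h1
    · exact hx0 h0
    · exact hx1 h1
  unfold spTerm
  congr 1
  · congr 1
    exact trace_re_plaquette_decouple_of_not_isCrossing i ρ U x _ _ (not_isCrossing_none i x)
      (hnc (by simp)) (not_isCrossing_none i _) hncx
  · congr 1
    refine Finset.sum_congr rfl fun p hp => ?_
    simp only [Finset.mem_filter, Finset.mem_univ, true_and] at hp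
    rcases hp with h | h
    · have h2 : (some p.1.2 : Dir d) ≠ some i := fun h' => by
        have := Option.some_injective _ h'
        have hlt := p.2
        rw [this, ← h] at hlt
        exact lt_irrefl _ hlt
      rw [h]
      exact trace_re_plaquette_decouple_of_not_isCrossing i ρ U x _ _ hncx (fun h' => h2 h'.1)
        (hnc h2) (fun h' => h2 h'.1)
    · have h1 : (some p.1.1 : Dir d) ≠ some i := fun h' => by
        have := Option.some_injective _ h'
        have hlt := p.2
        rw [this, h] at hlt
        exact lt_irrefl _ hlt
      rw [h]
      exact trace_re_plaquette_decouple_of_not_isCrossing i ρ U x _ _ (fun h' => h1 h'.1) (hnc h1)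
        (fun h' => h1 h'.1) hncx

omit [TopologicalSpace G] [IsTopologicalGroup G] [CompactSpace G] [MeasurableSpace G] [BorelSpace G] in
/-- **Spanning terms at the crossing slices become axial** (unitary `ρ`, `1 ≤ n`). [folklore] -/
theorem spTerm_decouple_of_crossing (hρu : ∀ g, ρ g ∈ Matrix.unitaryGroup (Fin N) ℂ) (hn : 1 ≤ n)
    (U : Config d L₀ (2 * n + 2) G) (x : Site d L₀ (2 * n + 2))
    (hx : slice i x = 0 ∨ slice i x = (n + 1 : ℕ)) :
    spTerm i ρ JE JM (decouple i U) x = axTerm i ρ JE JM U x := by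
  -- the plaquette in the plane `(i, ν)` and its reverse
  have key : ∀ {ν : Dir d} (hν : ν ≠ some i),
      (ρ (plaquette (decouple i U) x (some i) ν)).trace.re =
        (ρ (U (x.shift (some i), ν) * (U (x, ν))⁻¹)).trace.re := by
    intro ν hν
    rcases hx with h0 | h1
    · rw [plaquette_decouple_crossing_zero i hn U x h0 hν]
      have := trace_re_rep_conj ρ (U (x, some i))⁻¹ (U (x.shift (some i), ν) * (U (x, ν))⁻¹)
      rwa [inv_inv] at this
    · rw [plaquette_decouple_crossing_half i hn U x h1 hν]
  unfold spTerm axTerm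
  congr 1
  · congr 1
    rw [plaquette_swap, trace_re_rep_inv ρ hρu, key (by simp)]
  · congr 1
    refine Finset.sum_congr rfl fun p hp => ?_
    simp only [Finset.mem_filter, Finset.mem_univ, true_and] at hp
    by_cases h : p.1.1 = i
    · have h2 : (some p.1.2 : Dir d) ≠ some i := fun h' => by
        have := Option.some_injective _ h'
        have hlt := p.2
        rw [this, ← h] at hlt
        exact lt_irrefl _ hlt
      simp only [otherDir, h, if_true]
      exact key h2
    · have h' : p.1.2 = i := hp.resolve_left h
      have h1 : (some p.1.1 : Dir d) ≠ some i := fun h'' => h (Option.some_injective _ h'')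
      simp only [otherDir, h, if_false]
      rw [h', plaquette_swap, trace_re_rep_inv ρ hρu]
      exact key h1

omit [TopologicalSpace G] [IsTopologicalGroup G] [CompactSpace G] [MeasurableSpace G] [BorelSpace G] in
/-- **In-slice terms under the reflection**: `inTerm (θU) x = inTerm U x̂`. [folklore] -/
theorem inTerm_spaceReflect (c : ZMod (2 * n + 2)) (U : Config d L₀ (2 * n + 2) G) (x : Site d L₀ (2 * n + 2)) :
    inTerm i ρ JE JM (spaceReflect i c U) x = inTerm i ρ JE JM U (hatSite i c x) := by
  unfold inTerm
  congr 1
  · congr 1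
    refine Finset.sum_congr rfl fun j hj => ?_
    simp only [Finset.mem_filter, Finset.mem_univ, true_and] at hj
    have hj' : (some j : Dir d) ≠ some i := fun h => hj (Option.some_injective _ h)
    exact trace_re_plaquette_spaceReflect_of_ne_of_ne i c ρ U x (by simp) hj'
  · congr 1
    refine Finset.sum_congr rfl fun p hp => ?_
    simp only [Finset.mem_filter, Finset.mem_univ, true_and] at hp
    exact trace_re_plaquette_spaceReflect_of_ne_of_ne i c ρ U x
      (fun h => hp.1 (Option.some_injective _ h)) (fun h => hp.2 (Option.some_injective _ h))

omit [TopologicalSpace G] [IsTopologicalGroup G] [CompactSpace G] [MeasurableSpace G] [BorelSpace G] in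
/-- **Spanning terms under the reflection** (unitary `ρ`): `spTerm (θU) x = spTerm U (hatBack x)`.
[folklore] -/
theorem spTerm_spaceReflect (hρu : ∀ g, ρ g ∈ Matrix.unitaryGroup (Fin N) ℂ) (c : ZMod (2 * n + 2))
    (U : Config d L₀ (2 * n + 2) G) (x : Site d L₀ (2 * n + 2)) :
    spTerm i ρ JE JM (spaceReflect i c U) x = spTerm i ρ JE JM U (hatBack i c x) := by
  unfold spTerm
  congr 1
  · congr 1
    exact trace_re_plaquette_spaceReflect_self_right i c ρ hρu U x (by simp)
  · congr 1
    refine Finset.sum_congr rfl fun p hp => ?_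
    simp only [Finset.mem_filter, Finset.mem_univ, true_and] at hp
    by_cases h : p.1.1 = i
    · have h2 : (some p.1.2 : Dir d) ≠ some i := fun h' => by
        have := Option.some_injective _ h'
        have hlt := p.2
        rw [this, ← h] at hlt
        exact lt_irrefl _ hlt
      rw [h]
      exact trace_re_plaquette_spaceReflect_some_self i c ρ hρu U x h2
    · have h' : p.1.2 = i := hp.resolve_left h
      have h1 : (some p.1.1 : Dir d) ≠ some i := fun h'' => h (Option.some_injective _ h'')
      rw [h']
      exact trace_re_plaquette_spaceReflect_self_right i c ρ hρu U x h1

end Terms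

/-! ### The link reflection `θ₁`: the two half-spaces, reindexing, and the decoupled action -/

section LinkHalves

variable {n : ℕ}

omit [Group G] in
/-- The slice of the reflected site: `slice x̂ = 1 − slice x`. [folklore] -/
theorem slice_hatSite_one (x : Site d L₀ (2 * n + 2)) : slice i (hatSite i 1 x) = 1 - slice i x := by
  simp [slice, hatSite]

omit [Group G] in
/-- The slice of `hatBack x` for the link reflection: `−slice x`. [folklore] -/
theorem slice_hatBack_one (x : Site d L₀ (2 * n + 2)) : slice i (hatBack i 1 x) = -slice i x := by
  simp [slice, hatBack]

omit [Group G] in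
/-- `hatSite` is an involution. [folklore] -/
@[simp] theorem hatSite_hatSite (c : ZMod (2 * n + 2)) (x : Site d L₀ (2 * n + 2)) :
    hatSite i c (hatSite i c x) = x := by
  simp [hatSite]

omit [Group G] in
/-- `hatBack` is an involution. [folklore] -/
@[simp] theorem hatBack_hatBack (c : ZMod (2 * n + 2)) (x : Site d L₀ (2 * n + 2)) :
    hatBack i c (hatBack i c x) = x := by
  rcases x with ⟨t, y⟩
  simp only [hatBack]
  rw [sigma_sigma_sub_single]

omit [Group G] in
/-- `(1 − s).val` in `ℤ_{2n+2}`. [folklore] -/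
theorem val_one_sub_of_pos (s : ZMod (2 * n + 2)) :
    (1 - s).val = (2 * n + 3 - s.val) % (2 * n + 2) := by
  have hlt := ZMod.val_lt s
  have h1 : (1 - s : ZMod (2 * n + 2)) = ((2 * n + 3 - s.val : ℕ) : ZMod (2 * n + 2)) := by
    have h2 : ((2 * n + 3 - s.val : ℕ) : ZMod (2 * n + 2)) + (s.val : ℕ) = 1 := by
      rw [← Nat.cast_add, show 2 * n + 3 - s.val + s.val = (2 * n + 2) + 1 by omega, Nat.cast_add,
        ZMod.natCast_self, zero_add, Nat.cast_one]
    rw [ZMod.natCast_zmod_val] at h2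
    linear_combination -h2
  rw [h1, ZMod.val_natCast]

/-- The POSITIVE in-slice region of `θ₁`: slices `1, …, n + 1`. [folklore] -/
def PosIn (x : Site d L₀ (2 * n + 2)) : Prop := 1 ≤ (slice i x).val ∧ (slice i x).val ≤ n + 1

/-- The POSITIVE spanning region of `θ₁`: slices `1, …, n`. [folklore] -/
def PosSp (x : Site d L₀ (2 * n + 2)) : Prop := 1 ≤ (slice i x).val ∧ (slice i x).val ≤ n

/-- The CROSSING slices of `θ₁`: `0` and `n + 1`. [folklore] -/
def CrossSl (x : Site d L₀ (2 * n + 2)) : Prop := slice i x = 0 ∨ slice i x = (n + 1 : ℕ)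

/-- `PosIn` is decidable. [folklore] -/
instance (x : Site d L₀ (2 * n + 2)) : Decidable (PosIn (i := i) x) := by unfold PosIn; infer_instance
/-- `PosSp` is decidable. [folklore] -/
instance (x : Site d L₀ (2 * n + 2)) : Decidable (PosSp (i := i) x) := by unfold PosSp; infer_instance
/-- `CrossSl` is decidable. [folklore] -/
instance (x : Site d L₀ (2 * n + 2)) : Decidable (CrossSl (i := i) x) := by unfold CrossSl; infer_instance

omit [Group G] in
/-- **Reindexing the in-slice regions**: `x̂` is positive iff `x` is not. [folklore] -/
theorem posIn_hatSite_iff (x : Site d L₀ (2 * n + 2)) : PosIn i (hatSite i 1 x) ↔ ¬ PosIn i x := by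
  unfold PosIn
  rw [slice_hatSite_one]
  have hlt := ZMod.val_lt (slice i x)
  by_cases h0 : (slice i x).val = 0
  · have hs : slice i x = 0 := (ZMod.val_eq_zero _).1 h0
    haveI : Fact (1 < 2 * n + 2) := ⟨by omega⟩
    rw [hs, sub_zero, ZMod.val_one, ZMod.val_zero]
    omega
  · rw [val_one_sub_of_pos]
    by_cases h1 : (slice i x).val = 1
    · rw [h1, show 2 * n + 3 - 1 = (2 * n + 2) by omega, Nat.mod_self]; omega
    · rw [Nat.mod_eq_of_lt (by omega)]; omega

omit [Group G] in
/-- **Reindexing the spanning regions**: `hatBack x` is positive iff `x` is neither positive nor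
crossing (i.e. lies in the negative spanning region). [folklore] -/
theorem posSp_hatBack_iff (hn : 1 ≤ n) (x : Site d L₀ (2 * n + 2)) :
    PosSp i (hatBack i 1 x) ↔ ¬ PosSp i x ∧ ¬ CrossSl i x := by
  unfold PosSp CrossSl
  rw [slice_hatBack_one]
  have hlt := ZMod.val_lt (slice i x)
  have hn1 : ((n + 1 : ℕ) : ZMod (2 * n + 2)).val = n + 1 := ZMod.val_cast_of_lt (by omega)
  by_cases h0 : (slice i x).val = 0
  · have hs : slice i x = 0 := (ZMod.val_eq_zero _).1 h0
    rw [hs, neg_zero, ZMod.val_zero]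
    simp
  · have hs0 : slice i x ≠ 0 := fun h => h0 (by rw [h, ZMod.val_zero])
    rw [val_neg_of_pos_even (by omega)]
    have hiff : slice i x = ((n + 1 : ℕ) : ZMod (2 * n + 2)) ↔ (slice i x).val = n + 1 := by
      constructor
      · intro h; rw [h, hn1]
      · intro h; apply ZMod.val_injective; rw [hn1, h]
    rw [hiff]
    constructor
    · rintro ⟨h1, h2⟩; refine ⟨by omega, ?_⟩; push Not; exact ⟨hs0, by omega⟩
    · rintro ⟨h1, h2⟩; push Not at h2; omega

variable (JE JM : ℝ)

/-- The POSITIVE part of the exponent of the Wilson weight for `θ₁`: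
`B₊(U) = Σ_{x : 1 ≤ slice ≤ n+1} inTerm + Σ_{x : 1 ≤ slice ≤ n} spTerm`. [folklore] -/
def bPlus [NeZero L₀] (U : Config d L₀ (2 * n + 2) G) : ℝ :=
  ∑ x ∈ Finset.univ.filter (fun x => PosIn i x), inTerm i ρ JE JM U x +
    ∑ x ∈ Finset.univ.filter (fun x => PosSp i x), spTerm i ρ JE JM U x

/-- The CROSSING part (in axial form): `X(U) = Σ_{x : slice ∈ {0, n+1}} axTerm`. [folklore] -/
def xCross [NeZero L₀] (U : Config d L₀ (2 * n + 2) G) : ℝ :=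
  ∑ x ∈ Finset.univ.filter (fun x => CrossSl i x), axTerm i ρ JE JM U x

omit [TopologicalSpace G] [IsTopologicalGroup G] [CompactSpace G] [MeasurableSpace G] [BorelSpace G] in
/-- **The decoupled Wilson action in reflection-positive form (link reflection)**: for a unitary
`ρ` and `1 ≤ n`,
`−S(decouple U) = B₊(U) + B₊(θ₁ U) + X(U)`. [folklore] -/
theorem minusAction_decouple [NeZero L₀] (hρu : ∀ g, ρ g ∈ Matrix.unitaryGroup (Fin N) ℂ) (hn : 1 ≤ n)
    (U : Config d L₀ (2 * n + 2) G) :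
    minusAction ρ JE JM (decouple i U) =
      bPlus i ρ JE JM U + bPlus i ρ JE JM (spaceReflect i 1 U) + xCross i ρ JE JM U := by
  classical
  rw [minusAction_eq_sum_terms i ρ JE JM, Finset.sum_add_distrib]
  -- in-slice terms: unchanged, then split into `±` and reindex the `−` part by `x ↦ x̂`
  have hIn : ∑ x, inTerm i ρ JE JM (decouple i U) x =
      ∑ x ∈ Finset.univ.filter (fun x => PosIn i x), inTerm i ρ JE JM U x +
        ∑ x ∈ Finset.univ.filter (fun x => PosIn i x), inTerm i ρ JE JM (spaceReflect i 1 U) x := by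
    simp_rw [inTerm_decouple]
    rw [← Finset.sum_filter_add_sum_filter_not Finset.univ (fun x => PosIn i x)]
    congr 1
    refine Finset.sum_nbij' (hatSite i 1) (hatSite i 1) (fun x hx => ?_) (fun x hx => ?_)
      (fun x _ => hatSite_hatSite i 1 x) (fun x _ => hatSite_hatSite i 1 x) (fun x _ => ?_)
    · simp only [Finset.mem_filter, Finset.mem_univ, true_and] at hx ⊢
      exact (posIn_hatSite_iff i x).2 hx
    · simp only [Finset.mem_filter, Finset.mem_univ, true_and] at hx ⊢
      have h := posIn_hatSite_iff i (hatSite i 1 x)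
      rw [hatSite_hatSite] at h
      exact h.1 hx
    · rw [inTerm_spaceReflect, hatSite_hatSite]
  -- spanning terms: split off the crossing slices, the rest splits into `±`
  have hSp : ∑ x, spTerm i ρ JE JM (decouple i U) x =
      ∑ x ∈ Finset.univ.filter (fun x => PosSp i x), spTerm i ρ JE JM U x +
        ∑ x ∈ Finset.univ.filter (fun x => PosSp i x), spTerm i ρ JE JM (spaceReflect i 1 U) x +
        xCross i ρ JE JM U := by
    rw [← Finset.sum_filter_add_sum_filter_not Finset.univ (fun x => CrossSl i x)]
    have hcr : ∑ x ∈ Finset.univ.filter (fun x => CrossSl i x), spTerm i ρ JE JM (decouple i U) x =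
        xCross i ρ JE JM U := by
      unfold xCross
      refine Finset.sum_congr rfl fun x hx => ?_
      simp only [Finset.mem_filter, Finset.mem_univ, true_and] at hx
      exact spTerm_decouple_of_crossing i ρ JE JM hρu hn U x hx
    have hncr : ∑ x ∈ Finset.univ.filter (fun x => ¬ CrossSl i x), spTerm i ρ JE JM (decouple i U) x =
        ∑ x ∈ Finset.univ.filter (fun x => ¬ CrossSl i x), spTerm i ρ JE JM U x := by
      refine Finset.sum_congr rfl fun x hx => ?_
      simp only [Finset.mem_filter, Finset.mem_univ, true_and, CrossSl, not_or] at hx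
      exact spTerm_decouple_of_not_crossing i ρ JE JM U x hx.1 hx.2
    have hps : Finset.univ.filter (fun x : Site d L₀ (2 * n + 2) => ¬ CrossSl i x ∧ PosSp i x) =
        Finset.univ.filter (fun x => PosSp i x) := by
      ext x
      simp only [Finset.mem_filter, Finset.mem_univ, true_and, and_iff_right_iff_imp]
      intro hx hc
      unfold PosSp at hx
      rcases hc with h0 | h1
      · rw [h0, ZMod.val_zero] at hx; omega
      · rw [h1, ZMod.val_cast_of_lt (by omega)] at hx; omega
    have hneg : ∑ x ∈ Finset.univ.filter (fun x : Site d L₀ (2 * n + 2) => ¬ CrossSl i x ∧ ¬ PosSp i x),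
        spTerm i ρ JE JM U x =
        ∑ x ∈ Finset.univ.filter (fun x => PosSp i x), spTerm i ρ JE JM (spaceReflect i 1 U) x := by
      refine Finset.sum_nbij' (hatBack i 1) (hatBack i 1) (fun x hx => ?_) (fun x hx => ?_)
        (fun x _ => hatBack_hatBack i 1 x) (fun x _ => hatBack_hatBack i 1 x) (fun x _ => ?_)
      · simp only [Finset.mem_filter, Finset.mem_univ, true_and] at hx ⊢
        rw [posSp_hatBack_iff i hn]
        exact ⟨hx.2, hx.1⟩
      · simp only [Finset.mem_filter, Finset.mem_univ, true_and] at hx ⊢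
        have h := posSp_hatBack_iff i hn (hatBack i 1 x)
        rw [hatBack_hatBack] at h
        obtain ⟨h1, h2⟩ := h.1 hx
        exact ⟨h2, h1⟩
      · rw [spTerm_spaceReflect i ρ JE JM hρu 1 U, hatBack_hatBack]
    rw [hcr, hncr, ← Finset.sum_filter_add_sum_filter_not (Finset.univ.filter fun x => ¬ CrossSl i x)
      (fun x => PosSp i x), Finset.filter_filter, Finset.filter_filter, hps, hneg]
    ring
  rw [hIn, hSp]
  unfold bPlus
  ring

/-! ### The positive links of `θ₁`, dependence and continuity -/

/-- The POSITIVE links of the link reflection `θ₁`: in-slice links of the slices `1, …, n + 1`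
and links in direction `i` starting in the slices `1, …, n`. [folklore] -/
def posLinks [NeZero L₀] : Finset (Site d L₀ (2 * n + 2) × Dir d) :=
  Finset.univ.filter fun e => (e.2 ≠ some i ∧ PosIn i e.1) ∨ (e.2 = some i ∧ PosSp i e.1)

omit [Group G] in
/-- Membership of an in-slice link in `posLinks`. [folklore] -/
theorem mem_posLinks_of_ne [NeZero L₀] {x : Site d L₀ (2 * n + 2)} {μ : Dir d} (hμ : μ ≠ some i)
    (hx : PosIn i x) : (x, μ) ∈ posLinks (L₀ := L₀) i := by
  simp [posLinks, hμ, hx]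

omit [Group G] in
/-- Membership of a link in direction `i` in `posLinks`. [folklore] -/
theorem mem_posLinks_self [NeZero L₀] {x : Site d L₀ (2 * n + 2)} (hx : PosSp i x) :
    (x, some i) ∈ posLinks (L₀ := L₀) i := by
  simp [posLinks, hx]

omit [Group G] in
/-- Shifts in directions other than `i` preserve the positive in-slice region. [folklore] -/
theorem posIn_shift_of_ne {x : Site d L₀ (2 * n + 2)} {μ : Dir d} (hμ : μ ≠ some i) :
    PosIn i (x.shift μ) ↔ PosIn i x := by
  unfold PosIn; rw [slice_shift_of_ne i x hμ]

omit [Group G] in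
/-- Shifts in directions other than `i` preserve the positive spanning region. [folklore] -/
theorem posSp_shift_of_ne {x : Site d L₀ (2 * n + 2)} {μ : Dir d} (hμ : μ ≠ some i) :
    PosSp i (x.shift μ) ↔ PosSp i x := by
  unfold PosSp; rw [slice_shift_of_ne i x hμ]

omit [Group G] in
/-- The positive spanning region lies in the positive in-slice region. [folklore] -/
theorem posIn_of_posSp {x : Site d L₀ (2 * n + 2)} (hx : PosSp i x) : PosIn i x :=
  ⟨hx.1, hx.2.trans (Nat.le_succ n)⟩

omit [Group G] in
/-- One step in direction `i` from the positive spanning region stays in the positive in-slice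
region. [folklore] -/
theorem posIn_shift_self_of_posSp {x : Site d L₀ (2 * n + 2)} (hx : PosSp i x) : PosIn i (x.shift (some i)) := by
  unfold PosIn
  rw [slice_shift_some_self, ZMod.val_add, ZMod.val_one_eq_one_mod, Nat.mod_eq_of_lt (by omega : 1 < 2 * n + 2),
    Nat.mod_eq_of_lt (by unfold PosSp at hx; omega)]
  unfold PosSp at hx
  omega

omit [TopologicalSpace G] [IsTopologicalGroup G] [CompactSpace G] [MeasurableSpace G] [BorelSpace G] in
/-- In-slice terms depend only on the in-slice links of the slice of `x`. [folklore] -/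
theorem inTerm_congr {U V : Config d L₀ (2 * n + 2) G} (x : Site d L₀ (2 * n + 2))
    (h : ∀ (y : Site d L₀ (2 * n + 2)) (μ : Dir d), slice i y = slice i x → μ ≠ some i → U (y, μ) = V (y, μ)) :
    inTerm i ρ JE JM U x = inTerm i ρ JE JM V x := by
  have hne : ∀ {j : Fin d}, j ≠ i → (some j : Dir d) ≠ some i := fun hj h' => hj (Option.some_injective _ h')
  have key : ∀ {μ ν : Dir d} (hμ : μ ≠ some i) (hν : ν ≠ some i), plaquette U x μ ν = plaquette V x μ ν :=
    fun hμ hν => plaquette_congr x _ _ (h x _ rfl hμ) (h _ _ (slice_shift_of_ne i x hμ) hν)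
      (h _ _ (slice_shift_of_ne i x hν) hμ) (h x _ rfl hν)
  unfold inTerm
  congr 1
  · congr 1
    refine Finset.sum_congr rfl fun j hj => ?_
    simp only [Finset.mem_filter, Finset.mem_univ, true_and] at hj
    rw [key (by simp) (hne hj)]
  · congr 1
    refine Finset.sum_congr rfl fun p hp => ?_
    simp only [Finset.mem_filter, Finset.mem_univ, true_and] at hp
    rw [key (hne hp.1) (hne hp.2)]

omit [TopologicalSpace G] [IsTopologicalGroup G] [CompactSpace G] [MeasurableSpace G] [BorelSpace G] in
/-- Spanning terms depend only on the in-slice links of the slices of `x` and `x + eᵢ` and the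
links in direction `i` in the slice of `x`. [folklore] -/
theorem spTerm_congr {U V : Config d L₀ (2 * n + 2) G} (x : Site d L₀ (2 * n + 2))
    (h : ∀ (y : Site d L₀ (2 * n + 2)) (μ : Dir d), μ ≠ some i →
      (slice i y = slice i x ∨ slice i y = slice i x + 1) → U (y, μ) = V (y, μ))
    (h' : ∀ (y : Site d L₀ (2 * n + 2)), slice i y = slice i x → U (y, some i) = V (y, some i)) :
    spTerm i ρ JE JM U x = spTerm i ρ JE JM V x := by
  have key : ∀ {ν : Dir d} (hν : ν ≠ some i),
      plaquette U x (some i) ν = plaquette V x (some i) ν ∧ plaquette U x ν (some i) = plaquette V x ν (some i) := by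
    intro ν hν
    have e1 := h' x rfl
    have e2 := h (x.shift (some i)) ν hν (Or.inr (slice_shift_some_self i x))
    have e3 := h' (x.shift ν) (slice_shift_of_ne i x hν)
    have e4 := h x ν hν (Or.inl rfl)
    exact ⟨plaquette_congr x _ _ e1 e2 e3 e4, plaquette_congr x _ _ e4 e3 e2 e1⟩
  unfold spTerm
  congr 1
  · congr 1; rw [(key (by simp)).2]
  · congr 1
    refine Finset.sum_congr rfl fun p hp => ?_
    simp only [Finset.mem_filter, Finset.mem_univ, true_and] at hp
    by_cases hp1 : p.1.1 = i
    · have h2 : (some p.1.2 : Dir d) ≠ some i := fun h'' => by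
        have := Option.some_injective _ h''
        have hlt := p.2
        rw [this, ← hp1] at hlt
        exact lt_irrefl _ hlt
      rw [hp1, (key h2).1]
    · have hp2 : p.1.2 = i := hp.resolve_left hp1
      have h1 : (some p.1.1 : Dir d) ≠ some i := fun h'' => hp1 (Option.some_injective _ h'')
      rw [hp2, (key h1).2]

omit [TopologicalSpace G] [IsTopologicalGroup G] [CompactSpace G] [MeasurableSpace G] [BorelSpace G] in
/-- **`B₊` depends only on the positive links.** [folklore] -/
theorem dependsOn_bPlus [NeZero L₀] :
    DependsOn (fun U : Config d L₀ (2 * n + 2) G => bPlus i ρ JE JM U)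
      ((posLinks (L₀ := L₀) i : Finset (Site d L₀ (2 * n + 2) × Dir d)) : Set (Site d L₀ (2 * n + 2) × Dir d)) := by
  intro U V hUV
  unfold bPlus
  refine congrArg₂ (· + ·) (Finset.sum_congr rfl fun x hx => ?_) (Finset.sum_congr rfl fun x hx => ?_)
  · simp only [Finset.mem_filter, Finset.mem_univ, true_and] at hx
    refine inTerm_congr i ρ JE JM x fun y μ hy hμ => hUV _ (Finset.mem_coe.2 (mem_posLinks_of_ne i hμ ?_))
    unfold PosIn at hx ⊢; rw [hy]; exact hx
  · simp only [Finset.mem_filter, Finset.mem_univ, true_and] at hx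
    refine spTerm_congr i ρ JE JM x (fun y μ hμ hy => hUV _ (Finset.mem_coe.2 (mem_posLinks_of_ne i hμ ?_)))
      (fun y hy => hUV _ (Finset.mem_coe.2 (mem_posLinks_self i ?_)))
    · rcases hy with hy | hy
      · have := posIn_of_posSp i hx; unfold PosIn at this ⊢; rw [hy]; exact this
      · have := posIn_shift_self_of_posSp i hx
        unfold PosIn at this ⊢; rw [hy, ← slice_shift_some_self i x]; exact this
    · unfold PosSp at hx ⊢; rw [hy]; exact hx

/-- The partner of a positive in-slice link lies outside the positive links. [folklore] -/
theorem hatSite_not_mem_posLinks [NeZero L₀] {x : Site d L₀ (2 * n + 2)} {μ : Dir d} (hμ : μ ≠ some i)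
    (hx : PosIn i x) : (hatSite i 1 x, μ) ∉ posLinks (L₀ := L₀) i := by
  intro h
  simp only [posLinks, Finset.mem_filter, Finset.mem_univ, true_and] at h
  rcases h with ⟨-, hpos⟩ | ⟨hμ', -⟩
  · exact (posIn_hatSite_iff i x).1 hpos hx
  · exact hμ hμ'

/-- The partner of a positive link in direction `i` lies outside the positive links. [folklore] -/
theorem hatBack_not_mem_posLinks [NeZero L₀] (hn : 1 ≤ n) {x : Site d L₀ (2 * n + 2)} (hx : PosSp i x) :
    (hatBack i 1 x, some i) ∉ posLinks (L₀ := L₀) i := by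
  intro hmem
  simp only [posLinks, Finset.mem_filter, Finset.mem_univ, true_and, ne_eq, not_true_eq_false,
    false_and, false_or] at hmem
  have h := posSp_hatBack_iff i hn (hatBack i 1 x)
  rw [hatBack_hatBack] at h
  exact (h.1 hx).1 hmem

omit [TopologicalSpace G] [IsTopologicalGroup G] [CompactSpace G] [MeasurableSpace G] [BorelSpace G] in
/-- **`θ₁` maps the positive links into the complement**: the positive coordinates of `θ₁ U`
depend only on `U` off the positive links. [folklore] -/
theorem dependsOn_spaceReflect_apply_of_mem_posLinks [NeZero L₀] (hn : 1 ≤ n)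
    {e : Site d L₀ (2 * n + 2) × Dir d} (he : e ∈ posLinks (L₀ := L₀) i) :
    DependsOn (fun U : Config d L₀ (2 * n + 2) G => spaceReflect i 1 U e)
      (((posLinks (L₀ := L₀) i)ᶜ : Finset (Site d L₀ (2 * n + 2) × Dir d)) :
        Set (Site d L₀ (2 * n + 2) × Dir d)) := by
  intro U V hUV
  rcases e with ⟨x, μ⟩
  simp only [posLinks, Finset.mem_filter, Finset.mem_univ, true_and] at he
  rcases he with ⟨hμ, hx⟩ | ⟨hμ, hx⟩
  · show spaceReflect i 1 U (x, μ) = spaceReflect i 1 V (x, μ)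
    rw [spaceReflect_apply_of_ne i 1 U x hμ, spaceReflect_apply_of_ne i 1 V x hμ]
    exact hUV _ (by rw [Finset.coe_compl]; exact hatSite_not_mem_posLinks i hμ hx)
  · subst hμ
    show spaceReflect i 1 U (x, some i) = spaceReflect i 1 V (x, some i)
    rw [spaceReflect_apply_self, spaceReflect_apply_self]
    congr 1
    exact hUV _ (by rw [Finset.coe_compl]; exact hatBack_not_mem_posLinks i hn hx)

omit [CompactSpace G] [MeasurableSpace G] [BorelSpace G] in
/-- `inTerm · x` is continuous. [folklore] -/
theorem continuous_inTerm (hρ : Continuous ρ) (x : Site d L₀ (2 * n + 2)) :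
    Continuous fun U : Config d L₀ (2 * n + 2) G => inTerm i ρ JE JM U x := by
  have h : ∀ μ ν : Dir d, Continuous fun U : Config d L₀ (2 * n + 2) G => (ρ (plaquette U x μ ν)).trace.re :=
    fun μ ν => Complex.continuous_re.comp (Continuous.matrix_trace (hρ.comp (continuous_plaquette x μ ν)))
  unfold inTerm
  exact (continuous_const.mul (continuous_finsetSum _ fun j _ => h _ _)).add
    (continuous_const.mul (continuous_finsetSum _ fun p _ => h _ _))

omit [CompactSpace G] [MeasurableSpace G] [BorelSpace G] in
/-- `spTerm · x` is continuous. [folklore] -/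
theorem continuous_spTerm (hρ : Continuous ρ) (x : Site d L₀ (2 * n + 2)) :
    Continuous fun U : Config d L₀ (2 * n + 2) G => spTerm i ρ JE JM U x := by
  have h : ∀ μ ν : Dir d, Continuous fun U : Config d L₀ (2 * n + 2) G => (ρ (plaquette U x μ ν)).trace.re :=
    fun μ ν => Complex.continuous_re.comp (Continuous.matrix_trace (hρ.comp (continuous_plaquette x μ ν)))
  unfold spTerm
  exact (continuous_const.mul (h _ _)).add (continuous_const.mul (continuous_finsetSum _ fun p _ => h _ _))

omit [CompactSpace G] [MeasurableSpace G] [BorelSpace G] in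
/-- `axTerm · x` is continuous. [folklore] -/
theorem continuous_axTerm (hρ : Continuous ρ) (x : Site d L₀ (2 * n + 2)) :
    Continuous fun U : Config d L₀ (2 * n + 2) G => axTerm i ρ JE JM U x := by
  have h : ∀ (y : Site d L₀ (2 * n + 2)) (ν : Dir d),
      Continuous fun U : Config d L₀ (2 * n + 2) G => (ρ (U (y.shift (some i), ν) * (U (y, ν))⁻¹)).trace.re :=
    fun y ν => Complex.continuous_re.comp (Continuous.matrix_trace (hρ.comp
      ((continuous_link _).mul (continuous_link _).inv)))
  unfold axTerm
  exact (continuous_const.mul (h _ _)).add (continuous_const.mul (continuous_finsetSum _ fun p _ => h _ _))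

omit [CompactSpace G] [MeasurableSpace G] [BorelSpace G] in
/-- `B₊` is continuous. [folklore] -/
theorem continuous_bPlus [NeZero L₀] (hρ : Continuous ρ) :
    Continuous fun U : Config d L₀ (2 * n + 2) G => bPlus i ρ JE JM U :=
  (continuous_finsetSum _ fun x _ => continuous_inTerm i ρ JE JM hρ x).add
    (continuous_finsetSum _ fun x _ => continuous_spTerm i ρ JE JM hρ x)

omit [CompactSpace G] [MeasurableSpace G] [BorelSpace G] in
/-- `X` is continuous. [folklore] -/
theorem continuous_xCross [NeZero L₀] (hρ : Continuous ρ) :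
    Continuous fun U : Config d L₀ (2 * n + 2) G => xCross i ρ JE JM U :=
  continuous_finsetSum _ fun x _ => continuous_axTerm i ρ JE JM hρ x

omit [CompactSpace G] [MeasurableSpace G] [BorelSpace G] in
/-- The spatial reflection is continuous. [folklore] -/
theorem continuous_spaceReflect (c : ZMod L) : Continuous (spaceReflect (d := d) (L₀ := L₀) (L := L) (G := G) i c) := by
  refine continuous_pi fun e => ?_
  by_cases he : e.2 = some i
  · simp only [spaceReflect, he, if_true]; exact (continuous_apply _).inv
  · simp only [spaceReflect, he, if_false]; exact continuous_apply _

/-! ### Reflection positivity in the planes half-way between lattice planes (`θ₁`) -/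

/-- The crossing coupling attached to a set `S` of links with weights `J`:
`Σ_{ℓ ∈ S} J(ℓ) Re tr(ρ((θ₁U)(ℓ)) ρ(U(ℓ))ᴴ)`. For `S` the in-slice links of the slices `1` and
`n + 1` (weights `J_E` on time-like, `J_M` on spatial links) this is `X(U)` (`xCross_eq'`). [folklore] -/
def linkCoupling (J : Site d L₀ (2 * n + 2) × Dir d → ℝ) (S : Finset (Site d L₀ (2 * n + 2) × Dir d))
    (U : Config d L₀ (2 * n + 2) G) : ℝ :=
  ∑ ℓ ∈ S, J ℓ * (ρ (spaceReflect i 1 U ℓ) * (ρ (U ℓ))ᴴ).trace.re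

/-- The Gram coefficients of the crossing coupling: `√(J/2) ρ(U(ℓ))_{kl}` and their conjugates.
[folklore] -/
def lcoef (J : Site d L₀ (2 * n + 2) × Dir d → ℝ) (S : Finset (Site d L₀ (2 * n + 2) × Dir d)) :
    (S × Fin N × Fin N) × Bool → Config d L₀ (2 * n + 2) G → ℂ
  | ((ℓ, k, l), false) => fun U => (Real.sqrt (J ℓ / 2) : ℂ) * ρ (U ℓ) k l
  | ((ℓ, k, l), true) => fun U => (Real.sqrt (J ℓ / 2) : ℂ) * conj (ρ (U ℓ) k l)

omit [TopologicalSpace G] [IsTopologicalGroup G] [CompactSpace G] [MeasurableSpace G] [BorelSpace G] in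
/-- **The crossing coupling in Gram form**: `X_S(U) = Σ_I a_I(U) conj a_I(θ₁U)` for `J ≥ 0` on `S`.
[folklore] -/
theorem linkCoupling_eq_sum_lcoef (J : Site d L₀ (2 * n + 2) × Dir d → ℝ)
    (S : Finset (Site d L₀ (2 * n + 2) × Dir d)) (hJ : ∀ ℓ ∈ S, 0 ≤ J ℓ) (U : Config d L₀ (2 * n + 2) G) :
    ((linkCoupling i ρ J S U : ℝ) : ℂ) =
      ∑ I, lcoef ρ J S I U * conj (lcoef ρ J S I (spaceReflect i 1 U)) := by
  classical
  unfold linkCoupling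
  rw [Complex.ofReal_sum, Fintype.sum_prod_type, Fintype.sum_prod_type, ← Finset.sum_coe_sort S]
  refine Finset.sum_congr rfl fun ℓ _ => ?_
  have hs : ((Real.sqrt (J ℓ / 2) : ℂ)) * (Real.sqrt (J ℓ / 2) : ℂ) = ((J ℓ / 2 : ℝ) : ℂ) := by
    rw [← Complex.ofReal_mul, Real.mul_self_sqrt (by linarith [hJ ℓ ℓ.2])]
  -- `Re tr(A Bᴴ) = Σ_{kl} Re (A_kl conj B_kl)`
  have htr : ∀ A B : Matrix (Fin N) (Fin N) ℂ, (A * Bᴴ).trace = ∑ k, ∑ l, A k l * conj (B k l) := by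
    intro A B
    simp only [Matrix.trace, Matrix.diag, Matrix.mul_apply, Matrix.conjTranspose_apply, Complex.star_def]
  rw [htr, Complex.re_sum, Finset.mul_sum, Complex.ofReal_sum, Fintype.sum_prod_type]
  refine Finset.sum_congr rfl fun k _ => ?_
  rw [Complex.re_sum, Finset.mul_sum, Complex.ofReal_sum]
  refine Finset.sum_congr rfl fun l _ => ?_
  rw [Fintype.sum_bool]
  simp only [lcoef, map_mul, Complex.conj_ofReal, Complex.conj_conj]
  set a : ℂ := ρ (spaceReflect i 1 U ℓ) k l
  set b : ℂ := ρ (U ↑ℓ) k l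
  have hre : (((a * conj b).re : ℝ) : ℂ) * 2 = a * conj b + conj (a * conj b) := by
    rw [Complex.add_conj]; push_cast; ring
  calc ((J ↑ℓ * (a * conj b).re : ℝ) : ℂ) = ((J ↑ℓ / 2 : ℝ) : ℂ) * ((((a * conj b).re : ℝ) : ℂ) * 2) := by
        push_cast; ring
    _ = (Real.sqrt (J ↑ℓ / 2) : ℂ) * conj b * ((Real.sqrt (J ↑ℓ / 2) : ℂ) * a) +
        (Real.sqrt (J ↑ℓ / 2) : ℂ) * b * ((Real.sqrt (J ↑ℓ / 2) : ℂ) * conj a) := by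
        rw [hre, ← hs, map_mul, Complex.conj_conj]; ring
    _ = _ := by ring

variable [SecondCountableTopology G]

/-- **Reflection positivity in planes half-way between lattice planes (spatial direction `i`,
after the gauge decoupling of the crossing links).** Let `L = 2n + 2` with `n ≥ 1`, `ρ` a
continuous unitary representation, `S` a set of positive links with couplings `J ≥ 0`, and `F` a
bounded measurable observable depending only on the positive links of `θ₁`. Then
`0 ≤ ∫ F(U) conj F(θ₁U) e^{B₊(U)} e^{B₊(θ₁U)} e^{X_S(U)} ∏dg` (real and nonnegative), by the
tree's mechanism `LatticeRP.integral_mul_conj_mul_exp_nonneg` (no crossing, no shared coordinates).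
[cite: BorgsSeiler1983, §II.2 (pp. 331–332); §III.2 Lemma III.8 (p. 349)] -/
theorem linkRP_core [NeZero L₀] (hρu : ∀ g, ρ g ∈ Matrix.unitaryGroup (Fin N) ℂ) (hρ : Continuous ρ)
    (hn : 1 ≤ n) (J : Site d L₀ (2 * n + 2) × Dir d → ℝ) (S : Finset (Site d L₀ (2 * n + 2) × Dir d))
    (hS : S ⊆ posLinks (L₀ := L₀) i) (hJ : ∀ ℓ ∈ S, 0 ≤ J ℓ)
    {F : Config d L₀ (2 * n + 2) G → ℂ} (hFm : Measurable F) {K : ℝ} (hFb : ∀ U, ‖F U‖ ≤ K)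
    (hFdep : DependsOn F ((posLinks (L₀ := L₀) i : Finset (Site d L₀ (2 * n + 2) × Dir d)) :
      Set (Site d L₀ (2 * n + 2) × Dir d))) :
    0 ≤ ∫ U, F U * conj (F (spaceReflect i 1 U)) *
        ((Real.exp (bPlus i ρ JE JM U) * Real.exp (bPlus i ρ JE JM (spaceReflect i 1 U)) *
          Real.exp (linkCoupling i ρ J S U) : ℝ) : ℂ) ∂haar d L₀ (2 * n + 2) G := by
  classical
  -- the observable `g = F e^{B₊}` and the coefficients
  set g : Config d L₀ (2 * n + 2) G → ℂ := fun U => F U * (Real.exp (bPlus i ρ JE JM U) : ℂ) with hg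
  obtain ⟨KB, hKB⟩ := exists_forall_norm_le_of_continuous (continuous_bPlus (L₀ := L₀) i ρ JE JM hρ (n := n))
  have hgm : Measurable g := hFm.mul (Complex.continuous_ofReal.comp
    (Real.continuous_exp.comp (continuous_bPlus i ρ JE JM hρ))).measurable
  have hgb : ∀ U, ‖g U‖ ≤ |K| * Real.exp KB := fun U => by
    rw [hg, norm_mul, Complex.norm_real, Real.norm_of_nonneg (Real.exp_pos _).le]
    exact mul_le_mul ((hFb U).trans (le_abs_self K)) (Real.exp_le_exp.2 ((Real.le_norm_self _).trans (hKB U)))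
      (Real.exp_pos _).le (abs_nonneg K)
  have hgdep : DependsOn g ((posLinks (L₀ := L₀) i ∪ ∅ : Finset (Site d L₀ (2 * n + 2) × Dir d)) :
      Set (Site d L₀ (2 * n + 2) × Dir d)) := by
    rw [Finset.union_empty]
    intro U V hUV
    have e2 : bPlus i ρ JE JM U = bPlus i ρ JE JM V := dependsOn_bPlus i ρ JE JM hUV
    simp only [hg]
    rw [hFdep hUV, e2]
  set KJ : ℝ := ∑ ℓ ∈ S, Real.sqrt (J ℓ / 2) with hKJdef
  have hKJ : ∀ ℓ ∈ S, Real.sqrt (J ℓ / 2) ≤ KJ := fun ℓ hℓ =>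
    Finset.single_le_sum (f := fun ℓ' => Real.sqrt (J ℓ' / 2)) (fun ℓ' _ => Real.sqrt_nonneg _) hℓ
  have ham : ∀ I, Measurable (lcoef (L₀ := L₀) ρ J S I : Config d L₀ (2 * n + 2) G → ℂ) := by
    rintro ⟨⟨ℓ, k, l⟩, _ | _⟩
    · exact (continuous_const.mul ((hρ.comp (continuous_link _)).matrix_elem k l)).measurable
    · exact (continuous_const.mul (Complex.continuous_conj.comp ((hρ.comp (continuous_link _)).matrix_elem k l))).measurable
  have hab : ∀ I (U : Config d L₀ (2 * n + 2) G), ‖lcoef ρ J S I U‖ ≤ KJ := by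
    rintro ⟨⟨ℓ, k, l⟩, b⟩ U
    have h1 : ‖ρ (U ℓ) k l‖ ≤ 1 := entry_norm_bound_of_unitary (hρu _) k l
    have hK : Real.sqrt (J ℓ / 2) ≤ KJ := hKJ ℓ ℓ.2
    rcases b with _ | _
    · simp only [lcoef, norm_mul, Complex.norm_real, Real.norm_of_nonneg (Real.sqrt_nonneg _)]
      calc Real.sqrt (J ℓ / 2) * ‖ρ (U ℓ) k l‖ ≤ Real.sqrt (J ℓ / 2) * 1 :=
            mul_le_mul_of_nonneg_left h1 (Real.sqrt_nonneg _)
        _ ≤ KJ := by rw [mul_one]; exact hK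
    · simp only [lcoef, norm_mul, Complex.norm_real, Real.norm_of_nonneg (Real.sqrt_nonneg _), Complex.norm_conj]
      calc Real.sqrt (J ℓ / 2) * ‖ρ (U ℓ) k l‖ ≤ Real.sqrt (J ℓ / 2) * 1 :=
            mul_le_mul_of_nonneg_left h1 (Real.sqrt_nonneg _)
        _ ≤ KJ := by rw [mul_one]; exact hK
  have hadep : ∀ I, DependsOn (lcoef (L₀ := L₀) ρ J S I : Config d L₀ (2 * n + 2) G → ℂ)
      ((posLinks (L₀ := L₀) i ∪ ∅ : Finset (Site d L₀ (2 * n + 2) × Dir d)) : Set (Site d L₀ (2 * n + 2) × Dir d)) := by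
    rw [Finset.union_empty]
    rintro ⟨⟨ℓ, k, l⟩, _ | _⟩ U V hUV
    · have e := hUV ℓ (Finset.mem_coe.2 (hS ℓ.2)); simp only [lcoef]; rw [e]
    · have e := hUV ℓ (Finset.mem_coe.2 (hS ℓ.2)); simp only [lcoef]; rw [e]
  -- the abstract theorem, with `C = ∅`
  have key := Literature.MathematicalPhysics.QuantumFieldTheory.LatticeRP.integral_mul_conj_mul_exp_nonneg
    (Literature.MathematicalPhysics.QuantumFieldTheory.haarProbability G) (posLinks (L₀ := L₀) i) ∅ (spaceReflect i 1)
    (measurePreserving_spaceReflect i 1)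
    (fun e he => by
      rw [Finset.union_empty] at he
      exact dependsOn_spaceReflect_apply_of_mem_posLinks i hn he)
    hgm ham hgb hab hgdep hadep
  -- identify the integrand
  have hint : ∀ U : Config d L₀ (2 * n + 2) G,
      F U * conj (F (spaceReflect i 1 U)) *
        ((Real.exp (bPlus i ρ JE JM U) * Real.exp (bPlus i ρ JE JM (spaceReflect i 1 U)) *
          Real.exp (linkCoupling i ρ J S U) : ℝ) : ℂ) =
      g U * conj (g (spaceReflect i 1 U)) *
        Complex.exp (∑ I, lcoef ρ J S I U * conj (lcoef ρ J S I (spaceReflect i 1 U))) := by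
    intro U
    rw [← linkCoupling_eq_sum_lcoef i ρ J S hJ U, ← Complex.ofReal_exp]
    simp only [hg, map_mul, Complex.conj_ofReal]
    push_cast
    ring
  simp_rw [hint]
  -- pass to the doubled integral of the mechanism (`C = ∅`: the second variable is a dummy)
  have hΨm : Measurable fun U : Config d L₀ (2 * n + 2) G => g U * conj (g (spaceReflect i 1 U)) *
      Complex.exp (∑ I, lcoef ρ J S I U * conj (lcoef ρ J S I (spaceReflect i 1 U))) := by
    have hθ : Measurable (spaceReflect (d := d) (L₀ := L₀) (L := 2 * n + 2) (G := G) i 1) :=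
      (continuous_spaceReflect i 1).measurable
    refine (hgm.mul (Complex.continuous_conj.measurable.comp (hgm.comp hθ))).mul
      (Complex.measurable_exp.comp (Finset.measurable_sum _ fun I _ =>
        (ham I).mul (Complex.continuous_conj.measurable.comp ((ham I).comp hθ))))
  have hΨb : ∀ U : Config d L₀ (2 * n + 2) G, ‖g U * conj (g (spaceReflect i 1 U)) *
      Complex.exp (∑ I, lcoef ρ J S I U * conj (lcoef ρ J S I (spaceReflect i 1 U)))‖ ≤
      (|K| * Real.exp KB) * (|K| * Real.exp KB) *
        Real.exp ((Fintype.card ((S × Fin N × Fin N) × Bool) : ℝ) * (KJ * KJ)) := by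
    intro U
    rw [norm_mul, norm_mul, Complex.norm_conj, Complex.norm_exp]
    refine mul_le_mul (mul_le_mul (hgb U) (hgb _) (norm_nonneg _) (by positivity)) ?_ (Real.exp_pos _).le
      (by positivity)
    refine Real.exp_le_exp.2 ?_
    calc (∑ I, lcoef ρ J S I U * conj (lcoef ρ J S I (spaceReflect i 1 U))).re
        ≤ ‖∑ I, lcoef ρ J S I U * conj (lcoef ρ J S I (spaceReflect i 1 U))‖ := Complex.re_le_norm _
      _ ≤ ∑ I, ‖lcoef ρ J S I U * conj (lcoef ρ J S I (spaceReflect i 1 U))‖ := norm_sum_le _ _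
      _ ≤ ∑ _I : (S × Fin N × Fin N) × Bool, KJ * KJ := Finset.sum_le_sum fun I _ => by
          rw [norm_mul, Complex.norm_conj]
          exact mul_le_mul (hab I U) (hab I _) (norm_nonneg _) ((norm_nonneg _).trans (hab I U))
      _ = (Fintype.card ((S × Fin N × Fin N) × Bool) : ℝ) * (KJ * KJ) := by
          rw [Finset.sum_const, Finset.card_univ, nsmul_eq_mul]
  rw [integral_eq_integral_prod_mulOn ∅ hΨm hΨb]
  simp_rw [mulOn_empty]
  simp_rw [splice_empty] at key
  exact key

end LinkHalves

/-! ### Reflection positivity in lattice planes (`θ₀`, planes = the slices `0` and `n + 1`) -/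

section SiteHalves

variable {n : ℕ} (JE JM : ℝ)

omit [Group G] in
/-- The slice of the reflected site for `θ₀`: `slice x̂ = −slice x`. [folklore] -/
theorem slice_hatSite_zero (x : Site d L₀ (2 * n + 2)) : slice i (hatSite i 0 x) = -slice i x := by
  simp [slice, hatSite]

omit [Group G] in
/-- The slice of `hatBack x` for `θ₀`: `−1 − slice x`. [folklore] -/
theorem slice_hatBack_zero (x : Site d L₀ (2 * n + 2)) : slice i (hatBack i 0 x) = -1 - slice i x := by
  simp [slice, hatBack]; ring

/-- The POSITIVE in-slice region of `θ₀`: slices `1, …, n`. [folklore] -/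
def PosIn0 (x : Site d L₀ (2 * n + 2)) : Prop := 1 ≤ (slice i x).val ∧ (slice i x).val ≤ n

/-- The POSITIVE spanning region of `θ₀`: slices `0, …, n`. [folklore] -/
def PosSp0 (x : Site d L₀ (2 * n + 2)) : Prop := (slice i x).val ≤ n

/-- The reflection PLANES of `θ₀`: the slices `0` and `n + 1`. [folklore] -/
def Plane0 (x : Site d L₀ (2 * n + 2)) : Prop := (slice i x).val = 0 ∨ (slice i x).val = n + 1

/-- `PosIn0` is decidable. [folklore] -/
instance (x : Site d L₀ (2 * n + 2)) : Decidable (PosIn0 (i := i) x) := by unfold PosIn0; infer_instance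
/-- `PosSp0` is decidable. [folklore] -/
instance (x : Site d L₀ (2 * n + 2)) : Decidable (PosSp0 (i := i) x) := by unfold PosSp0; infer_instance
/-- `Plane0` is decidable. [folklore] -/
instance (x : Site d L₀ (2 * n + 2)) : Decidable (Plane0 (i := i) x) := by unfold Plane0; infer_instance

omit [Group G] in
/-- **Reindexing the in-slice regions of `θ₀`**: `x̂` is positive iff `x` is neither positive nor
on a plane. [folklore] -/
theorem posIn0_hatSite_iff (x : Site d L₀ (2 * n + 2)) :
    PosIn0 i (hatSite i 0 x) ↔ ¬ PosIn0 i x ∧ ¬ Plane0 i x := by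
  unfold PosIn0 Plane0
  rw [slice_hatSite_zero]
  have hlt := ZMod.val_lt (slice i x)
  by_cases h0 : (slice i x).val = 0
  · have hs : slice i x = 0 := (ZMod.val_eq_zero _).1 h0
    rw [hs, neg_zero, ZMod.val_zero]; omega
  · rw [val_neg_of_pos_even (by omega)]; omega

omit [Group G] in
/-- **Reindexing the spanning regions of `θ₀`**: `hatBack x` is positive iff `x` is not. [folklore] -/
theorem posSp0_hatBack_iff (x : Site d L₀ (2 * n + 2)) : PosSp0 i (hatBack i 0 x) ↔ ¬ PosSp0 i x := by
  unfold PosSp0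
  rw [slice_hatBack_zero, val_neg_one_sub_even]
  have hlt := ZMod.val_lt (slice i x)
  omega

/-- The POSITIVE part of the exponent for `θ₀`:
`B₊⁰(U) = Σ_{x : 1 ≤ slice ≤ n} inTerm + Σ_{x : slice ≤ n} spTerm`. [folklore] -/
def bPlus0 [NeZero L₀] (U : Config d L₀ (2 * n + 2) G) : ℝ :=
  ∑ x ∈ Finset.univ.filter (fun x => PosIn0 i x), inTerm i ρ JE JM U x +
    ∑ x ∈ Finset.univ.filter (fun x => PosSp0 i x), spTerm i ρ JE JM U x

/-- The PLANE part of the exponent for `θ₀`: the in-slice terms of the slices `0` and `n + 1`.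
[folklore] -/
def bPlane0 [NeZero L₀] (U : Config d L₀ (2 * n + 2) G) : ℝ :=
  ∑ x ∈ Finset.univ.filter (fun x => Plane0 i x), inTerm i ρ JE JM U x

omit [TopologicalSpace G] [IsTopologicalGroup G] [CompactSpace G] [MeasurableSpace G] [BorelSpace G] in
/-- Sites on the planes are fixed by `σ₀`. [folklore] -/
theorem hatSite_zero_of_plane0 {x : Site d L₀ (2 * n + 2)} (hx : Plane0 i x) : hatSite i 0 x = x := by
  rcases x with ⟨t, y⟩
  simp only [hatSite, Prod.mk.injEq, true_and]
  funext j
  by_cases hj : j = i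
  · subst hj
    rw [sigma_apply_self, zero_sub]
    unfold Plane0 slice at hx
    simp only at hx
    rcases hx with h | h
    · rw [(ZMod.val_eq_zero _).1 h, neg_zero]
    · have : y j = ((n + 1 : ℕ) : ZMod (2 * n + 2)) := by
        apply ZMod.val_injective; rw [h, ZMod.val_cast_of_lt (by omega)]
      rw [this, neg_half]
  · rw [sigma_apply_of_ne i 0 hj]

omit [TopologicalSpace G] [IsTopologicalGroup G] [CompactSpace G] [MeasurableSpace G] [BorelSpace G] in
/-- **The plane part is reflection invariant.** [folklore] -/
theorem bPlane0_spaceReflect [NeZero L₀] (U : Config d L₀ (2 * n + 2) G) :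
    bPlane0 i ρ JE JM (spaceReflect i 0 U) = bPlane0 i ρ JE JM U := by
  unfold bPlane0
  refine Finset.sum_congr rfl fun x hx => ?_
  simp only [Finset.mem_filter, Finset.mem_univ, true_and] at hx
  rw [inTerm_spaceReflect, hatSite_zero_of_plane0 i hx]

omit [TopologicalSpace G] [IsTopologicalGroup G] [CompactSpace G] [MeasurableSpace G] [BorelSpace G] in
/-- **The Wilson action in reflection-positive form (site reflection)**: for a unitary `ρ`,
`−S(U) = B₊⁰(U) + B₊⁰(θ₀ U) + M⁰(U)`. [folklore] -/
theorem minusAction_site_split [NeZero L₀] (hρu : ∀ g, ρ g ∈ Matrix.unitaryGroup (Fin N) ℂ)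
    (U : Config d L₀ (2 * n + 2) G) :
    minusAction ρ JE JM U =
      bPlus0 i ρ JE JM U + bPlus0 i ρ JE JM (spaceReflect i 0 U) + bPlane0 i ρ JE JM U := by
  classical
  rw [minusAction_eq_sum_terms i ρ JE JM, Finset.sum_add_distrib]
  have hIn : ∑ x, inTerm i ρ JE JM U x =
      ∑ x ∈ Finset.univ.filter (fun x => PosIn0 i x), inTerm i ρ JE JM U x +
        ∑ x ∈ Finset.univ.filter (fun x => PosIn0 i x), inTerm i ρ JE JM (spaceReflect i 0 U) x +
        bPlane0 i ρ JE JM U := by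
    rw [← Finset.sum_filter_add_sum_filter_not Finset.univ (fun x => Plane0 i x)]
    have hpl : ∑ x ∈ Finset.univ.filter (fun x => Plane0 i x), inTerm i ρ JE JM U x = bPlane0 i ρ JE JM U := rfl
    rw [hpl, ← Finset.sum_filter_add_sum_filter_not (Finset.univ.filter fun x => ¬ Plane0 i x)
      (fun x => PosIn0 i x), Finset.filter_filter, Finset.filter_filter]
    have hps : Finset.univ.filter (fun x : Site d L₀ (2 * n + 2) => ¬ Plane0 i x ∧ PosIn0 i x) =
        Finset.univ.filter (fun x => PosIn0 i x) := by
      ext x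
      simp only [Finset.mem_filter, Finset.mem_univ, true_and, and_iff_right_iff_imp]
      intro hx hp
      unfold PosIn0 at hx; unfold Plane0 at hp; omega
    have hneg : ∑ x ∈ Finset.univ.filter (fun x : Site d L₀ (2 * n + 2) => ¬ Plane0 i x ∧ ¬ PosIn0 i x),
        inTerm i ρ JE JM U x =
        ∑ x ∈ Finset.univ.filter (fun x => PosIn0 i x), inTerm i ρ JE JM (spaceReflect i 0 U) x := by
      refine Finset.sum_nbij' (hatSite i 0) (hatSite i 0) (fun x hx => ?_) (fun x hx => ?_)
        (fun x _ => hatSite_hatSite i 0 x) (fun x _ => hatSite_hatSite i 0 x) (fun x _ => ?_)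
      · simp only [Finset.mem_filter, Finset.mem_univ, true_and] at hx ⊢
        rw [posIn0_hatSite_iff]; exact ⟨hx.2, hx.1⟩
      · simp only [Finset.mem_filter, Finset.mem_univ, true_and] at hx ⊢
        have h := posIn0_hatSite_iff i (hatSite i 0 x)
        rw [hatSite_hatSite] at h
        obtain ⟨h1, h2⟩ := h.1 hx
        exact ⟨h2, h1⟩
      · rw [inTerm_spaceReflect, hatSite_hatSite]
    rw [hps, hneg]
    ring
  have hSp : ∑ x, spTerm i ρ JE JM U x =
      ∑ x ∈ Finset.univ.filter (fun x => PosSp0 i x), spTerm i ρ JE JM U x +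
        ∑ x ∈ Finset.univ.filter (fun x => PosSp0 i x), spTerm i ρ JE JM (spaceReflect i 0 U) x := by
    rw [← Finset.sum_filter_add_sum_filter_not Finset.univ (fun x => PosSp0 i x)]
    congr 1
    refine Finset.sum_nbij' (hatBack i 0) (hatBack i 0) (fun x hx => ?_) (fun x hx => ?_)
      (fun x _ => hatBack_hatBack i 0 x) (fun x _ => hatBack_hatBack i 0 x) (fun x _ => ?_)
    · simp only [Finset.mem_filter, Finset.mem_univ, true_and] at hx ⊢
      exact (posSp0_hatBack_iff i x).2 hx
    · simp only [Finset.mem_filter, Finset.mem_univ, true_and] at hx ⊢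
      have h := posSp0_hatBack_iff i (hatBack i 0 x)
      rw [hatBack_hatBack] at h
      exact h.1 hx
    · rw [spTerm_spaceReflect i ρ JE JM hρu 0 U, hatBack_hatBack]
  rw [hIn, hSp]
  unfold bPlus0
  ring

/-- The POSITIVE links of `θ₀`: in-slice links of the slices `1, …, n` and links in direction `i`
starting in the slices `0, …, n`. [folklore] -/
def posLinks0 [NeZero L₀] : Finset (Site d L₀ (2 * n + 2) × Dir d) :=
  Finset.univ.filter fun e => (e.2 ≠ some i ∧ PosIn0 i e.1) ∨ (e.2 = some i ∧ PosSp0 i e.1)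

/-- The SHARED links of `θ₀`: in-slice links of the planes. [folklore] -/
def sharedLinks0 [NeZero L₀] : Finset (Site d L₀ (2 * n + 2) × Dir d) :=
  Finset.univ.filter fun e => e.2 ≠ some i ∧ Plane0 i e.1

omit [Group G] in
/-- The shared and positive links are disjoint. [folklore] -/
theorem disjoint_sharedLinks0_posLinks0 [NeZero L₀] :
    Disjoint (sharedLinks0 (L₀ := L₀) (n := n) i) (posLinks0 i) := by
  rw [Finset.disjoint_left]
  rintro ⟨x, μ⟩ h1 h2
  simp only [sharedLinks0, posLinks0, Finset.mem_filter, Finset.mem_univ, true_and] at h1 h2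
  rcases h2 with ⟨-, hx⟩ | ⟨hμ, -⟩
  · unfold PosIn0 at hx; unfold Plane0 at h1; omega
  · exact h1.1 hμ

omit [TopologicalSpace G] [IsTopologicalGroup G] [CompactSpace G] [MeasurableSpace G] [BorelSpace G] in
/-- `θ₀` fixes the shared links. [folklore] -/
theorem spaceReflect_zero_apply_of_mem_sharedLinks0 [NeZero L₀] (U : Config d L₀ (2 * n + 2) G)
    {e : Site d L₀ (2 * n + 2) × Dir d} (he : e ∈ sharedLinks0 (L₀ := L₀) i) :
    spaceReflect i 0 U e = U e := by
  rcases e with ⟨x, μ⟩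
  simp only [sharedLinks0, Finset.mem_filter, Finset.mem_univ, true_and] at he
  rw [spaceReflect_apply_of_ne i 0 U x he.1, hatSite_zero_of_plane0 i he.2]

omit [TopologicalSpace G] [IsTopologicalGroup G] [CompactSpace G] [MeasurableSpace G] [BorelSpace G] in
/-- **`θ₀` maps the positive links into the complement.** [folklore] -/
theorem dependsOn_spaceReflect_zero_apply_of_mem_posLinks0 [NeZero L₀]
    {e : Site d L₀ (2 * n + 2) × Dir d} (he : e ∈ posLinks0 (L₀ := L₀) i) :
    DependsOn (fun U : Config d L₀ (2 * n + 2) G => spaceReflect i 0 U e)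
      (((posLinks0 (L₀ := L₀) i)ᶜ : Finset (Site d L₀ (2 * n + 2) × Dir d)) :
        Set (Site d L₀ (2 * n + 2) × Dir d)) := by
  intro U V hUV
  rcases e with ⟨x, μ⟩
  simp only [posLinks0, Finset.mem_filter, Finset.mem_univ, true_and] at he
  rcases he with ⟨hμ, hx⟩ | ⟨hμ, hx⟩
  · show spaceReflect i 0 U (x, μ) = spaceReflect i 0 V (x, μ)
    rw [spaceReflect_apply_of_ne i 0 U x hμ, spaceReflect_apply_of_ne i 0 V x hμ]
    refine hUV _ ?_
    rw [Finset.coe_compl]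
    intro h
    simp only [Finset.mem_coe, posLinks0, Finset.mem_filter, Finset.mem_univ, true_and] at h
    rcases h with ⟨-, hpos⟩ | ⟨hμ', -⟩
    · exact ((posIn0_hatSite_iff i x).1 hpos).1 hx
    · exact hμ hμ'
  · subst hμ
    show spaceReflect i 0 U (x, some i) = spaceReflect i 0 V (x, some i)
    rw [spaceReflect_apply_self, spaceReflect_apply_self]
    congr 1
    refine hUV _ ?_
    rw [Finset.coe_compl]
    intro h
    simp only [Finset.mem_coe, posLinks0, Finset.mem_filter, Finset.mem_univ, true_and, ne_eq,
      not_true_eq_false, false_and, false_or] at h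
    exact (posSp0_hatBack_iff i x).1 h hx

omit [TopologicalSpace G] [IsTopologicalGroup G] [CompactSpace G] [MeasurableSpace G] [BorelSpace G] in
/-- `B₊⁰` depends only on the positive and shared links. [folklore] -/
theorem dependsOn_bPlus0 [NeZero L₀] :
    DependsOn (fun U : Config d L₀ (2 * n + 2) G => bPlus0 i ρ JE JM U)
      ((posLinks0 (L₀ := L₀) i ∪ ∅ ∪ sharedLinks0 i : Finset (Site d L₀ (2 * n + 2) × Dir d)) :
        Set (Site d L₀ (2 * n + 2) × Dir d)) := by
  have hmem : ∀ (y : Site d L₀ (2 * n + 2)) (μ : Dir d), μ ≠ some i → (slice i y).val ≤ n + 1 →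
      (y, μ) ∈ (posLinks0 (L₀ := L₀) i ∪ ∅ ∪ sharedLinks0 i) := by
    intro y μ hμ hy
    simp only [Finset.union_empty, Finset.mem_union, posLinks0, sharedLinks0, Finset.mem_filter,
      Finset.mem_univ, true_and, PosIn0, Plane0]
    by_cases h0 : (slice i y).val = 0
    · exact Or.inr ⟨hμ, Or.inl h0⟩
    · by_cases h1 : (slice i y).val = n + 1
      · exact Or.inr ⟨hμ, Or.inr h1⟩
      · exact Or.inl (Or.inl ⟨hμ, by omega, by omega⟩)
  have hmem' : ∀ (y : Site d L₀ (2 * n + 2)), (slice i y).val ≤ n →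
      (y, some i) ∈ (posLinks0 (L₀ := L₀) i ∪ ∅ ∪ sharedLinks0 i) := by
    intro y hy
    simp only [Finset.union_empty, Finset.mem_union, posLinks0, Finset.mem_filter, Finset.mem_univ,
      true_and, PosSp0]
    left; right; exact hy
  intro U V hUV
  unfold bPlus0
  refine congrArg₂ (· + ·) (Finset.sum_congr rfl fun x hx => ?_) (Finset.sum_congr rfl fun x hx => ?_)
  · simp only [Finset.mem_filter, Finset.mem_univ, true_and] at hx
    refine inTerm_congr i ρ JE JM x fun y μ hy hμ => hUV _ (Finset.mem_coe.2 (hmem y μ hμ ?_))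
    unfold PosIn0 at hx; rw [hy]; omega
  · simp only [Finset.mem_filter, Finset.mem_univ, true_and] at hx
    unfold PosSp0 at hx
    refine spTerm_congr i ρ JE JM x (fun y μ hμ hy => hUV _ (Finset.mem_coe.2 (hmem y μ hμ ?_)))
      (fun y hy => hUV _ (Finset.mem_coe.2 (hmem' y ?_)))
    · rcases hy with hy | hy
      · rw [hy]; omega
      · rw [hy, ZMod.val_add, ZMod.val_one_eq_one_mod, Nat.mod_eq_of_lt (by omega : 1 < 2 * n + 2),
          Nat.mod_eq_of_lt (by omega)]
        omega
    · rw [hy]; exact hx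

omit [TopologicalSpace G] [IsTopologicalGroup G] [CompactSpace G] [MeasurableSpace G] [BorelSpace G] in
/-- `M⁰` depends only on the shared links. [folklore] -/
theorem dependsOn_bPlane0 [NeZero L₀] :
    DependsOn (fun U : Config d L₀ (2 * n + 2) G => bPlane0 i ρ JE JM U)
      ((posLinks0 (L₀ := L₀) i ∪ ∅ ∪ sharedLinks0 i : Finset (Site d L₀ (2 * n + 2) × Dir d)) :
        Set (Site d L₀ (2 * n + 2) × Dir d)) := by
  intro U V hUV
  unfold bPlane0
  refine Finset.sum_congr rfl fun x hx => ?_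
  simp only [Finset.mem_filter, Finset.mem_univ, true_and] at hx
  refine inTerm_congr i ρ JE JM x fun y μ hy hμ => hUV _ (Finset.mem_coe.2 ?_)
  simp only [Finset.union_empty, Finset.mem_union, sharedLinks0, Finset.mem_filter, Finset.mem_univ, true_and]
  refine Or.inr ⟨hμ, ?_⟩
  unfold Plane0 at hx ⊢; rw [hy]; exact hx

omit [CompactSpace G] [MeasurableSpace G] [BorelSpace G] in
/-- `B₊⁰` is continuous. [folklore] -/
theorem continuous_bPlus0 [NeZero L₀] (hρ : Continuous ρ) :
    Continuous fun U : Config d L₀ (2 * n + 2) G => bPlus0 i ρ JE JM U :=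
  (continuous_finsetSum _ fun x _ => continuous_inTerm i ρ JE JM hρ x).add
    (continuous_finsetSum _ fun x _ => continuous_spTerm i ρ JE JM hρ x)

omit [CompactSpace G] [MeasurableSpace G] [BorelSpace G] in
/-- `M⁰` is continuous. [folklore] -/
theorem continuous_bPlane0 [NeZero L₀] (hρ : Continuous ρ) :
    Continuous fun U : Config d L₀ (2 * n + 2) G => bPlane0 i ρ JE JM U :=
  continuous_finsetSum _ fun x _ => continuous_inTerm i ρ JE JM hρ x

variable [SecondCountableTopology G]

/-- **Reflection positivity in lattice planes (spatial direction `i`).** Let `L = 2n + 2`, `ρ` a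
continuous unitary representation and `F` a bounded measurable observable depending only on the
links of the closed positive half-space of `θ₀` (positive and shared links). Then
`0 ≤ ∫ F(U) conj F(θ₀U) e^{−S(U)} ∏dg` (real and nonnegative): `minusAction_site_split` and the
tree's mechanism `LatticeRP.integral_splice_mul_conj_comp_of_shared_nonneg` (`C = ∅`).
[cite: BorgsSeiler1983, §II.2 (pp. 331–332); §III.2 Lemma III.8 (p. 349)] -/
theorem siteRP_core [NeZero L₀] (hρu : ∀ g, ρ g ∈ Matrix.unitaryGroup (Fin N) ℂ) (hρ : Continuous ρ)
    {F : Config d L₀ (2 * n + 2) G → ℂ} (hFm : Measurable F) {K : ℝ} (hFb : ∀ U, ‖F U‖ ≤ K)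
    (hFdep : DependsOn F ((posLinks0 (L₀ := L₀) i ∪ ∅ ∪ sharedLinks0 i : Finset (Site d L₀ (2 * n + 2) × Dir d)) :
      Set (Site d L₀ (2 * n + 2) × Dir d))) :
    0 ≤ ∫ U, F U * conj (F (spaceReflect i 0 U)) * (weight ρ JE JM U : ℂ) ∂haar d L₀ (2 * n + 2) G := by
  classical
  set Φ : Config d L₀ (2 * n + 2) G → ℂ := fun U =>
    F U * (Real.exp (bPlus0 i ρ JE JM U) : ℂ) * (Real.exp (bPlane0 i ρ JE JM U / 2) : ℂ) with hΦ
  obtain ⟨KB, hKB⟩ := exists_forall_norm_le_of_continuous (continuous_bPlus0 (L₀ := L₀) i ρ JE JM hρ (n := n))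
  obtain ⟨KM, hKM⟩ := exists_forall_norm_le_of_continuous
    ((continuous_bPlane0 (L₀ := L₀) i ρ JE JM hρ (n := n)).div_const 2)
  have hΦm : Measurable Φ :=
    (hFm.mul (Complex.continuous_ofReal.comp (Real.continuous_exp.comp (continuous_bPlus0 i ρ JE JM hρ))).measurable).mul
      (Complex.continuous_ofReal.comp (Real.continuous_exp.comp
        ((continuous_bPlane0 i ρ JE JM hρ).div_const 2))).measurable
  have hΦb : ∀ U, ‖Φ U‖ ≤ |K| * Real.exp KB * Real.exp KM := fun U => by
    rw [hΦ, norm_mul, norm_mul, Complex.norm_real, Complex.norm_real, Real.norm_of_nonneg (Real.exp_pos _).le,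
      Real.norm_of_nonneg (Real.exp_pos _).le]
    exact mul_le_mul (mul_le_mul ((hFb U).trans (le_abs_self K))
      (Real.exp_le_exp.2 ((Real.le_norm_self _).trans (hKB U))) (Real.exp_pos _).le (abs_nonneg K))
      (Real.exp_le_exp.2 ((Real.le_norm_self _).trans (hKM U))) (Real.exp_pos _).le (by positivity)
  have hΦdep : DependsOn Φ ((posLinks0 (L₀ := L₀) i ∪ ∅ ∪ sharedLinks0 i : Finset (Site d L₀ (2 * n + 2) × Dir d)) :
      Set (Site d L₀ (2 * n + 2) × Dir d)) := by
    intro U V hUV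
    have e1 : bPlus0 i ρ JE JM U = bPlus0 i ρ JE JM V := dependsOn_bPlus0 i ρ JE JM hUV
    have e2 : bPlane0 i ρ JE JM U = bPlane0 i ρ JE JM V := dependsOn_bPlane0 i ρ JE JM hUV
    simp only [hΦ]
    rw [hFdep hUV, e1, e2]
  have key := Literature.MathematicalPhysics.QuantumFieldTheory.LatticeRP.integral_splice_mul_conj_comp_of_shared_nonneg
    (Literature.MathematicalPhysics.QuantumFieldTheory.haarProbability G) (sharedLinks0 (L₀ := L₀) i)
    (posLinks0 (L₀ := L₀) i) ∅ (spaceReflect i 0) (measurePreserving_spaceReflect i 0)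
    (fun U e he => spaceReflect_zero_apply_of_mem_sharedLinks0 i U he)
    (fun e he => by
      rw [Finset.union_empty] at he
      exact dependsOn_spaceReflect_zero_apply_of_mem_posLinks0 i he)
    (disjoint_sharedLinks0_posLinks0 i) (Finset.disjoint_empty_right _) hΦm hΦb hΦdep
  -- identify the integrand
  have hint : ∀ U : Config d L₀ (2 * n + 2) G,
      F U * conj (F (spaceReflect i 0 U)) * (weight ρ JE JM U : ℂ) = Φ U * conj (Φ (spaceReflect i 0 U)) := by
    intro U
    rw [weight, minusAction_site_split i ρ JE JM hρu U]
    simp only [hΦ, map_mul, Complex.conj_ofReal, bPlane0_spaceReflect]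
    have h2 : (Real.exp (bPlus0 i ρ JE JM U + bPlus0 i ρ JE JM (spaceReflect i 0 U) + bPlane0 i ρ JE JM U) : ℂ) =
        (Real.exp (bPlus0 i ρ JE JM U) : ℂ) * (Real.exp (bPlus0 i ρ JE JM (spaceReflect i 0 U)) : ℂ) *
          ((Real.exp (bPlane0 i ρ JE JM U / 2) : ℂ) * (Real.exp (bPlane0 i ρ JE JM U / 2) : ℂ)) := by
      rw [← Complex.ofReal_mul, ← Complex.ofReal_mul, ← Complex.ofReal_mul, ← Real.exp_add, ← Real.exp_add,
        ← Real.exp_add]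
      congr 2; ring
    rw [h2]; ring
  simp_rw [hint]
  have hΨm : Measurable fun U : Config d L₀ (2 * n + 2) G => Φ U * conj (Φ (spaceReflect i 0 U)) :=
    hΦm.mul (Complex.continuous_conj.measurable.comp (hΦm.comp (continuous_spaceReflect i 0).measurable))
  have hΨb : ∀ U : Config d L₀ (2 * n + 2) G, ‖Φ U * conj (Φ (spaceReflect i 0 U))‖ ≤
      (|K| * Real.exp KB * Real.exp KM) * (|K| * Real.exp KB * Real.exp KM) := fun U => by
    rw [norm_mul, Complex.norm_conj]
    exact mul_le_mul (hΦb U) (hΦb _) (norm_nonneg _) (by positivity)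
  rw [integral_eq_integral_prod_mulOn ∅ hΨm hΨb]
  simp_rw [mulOn_empty]
  simp_rw [splice_empty] at key
  exact key

end SiteHalves

end SliceRP

end FiniteTemperature

end Literature.Barriers.QuantumFields

/-! ## Assembly, part I: transversally smeared Polyakov loops of a slice, pairings, translations -/

namespace Literature.Barriers.QuantumFields

namespace FiniteTemperature

namespace SliceRP

open Literature.Probability.LatticeModels

variable {d' L₀ L : ℕ} {G : Type*} [Group G] {N : ℕ}
variable [TopologicalSpace G] [IsTopologicalGroup G] [CompactSpace G] [MeasurableSpace G] [BorelSpace G]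
variable (i : Fin (d' + 1)) (ρ : G →* Matrix (Fin N) (Fin N) ℂ)

section Geometry

omit [Group G] [TopologicalSpace G] [IsTopologicalGroup G] [CompactSpace G] [MeasurableSpace G] [BorelSpace G]

/-- The reflection `σ_c` acts on the slice coordinate: `σ_c (ins_i(s, y)) = ins_i(c − s, y)`.
[folklore] -/
theorem sigma_ins (c s : ZMod L) (y : Fin d' → ZMod L) :
    sigma i c (Torus.ins i s y) = Torus.ins i (c - s) y := by
  funext j
  refine Fin.succAboveCases i ?_ (fun j' => ?_) j
  · simp [sigma]
  · rw [sigma_apply_of_ne i c (Fin.succAbove_ne i j'), Torus.ins_apply_succAbove,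
      Torus.ins_apply_succAbove]

/-- The slice of a site `(t, ins_i(s, y))` is `s`. [folklore] -/
theorem ins_apply_i (s : ZMod L) (y : Fin d' → ZMod L) : Torus.ins i s y i = s :=
  Torus.ins_apply_same i s y

end Geometry

/-! ### The smeared slice observable `A_s = Σ_y c(y) χ(P_{ins_i(s,y)})` -/

section Obs

variable [NeZero L] (c : (Fin d' → ZMod L) → ℂ)

/-- The transversally smeared Polyakov loop of the slice `s`:
`A_s(U) = Σ_{y ∈ (ℤ/L)^{d'}} c(y) χ(g_{L_{ins_i(s, y)}})` (Borgs–Seiler's `F(L_{x₁}) = Σ h(x_⊥) χ(L_x)`,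
(III.27)). [cite: BorgsSeiler1983, §III.2 (III.27) (p. 348)] -/
def sliceObs (s : ZMod L) (U : Config (d' + 1) L₀ L G) : ℂ :=
  ∑ y, c y * polyakovTrace ρ U (Torus.ins i s y)

omit [TopologicalSpace G] [IsTopologicalGroup G] [CompactSpace G] [MeasurableSpace G] [BorelSpace G] in
/-- **The slice observable under the reflection `θ_c`**: `A_s(θ_c U) = A_{c − s}(U)`. [folklore] -/
theorem sliceObs_spaceReflect (c' s : ZMod L) (U : Config (d' + 1) L₀ L G) :
    sliceObs i ρ c s (spaceReflect i c' U) = sliceObs i ρ c (c' - s) U := by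
  unfold sliceObs
  refine Finset.sum_congr rfl fun y _ => ?_
  rw [polyakovTrace_spaceReflect, sigma_ins]

omit [TopologicalSpace G] [IsTopologicalGroup G] [CompactSpace G] [MeasurableSpace G] [BorelSpace G] in
/-- **The slice observable under translations in direction `i`**: `A_s(τ_{a eᵢ} U) = A_{s+a}(U)`.
[folklore] -/
theorem sliceObs_translate (a s : ZMod L) (U : Config (d' + 1) L₀ L G) :
    sliceObs i ρ c s (translate (Pi.single i a) U) = sliceObs i ρ c (s + a) U := by
  unfold sliceObs
  refine Finset.sum_congr rfl fun y _ => ?_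
  rw [polyakovTrace_translate, Torus.ins_add_single]

omit [TopologicalSpace G] [IsTopologicalGroup G] [CompactSpace G] [MeasurableSpace G] [BorelSpace G] in
/-- The slice observable is unchanged by the gauge decoupling. [folklore] -/
theorem sliceObs_decouple [NeZero L₀] {n : ℕ} (c : (Fin d' → ZMod (2 * n + 2)) → ℂ) (s : ZMod (2 * n + 2))
    (U : Config (d' + 1) L₀ (2 * n + 2) G) :
    sliceObs i ρ c s (decouple i U) = sliceObs i ρ c s U := by
  unfold sliceObs
  simp_rw [polyakovTrace_decouple]

omit [CompactSpace G] [MeasurableSpace G] [BorelSpace G] in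
/-- The slice observable is continuous in the configuration. [folklore] -/
theorem continuous_sliceObs (hρ : Continuous ρ) (s : ZMod L) :
    Continuous fun U : Config (d' + 1) L₀ L G => sliceObs i ρ c s U :=
  continuous_finsetSum _ fun _ _ => continuous_const.mul (continuous_polyakovTrace ρ hρ _)

omit [TopologicalSpace G] [IsTopologicalGroup G] [CompactSpace G] [MeasurableSpace G] [BorelSpace G] in
/-- The slice observable `A_s` depends only on the time-like links based in the slice `s`.
[folklore] -/
theorem dependsOn_sliceObs (s : ZMod L) :
    DependsOn (sliceObs (L₀ := L₀) (G := G) i ρ c s)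
      {e : Site (d' + 1) L₀ L × Dir (d' + 1) | e.2 = none ∧ e.1.2 i = s} := by
  intro U V hUV
  unfold sliceObs polyakovTrace polyakovLine
  refine Finset.sum_congr rfl fun y _ => ?_
  rw [timeHolonomy_congr (U := U) (V := V) L₀ 0 (Torus.ins i s y) fun j _ =>
    hUV _ ⟨rfl, Torus.ins_apply_same i s y⟩]

end Obs

/-! ### Pairings `⟨A_s, A_t⟩ = ∫ A_s conj(A_t) e^{−S}` and the two-point chain `g(m) = ⟨A_0, A_m⟩` -/

section Pairing

variable [NeZero L₀] [NeZero L] (JE JM : ℝ) (c : (Fin d' → ZMod L) → ℂ)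

/-- The (unnormalised) pairing `⟨A_s, A_t⟩ = ∫ A_s(U) conj(A_t(U)) e^{−S(U)} ∏dg`. [folklore] -/
def pair (s t : ZMod L) : ℂ :=
  ∫ U, sliceObs i ρ c s U * conj (sliceObs i ρ c t U) * (weight ρ JE JM U : ℂ) ∂haar (d' + 1) L₀ L G

/-- The two-point chain in direction `i`: `g(m) = ⟨A_0, A_m⟩`. [folklore] -/
def chain (m : ZMod L) : ℂ := pair (L₀ := L₀) i ρ JE JM c 0 m

/-- **Translation invariance of the pairing**: `⟨A_s, A_t⟩ = g(t − s)`. [cite: BorgsSeiler1983, §II.3 (II.22) (p. 337)] -/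
theorem pair_eq_chain (s t : ZMod L) :
    pair (L₀ := L₀) i ρ JE JM c s t = chain (L₀ := L₀) i ρ JE JM c (t - s) := by
  unfold chain pair
  have hmp := measurePreserving_translateEquiv (d := d' + 1) (L₀ := L₀) (L := L) (G := G) (Pi.single i s)
  have h := hmp.integral_comp' (fun U : Config (d' + 1) L₀ L G =>
    sliceObs i ρ c 0 U * conj (sliceObs i ρ c (t - s) U) * (weight ρ JE JM U : ℂ))
  rw [coe_translateEquiv] at h
  rw [← h]
  refine integral_congr_ae (Eventually.of_forall fun U => ?_)
  simp only [sliceObs_translate, weight_translate, zero_add, sub_add_cancel]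

variable [SecondCountableTopology G]

/-- Integrability of products `A_s conj(A_t) e^{−S}` (continuous on a compact space). [folklore] -/
theorem integrable_pairIntegrand (hρ : Continuous ρ) (s t : ZMod L) :
    Integrable (fun U : Config (d' + 1) L₀ L G =>
      sliceObs i ρ c s U * conj (sliceObs i ρ c t U) * (weight ρ JE JM U : ℂ)) (haar (d' + 1) L₀ L G) :=
  integrable_of_continuous_complex
    (((continuous_sliceObs i ρ c hρ s).mul (Complex.continuous_conj.comp (continuous_sliceObs i ρ c hρ t))).mul
      (Complex.continuous_ofReal.comp (continuous_weight ρ hρ JE JM)))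

/-- **The reflection form of a two-term observable** `F = A_a + z A_b` against `θ_{c'}`:
`∫ F conj(F∘θ_{c'}) e^{−S} = g(c'−2a) + conj z · g(c'−a−b) + z · g(c'−a−b) + z conj z · g(c'−2b)`.
[folklore] -/
theorem integral_twoTerm_spaceReflect (hρ : Continuous ρ) (c' a b : ZMod L) (z : ℂ) :
    ∫ U, (sliceObs i ρ c a U + z * sliceObs i ρ c b U) *
        conj (sliceObs i ρ c a (spaceReflect i c' U) + z * sliceObs i ρ c b (spaceReflect i c' U)) *
        (weight ρ JE JM U : ℂ) ∂haar (d' + 1) L₀ L G =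
      chain (L₀ := L₀) i ρ JE JM c (c' - a - a) + conj z * chain (L₀ := L₀) i ρ JE JM c (c' - b - a) +
        z * chain (L₀ := L₀) i ρ JE JM c (c' - a - b) +
        z * conj z * chain (L₀ := L₀) i ρ JE JM c (c' - b - b) := by
  simp only [sliceObs_spaceReflect]
  have hI := integrable_pairIntegrand (L₀ := L₀) (G := G) i ρ JE JM c hρ
  have hexp : ∀ U : Config (d' + 1) L₀ L G,
      (sliceObs i ρ c a U + z * sliceObs i ρ c b U) *
        conj (sliceObs i ρ c (c' - a) U + z * sliceObs i ρ c (c' - b) U) * (weight ρ JE JM U : ℂ) =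
      sliceObs i ρ c a U * conj (sliceObs i ρ c (c' - a) U) * (weight ρ JE JM U : ℂ) +
        conj z * (sliceObs i ρ c a U * conj (sliceObs i ρ c (c' - b) U) * (weight ρ JE JM U : ℂ)) +
        z * (sliceObs i ρ c b U * conj (sliceObs i ρ c (c' - a) U) * (weight ρ JE JM U : ℂ)) +
        z * conj z * (sliceObs i ρ c b U * conj (sliceObs i ρ c (c' - b) U) * (weight ρ JE JM U : ℂ)) := by
    intro U
    simp only [map_add, map_mul]
    ring
  simp_rw [hexp]
  rw [integral_add, integral_add, integral_add, integral_const_mul, integral_const_mul, integral_const_mul]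
  · rw [← pair, ← pair, ← pair, ← pair, pair_eq_chain, pair_eq_chain, pair_eq_chain, pair_eq_chain]
  · exact hI a (c' - a)
  · exact (hI a (c' - b)).const_mul _
  · exact (hI a (c' - a)).add ((hI a (c' - b)).const_mul _)
  · exact (hI b (c' - a)).const_mul _
  · exact ((hI a (c' - a)).add ((hI a (c' - b)).const_mul _)).add ((hI b (c' - a)).const_mul _)
  · exact (hI b (c' - b)).const_mul _

end Pairing

end SliceRP

end FiniteTemperature

end Literature.Barriers.QuantumFields

/-! ## Assembly, part II: the crossing coupling `X(U)` as a link coupling -/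

namespace Literature.Barriers.QuantumFields

namespace FiniteTemperature

namespace SliceRP

variable {d L₀ : ℕ} {G : Type*} [Group G] {N : ℕ} {n : ℕ}
variable [TopologicalSpace G] [IsTopologicalGroup G] [CompactSpace G] [MeasurableSpace G] [BorelSpace G]
variable (i : Fin d) (ρ : G →* Matrix (Fin N) (Fin N) ℂ) (JE JM : ℝ)

section CrossBridge

open Literature.MathematicalPhysics.QuantumFieldTheory (trace_re_mul_conjTranspose_comm)

/-- The axial crossing term of the link `(x, ν)`: `Re tr(ρ(U(x + eᵢ, ν)) ρ(U(x, ν))ᴴ)`. [folklore] -/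
def eTerm (U : Config d L₀ (2 * n + 2) G) (x : Site d L₀ (2 * n + 2)) (ν : Dir d) : ℝ :=
  (ρ (U (x.shift (some i), ν)) * (ρ (U (x, ν)))ᴴ).trace.re

omit [TopologicalSpace G] [IsTopologicalGroup G] [CompactSpace G] [MeasurableSpace G] [BorelSpace G] in
/-- For unitary `ρ`: `Re tr ρ(g h⁻¹) = Re tr(ρ(g) ρ(h)ᴴ)`. [folklore] -/
theorem trace_re_rep_mul_inv (hρu : ∀ g, ρ g ∈ Matrix.unitaryGroup (Fin N) ℂ) (g h : G) :
    (ρ (g * h⁻¹)).trace.re = (ρ g * (ρ h)ᴴ).trace.re := by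
  rw [map_mul, rep_inv_eq_star ρ hρu, Matrix.star_eq_conjTranspose]

omit [Group G] [TopologicalSpace G] [IsTopologicalGroup G] [CompactSpace G] [MeasurableSpace G] [BorelSpace G] in
/-- **Planes containing `i` versus directions `j ≠ i`**: `Σ_{p ∋ i} f(otherDir p) = Σ_{j ≠ i} f(j)`.
[folklore] -/
theorem sum_planes_otherDir (f : Fin d → ℝ) :
    ∑ p ∈ Finset.univ.filter (fun p : {p : Fin d × Fin d // p.1 < p.2} => p.1.1 = i ∨ p.1.2 = i),
        f (otherDir i p) =
      ∑ j ∈ Finset.univ.filter (fun j : Fin d => j ≠ i), f j := by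
  refine Finset.sum_bij (fun p _ => otherDir i p) (fun p hp => ?_) (fun p hp q hq h => ?_)
    (fun j hj => ?_) (fun _ _ => rfl)
  · simp only [Finset.mem_filter, Finset.mem_univ, true_and] at hp ⊢
    have hlt := p.2
    unfold otherDir
    split_ifs with h
    · intro h'; rw [h', h] at hlt; exact lt_irrefl _ hlt
    · intro h'; rw [hp.resolve_left h, h'] at hlt; exact lt_irrefl _ hlt
  · simp only [Finset.mem_filter, Finset.mem_univ, true_and] at hp hq
    have hp2 := p.2
    have hq2 := q.2
    unfold otherDir at h
    apply Subtype.ext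
    by_cases h1 : p.1.1 = i <;> by_cases h2 : q.1.1 = i <;> simp only [h1, h2, if_true, if_false] at h
    · exact Prod.ext (h1.trans h2.symm) h
    · -- `p = (i, p₂)`, `q = (q₁, i)` with `p₂ = q₁`: then `i < p₂ = q₁ < i`
      have hq' := hq.resolve_left h2
      rw [h1] at hp2; rw [hq'] at hq2; rw [h] at hp2
      exact absurd (hp2.trans hq2) (lt_irrefl _)
    · have hp' := hp.resolve_left h1
      rw [h2] at hq2; rw [hp'] at hp2; rw [← h] at hq2
      exact absurd (hq2.trans hp2) (lt_irrefl _)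
    · exact Prod.ext h ((hp.resolve_left h1).trans (hq.resolve_left h2).symm)
  · simp only [Finset.mem_filter, Finset.mem_univ, true_and] at hj
    rcases lt_or_gt_of_ne hj with h | h
    · refine ⟨⟨(j, i), h⟩, by simp, ?_⟩
      simp [otherDir, hj]
    · refine ⟨⟨(i, j), h⟩, by simp, ?_⟩
      simp [otherDir]

omit [TopologicalSpace G] [IsTopologicalGroup G] [CompactSpace G] [MeasurableSpace G] [BorelSpace G] in
/-- **The axial terms as a sum over the link directions `ν ≠ i`** (unitary `ρ`):
`axTerm U x = J_E e(x, time) + J_M Σ_{j ≠ i} e(x, j)`. [folklore] -/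
theorem axTerm_eq (hρu : ∀ g, ρ g ∈ Matrix.unitaryGroup (Fin N) ℂ) (U : Config d L₀ (2 * n + 2) G)
    (x : Site d L₀ (2 * n + 2)) :
    axTerm i ρ JE JM U x = JE * eTerm i ρ U x none +
      JM * ∑ j ∈ Finset.univ.filter (fun j : Fin d => j ≠ i), eTerm i ρ U x (some j) := by
  unfold axTerm eTerm
  simp only [trace_re_rep_mul_inv ρ hρu]
  rw [sum_planes_otherDir i (fun j => (ρ (U (x.shift (some i), some j)) * (ρ (U (x, some j)))ᴴ).trace.re)]

/-! ### The crossing link sets -/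

variable [NeZero L₀]

/-- The ELECTRIC crossing links: time-like links based in the slice `1`. [folklore] -/
def crossE : Finset (Site d L₀ (2 * n + 2) × Dir d) :=
  (Finset.univ.filter fun x => slice i x = 1) ×ˢ {none}

/-- The MAGNETIC crossing links of the slice `1`: spatial in-slice links based in the slice `1`.
[folklore] -/
def crossM : Finset (Site d L₀ (2 * n + 2) × Dir d) :=
  (Finset.univ.filter fun x => slice i x = 1) ×ˢ (Finset.univ.filter fun ν : Dir d => ν ≠ none ∧ ν ≠ some i)

/-- The crossing links of the slice `n + 1` (all in-slice links based there). [folklore] -/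
def crossH : Finset (Site d L₀ (2 * n + 2) × Dir d) :=
  (Finset.univ.filter fun x => slice i x = ((n + 1 : ℕ) : ZMod (2 * n + 2))) ×ˢ
    (Finset.univ.filter fun ν : Dir d => ν ≠ some i)

/-- The link weights: `J_E` on time-like, `J_M` on space-like links. [folklore] -/
def Jw (e : Site d L₀ (2 * n + 2) × Dir d) : ℝ := if e.2 = none then JE else JM

/-- The ELECTRIC crossing energy of the plane between the slices `0` and `1`:
`E₀(U) = J_E Σ_{x : slice x = 0} Re tr(ρ(U(x + eᵢ, 0)) ρ(U(x, 0))ᴴ)`. [folklore] -/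
def elec0 (U : Config d L₀ (2 * n + 2) G) : ℝ :=
  JE * ∑ x ∈ Finset.univ.filter (fun x => slice i x = 0), eTerm i ρ U x none

omit [NeZero L₀] [TopologicalSpace G] [IsTopologicalGroup G] [CompactSpace G] [MeasurableSpace G] [BorelSpace G] in
/-- Link couplings are additive over disjoint link sets. [folklore] -/
theorem linkCoupling_union (J : Site d L₀ (2 * n + 2) × Dir d → ℝ) {S T : Finset (Site d L₀ (2 * n + 2) × Dir d)}
    (hST : Disjoint S T) (U : Config d L₀ (2 * n + 2) G) :
    linkCoupling i ρ J (S ∪ T) U = linkCoupling i ρ J S U + linkCoupling i ρ J T U := by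
  unfold linkCoupling
  rw [Finset.sum_union hST]

omit [NeZero L₀] [Group G] [TopologicalSpace G] [IsTopologicalGroup G] [CompactSpace G] [MeasurableSpace G] [BorelSpace G] in
/-- For a site of the slice `1`, `x̂ = x − eᵢ`. [folklore] -/
theorem hatSite_one_of_slice_one {x : Site d L₀ (2 * n + 2)} (hx : slice i x = 1) : hatSite i 1 x = back i x := by
  rcases x with ⟨t, y⟩
  simp only [hatSite, back, Prod.mk.injEq, true_and]
  funext j
  by_cases hj : j = i
  · subst hj
    simp only [slice] at hx
    simp [sigma, hx]
  · simp [sigma, hj]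

omit [NeZero L₀] [Group G] [TopologicalSpace G] [IsTopologicalGroup G] [CompactSpace G] [MeasurableSpace G] [BorelSpace G] in
/-- For a site of the slice `n + 1`, `x̂ = x + eᵢ`. [folklore] -/
theorem hatSite_one_of_slice_half {x : Site d L₀ (2 * n + 2)} (hx : slice i x = ((n + 1 : ℕ) : ZMod (2 * n + 2))) :
    hatSite i 1 x = x.shift (some i) := by
  rcases x with ⟨t, y⟩
  simp only [hatSite, Site.shift, Prod.mk.injEq, true_and]
  funext j
  by_cases hj : j = i
  · subst hj
    simp only [slice] at hx
    simp only [sigma, Function.update_self, Pi.add_apply, Pi.single_eq_same, hx]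
    have h0 : (2 * n + 2 : ZMod (2 * n + 2)) = 0 := by exact_mod_cast ZMod.natCast_self (2 * n + 2)
    push_cast
    linear_combination -h0
  · simp [sigma, hj]

omit [Group G] [TopologicalSpace G] [IsTopologicalGroup G] [CompactSpace G] [MeasurableSpace G] [BorelSpace G] in
/-- Reindexing the slice `1` by the slice `0` (`x' ↦ x' − eᵢ`). [folklore] -/
theorem sum_slice_one_eq_sum_slice_zero (h : Site d L₀ (2 * n + 2) → ℝ) :
    ∑ x ∈ Finset.univ.filter (fun x => slice i x = 1), h (back i x) =
      ∑ x ∈ Finset.univ.filter (fun x => slice i x = 0), h x := by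
  refine Finset.sum_nbij' (back i) (fun x => x.shift (some i)) (fun x hx => ?_) (fun x hx => ?_)
    (fun x _ => back_shift_self i x) (fun x _ => back_shift_self' i x) (fun _ _ => rfl)
  · simp only [Finset.mem_filter, Finset.mem_univ, true_and] at hx ⊢
    rw [slice_back, hx, sub_self]
  · simp only [Finset.mem_filter, Finset.mem_univ, true_and] at hx ⊢
    rw [slice_shift_some_self, hx, zero_add]

omit [NeZero L₀] [Group G] [TopologicalSpace G] [IsTopologicalGroup G] [CompactSpace G] [MeasurableSpace G] [BorelSpace G] in
/-- Sums over directions `ν ≠ i`: the time direction plus the spatial `j ≠ i`. [folklore] -/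
theorem sum_dir_ne (f : Dir d → ℝ) :
    ∑ ν ∈ Finset.univ.filter (fun ν : Dir d => ν ≠ some i), f ν =
      f none + ∑ j ∈ Finset.univ.filter (fun j : Fin d => j ≠ i), f (some j) := by
  rw [Finset.sum_filter, Fintype.sum_option, if_pos (Option.some_ne_none i).symm, Finset.sum_filter]
  congr 1
  refine Finset.sum_congr rfl fun j _ => ?_
  simp only [ne_eq, Option.some.injEq]

omit [NeZero L₀] [Group G] [TopologicalSpace G] [IsTopologicalGroup G] [CompactSpace G] [MeasurableSpace G] [BorelSpace G] in
/-- Sums over spatial directions `ν ≠ i` as sums over `j ≠ i`. [folklore] -/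
theorem sum_dir_ne_ne (f : Dir d → ℝ) :
    ∑ ν ∈ Finset.univ.filter (fun ν : Dir d => ν ≠ none ∧ ν ≠ some i), f ν =
      ∑ j ∈ Finset.univ.filter (fun j : Fin d => j ≠ i), f (some j) := by
  rw [Finset.sum_filter, Fintype.sum_option, if_neg (by simp), zero_add, Finset.sum_filter]
  refine Finset.sum_congr rfl fun j _ => ?_
  simp only [ne_eq, Option.some.injEq, reduceCtorEq, not_false_eq_true, true_and]

omit [TopologicalSpace G] [IsTopologicalGroup G] [CompactSpace G] [MeasurableSpace G] [BorelSpace G] in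
/-- **The electric crossing energy is the coupling of the electric crossing links.** [folklore] -/
theorem linkCoupling_crossE (U : Config d L₀ (2 * n + 2) G) :
    linkCoupling i ρ (Jw JE JM) (crossE (L₀ := L₀) i) U = elec0 i ρ JE U := by
  unfold linkCoupling crossE elec0
  rw [Finset.sum_product, Finset.mul_sum, ← sum_slice_one_eq_sum_slice_zero i]
  refine Finset.sum_congr rfl fun x hx => ?_
  simp only [Finset.mem_filter, Finset.mem_univ, true_and] at hx
  rw [Finset.sum_singleton]
  simp only [Jw, if_true]
  congr 1
  rw [spaceReflect_apply_of_ne i 1 U x (by simp), hatSite_one_of_slice_one i hx, eTerm,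
    trace_re_mul_conjTranspose_comm, back_shift_self]

omit [TopologicalSpace G] [IsTopologicalGroup G] [CompactSpace G] [MeasurableSpace G] [BorelSpace G] in
/-- The magnetic crossing coupling of the slice `1` in axial form. [folklore] -/
theorem linkCoupling_crossM (U : Config d L₀ (2 * n + 2) G) :
    linkCoupling i ρ (Jw JE JM) (crossM (L₀ := L₀) i) U =
      JM * ∑ x ∈ Finset.univ.filter (fun x => slice i x = 0),
        ∑ j ∈ Finset.univ.filter (fun j : Fin d => j ≠ i), eTerm i ρ U x (some j) := by
  unfold linkCoupling crossM
  rw [Finset.sum_product, Finset.mul_sum,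
    ← sum_slice_one_eq_sum_slice_zero i (fun x => JM * ∑ j ∈ Finset.univ.filter (fun j : Fin d => j ≠ i),
      eTerm i ρ U x (some j))]
  refine Finset.sum_congr rfl fun x hx => ?_
  simp only [Finset.mem_filter, Finset.mem_univ, true_and] at hx
  rw [sum_dir_ne_ne i (fun ν => Jw JE JM (x, ν) * (ρ (spaceReflect i 1 U (x, ν)) * (ρ (U (x, ν)))ᴴ).trace.re),
    Finset.mul_sum]
  refine Finset.sum_congr rfl fun j hj => ?_
  simp only [Finset.mem_filter, Finset.mem_univ, true_and] at hj
  have hj' : (some j : Dir d) ≠ some i := fun h => hj (Option.some_injective _ h)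
  simp only [Jw, reduceCtorEq, if_false]
  congr 1
  rw [spaceReflect_apply_of_ne i 1 U x hj', hatSite_one_of_slice_one i hx, eTerm,
    trace_re_mul_conjTranspose_comm, back_shift_self]

omit [TopologicalSpace G] [IsTopologicalGroup G] [CompactSpace G] [MeasurableSpace G] [BorelSpace G] in
/-- The crossing coupling of the slice `n + 1` in axial form (unitary `ρ`). [folklore] -/
theorem linkCoupling_crossH (hρu : ∀ g, ρ g ∈ Matrix.unitaryGroup (Fin N) ℂ) (U : Config d L₀ (2 * n + 2) G) :
    linkCoupling i ρ (Jw JE JM) (crossH (L₀ := L₀) i) U =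
      ∑ x ∈ Finset.univ.filter (fun x => slice i x = ((n + 1 : ℕ) : ZMod (2 * n + 2))), axTerm i ρ JE JM U x := by
  unfold linkCoupling crossH
  rw [Finset.sum_product]
  refine Finset.sum_congr rfl fun x hx => ?_
  simp only [Finset.mem_filter, Finset.mem_univ, true_and] at hx
  rw [sum_dir_ne i (fun ν => Jw JE JM (x, ν) * (ρ (spaceReflect i 1 U (x, ν)) * (ρ (U (x, ν)))ᴴ).trace.re),
    axTerm_eq i ρ JE JM hρu U x, Finset.mul_sum]
  simp only [Jw, if_true, reduceCtorEq, if_false]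
  congr 1
  · congr 1
    rw [spaceReflect_apply_of_ne i 1 U x (by simp), hatSite_one_of_slice_half i hx, eTerm]
  · refine Finset.sum_congr rfl fun j hj => ?_
    simp only [Finset.mem_filter, Finset.mem_univ, true_and] at hj
    have hj' : (some j : Dir d) ≠ some i := fun h => hj (Option.some_injective _ h)
    congr 1
    rw [spaceReflect_apply_of_ne i 1 U x hj', hatSite_one_of_slice_half i hx, eTerm]

omit [TopologicalSpace G] [IsTopologicalGroup G] [CompactSpace G] [MeasurableSpace G] [BorelSpace G] in
/-- **The crossing part of the decoupled action as electric energy plus link couplings**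
(unitary `ρ`, `1 ≤ n`): `X(U) = E₀(U) + X_{crossM}(U) + X_{crossH}(U)`. [folklore] -/
theorem xCross_eq (hρu : ∀ g, ρ g ∈ Matrix.unitaryGroup (Fin N) ℂ) (hn : 1 ≤ n) (U : Config d L₀ (2 * n + 2) G) :
    xCross i ρ JE JM U = elec0 i ρ JE U + linkCoupling i ρ (Jw JE JM) (crossM (L₀ := L₀) i) U +
      linkCoupling i ρ (Jw JE JM) (crossH (L₀ := L₀) i) U := by
  classical
  have hne : (0 : ZMod (2 * n + 2)) ≠ ((n + 1 : ℕ) : ZMod (2 * n + 2)) := by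
    intro h
    have h1 := congrArg ZMod.val h
    rw [ZMod.val_zero, ZMod.val_cast_of_lt (by omega)] at h1
    omega
  have hset : Finset.univ.filter (fun x : Site d L₀ (2 * n + 2) => CrossSl i x) =
      Finset.univ.filter (fun x => slice i x = 0) ∪
        Finset.univ.filter (fun x => slice i x = ((n + 1 : ℕ) : ZMod (2 * n + 2))) := by
    ext x; simp [CrossSl]
  unfold xCross
  rw [hset, Finset.sum_union]
  · rw [linkCoupling_crossH i ρ JE JM hρu, linkCoupling_crossM, elec0, add_left_inj, Finset.mul_sum,
      Finset.mul_sum, ← Finset.sum_add_distrib]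
    refine Finset.sum_congr rfl fun x _ => ?_
    rw [axTerm_eq i ρ JE JM hρu]
  · rw [Finset.disjoint_filter]
    intro x _ h0 h1
    exact hne (h0.symm.trans h1)

omit [TopologicalSpace G] [IsTopologicalGroup G] [CompactSpace G] [MeasurableSpace G] [BorelSpace G] in
/-- The same with the electric energy as a link coupling:
`X(U) = X_{crossE}(U) + X_{crossM}(U) + X_{crossH}(U)`. [folklore] -/
theorem xCross_eq' (hρu : ∀ g, ρ g ∈ Matrix.unitaryGroup (Fin N) ℂ) (hn : 1 ≤ n) (U : Config d L₀ (2 * n + 2) G) :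
    xCross i ρ JE JM U = linkCoupling i ρ (Jw JE JM) (crossE (L₀ := L₀) i ∪ crossM i ∪ crossH i) U := by
  classical
  have hne1 : (1 : ZMod (2 * n + 2)) ≠ ((n + 1 : ℕ) : ZMod (2 * n + 2)) := by
    intro h
    haveI : Fact (1 < 2 * n + 2) := ⟨by omega⟩
    have h1 := congrArg ZMod.val h
    rw [ZMod.val_one, ZMod.val_cast_of_lt (by omega)] at h1
    omega
  have hEM : Disjoint (crossE (L₀ := L₀) (n := n) i) (crossM i) := by
    rw [Finset.disjoint_left]
    rintro ⟨x, ν⟩ h1 h2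
    simp only [crossE, crossM, Finset.mem_product, Finset.mem_filter, Finset.mem_univ, true_and,
      Finset.mem_singleton] at h1 h2
    exact h2.2.1 h1.2
  have hEMH : Disjoint (crossE (L₀ := L₀) (n := n) i ∪ crossM i) (crossH i) := by
    rw [Finset.disjoint_left]
    rintro ⟨x, ν⟩ h1 h2
    simp only [crossE, crossM, crossH, Finset.mem_union, Finset.mem_product, Finset.mem_filter,
      Finset.mem_univ, true_and, Finset.mem_singleton] at h1 h2
    rcases h1 with h1 | h1
    · exact hne1 (h1.1.symm.trans h2.1)
    · exact hne1 (h1.1.symm.trans h2.1)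
  rw [linkCoupling_union i ρ _ hEMH, linkCoupling_union i ρ _ hEM, linkCoupling_crossE, xCross_eq i ρ JE JM hρu hn]

omit [Group G] [TopologicalSpace G] [IsTopologicalGroup G] [CompactSpace G] [MeasurableSpace G] [BorelSpace G] in
/-- The crossing links are positive links of `θ₁` (`1 ≤ n`). [folklore] -/
theorem cross_subset_posLinks (hn : 1 ≤ n) :
    crossE (L₀ := L₀) (n := n) i ∪ crossM i ∪ crossH i ⊆ posLinks i := by
  haveI : Fact (1 < 2 * n + 2) := ⟨by omega⟩
  have hv1 : ∀ {x : Site d L₀ (2 * n + 2)}, slice i x = 1 → PosIn i x := fun hx => by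
    unfold PosIn; rw [hx, ZMod.val_one]; omega
  have hvh : ∀ {x : Site d L₀ (2 * n + 2)}, slice i x = ((n + 1 : ℕ) : ZMod (2 * n + 2)) → PosIn i x := fun hx => by
    unfold PosIn; rw [hx, ZMod.val_cast_of_lt (by omega)]; omega
  rintro ⟨x, ν⟩ h
  simp only [crossE, crossM, crossH, Finset.mem_union, Finset.mem_product, Finset.mem_filter,
    Finset.mem_univ, true_and, Finset.mem_singleton] at h
  rcases h with (h | h) | h
  · exact mem_posLinks_of_ne i (by rw [h.2]; simp) (hv1 h.1)
  · exact mem_posLinks_of_ne i h.2.2 (hv1 h.1)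
  · exact mem_posLinks_of_ne i h.2 (hvh h.1)

omit [Group G] [TopologicalSpace G] [IsTopologicalGroup G] [CompactSpace G] [MeasurableSpace G] [BorelSpace G] in
/-- The reduced crossing links are positive links of `θ₁` (`1 ≤ n`). [folklore] -/
theorem cross'_subset_posLinks (hn : 1 ≤ n) :
    crossM (L₀ := L₀) (n := n) i ∪ crossH i ⊆ posLinks i := fun e he =>
  cross_subset_posLinks i hn (by
    rw [Finset.union_assoc]
    exact Finset.mem_union_right _ he)

omit [NeZero L₀] in
/-- The link weights are nonnegative for `J_E, J_M ≥ 0`. [folklore] -/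
theorem Jw_nonneg (hJE : 0 ≤ JE) (hJM : 0 ≤ JM) (e : Site d L₀ (2 * n + 2) × Dir d) : 0 ≤ Jw JE JM e := by
  unfold Jw; split_ifs <;> assumption

end CrossBridge

end SliceRP

end FiniteTemperature

end Literature.Barriers.QuantumFields

/-! ## Assembly, part III: the reflection-positive forms of the chain; reality and convexity -/

namespace Literature.Barriers.QuantumFields

namespace FiniteTemperature

namespace SliceRP

open Literature.Probability.LatticeModels

variable {d' L₀ : ℕ} {G : Type*} [Group G] {N : ℕ} {n : ℕ}
variable [TopologicalSpace G] [IsTopologicalGroup G] [CompactSpace G] [MeasurableSpace G] [BorelSpace G]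
variable (i : Fin (d' + 1)) (ρ : G →* Matrix (Fin N) (Fin N) ℂ)

section Forms

variable [NeZero L₀] (JE JM : ℝ) (c : (Fin d' → ZMod (2 * n + 2)) → ℂ)

omit [NeZero L₀] [TopologicalSpace G] [IsTopologicalGroup G] [CompactSpace G] [MeasurableSpace G] [BorelSpace G] in
/-- The two-term observable `A_a + z A_b` depends only on the time-like links of the slices `a, b`.
[folklore] -/
theorem dependsOn_twoTerm (a b : ZMod (2 * n + 2)) (z : ℂ) {S : Set (Site (d' + 1) L₀ (2 * n + 2) × Dir (d' + 1))}
    (ha : {e : Site (d' + 1) L₀ (2 * n + 2) × Dir (d' + 1) | e.2 = none ∧ e.1.2 i = a} ⊆ S)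
    (hb : {e : Site (d' + 1) L₀ (2 * n + 2) × Dir (d' + 1) | e.2 = none ∧ e.1.2 i = b} ⊆ S) :
    DependsOn (fun U : Config (d' + 1) L₀ (2 * n + 2) G => sliceObs i ρ c a U + z * sliceObs i ρ c b U) S := by
  intro U V hUV
  simp only
  rw [dependsOn_sliceObs i ρ c a fun e he => hUV e (ha he), dependsOn_sliceObs i ρ c b fun e he => hUV e (hb he)]

omit [Group G] [TopologicalSpace G] [IsTopologicalGroup G] [CompactSpace G] [MeasurableSpace G] [BorelSpace G] in
/-- Time-like links of the slices `0, …, n + 1` are positive or shared links of `θ₀`. [folklore] -/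
theorem timeLinks_subset_site (a : ZMod (2 * n + 2)) (ha : a.val ≤ n + 1) :
    {e : Site (d' + 1) L₀ (2 * n + 2) × Dir (d' + 1) | e.2 = none ∧ e.1.2 i = a} ⊆
      ((posLinks0 (L₀ := L₀) (n := n) i ∪ ∅ ∪ sharedLinks0 i :
        Finset (Site (d' + 1) L₀ (2 * n + 2) × Dir (d' + 1))) : Set (Site (d' + 1) L₀ (2 * n + 2) × Dir (d' + 1))) := by
  rintro ⟨x, ν⟩ ⟨hν, hx⟩
  simp only at hν hx
  subst hν
  simp only [Finset.union_empty, Finset.coe_union, Set.mem_union, Finset.mem_coe, posLinks0, sharedLinks0,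
    Finset.mem_filter, Finset.mem_univ, true_and, PosIn0, Plane0, slice, hx, ne_eq, reduceCtorEq,
    not_false_eq_true, false_and, or_false]
  omega

omit [Group G] [TopologicalSpace G] [IsTopologicalGroup G] [CompactSpace G] [MeasurableSpace G] [BorelSpace G] in
/-- Time-like links of the slices `1, …, n + 1` are positive links of `θ₁`. [folklore] -/
theorem timeLinks_subset_link (a : ZMod (2 * n + 2)) (ha1 : 1 ≤ a.val) (ha : a.val ≤ n + 1) :
    {e : Site (d' + 1) L₀ (2 * n + 2) × Dir (d' + 1) | e.2 = none ∧ e.1.2 i = a} ⊆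
      ((posLinks (L₀ := L₀) (n := n) i : Finset (Site (d' + 1) L₀ (2 * n + 2) × Dir (d' + 1))) :
        Set (Site (d' + 1) L₀ (2 * n + 2) × Dir (d' + 1))) := by
  rintro ⟨x, ν⟩ ⟨hν, hx⟩
  simp only at hν hx
  subst hν
  exact mem_posLinks_of_ne i (by simp) ⟨by rw [slice, hx]; exact ha1, by rw [slice, hx]; exact ha⟩

variable [SecondCountableTopology G]

/-- **The site-reflection form of the chain is positive**: for slices `a, b ∈ {0, …, n + 1}` and
`z ∈ ℂ`, `0 ≤ g(−2a) + z̄ g(−a−b) + z g(−a−b) + |z|² g(−2b)` (reflection positivity in the lattice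
hyperplanes `{yᵢ = 0} ∪ {yᵢ = n + 1}`). [cite: BorgsSeiler1983, §II.2 (pp. 331–332)] -/
theorem siteForm_nonneg (hρu : ∀ g, ρ g ∈ Matrix.unitaryGroup (Fin N) ℂ) (hρ : Continuous ρ)
    (a b : ZMod (2 * n + 2)) (ha : a.val ≤ n + 1) (hb : b.val ≤ n + 1) (z : ℂ) :
    0 ≤ chain (L₀ := L₀) i ρ JE JM c (0 - a - a) + conj z * chain (L₀ := L₀) i ρ JE JM c (0 - b - a) +
        z * chain (L₀ := L₀) i ρ JE JM c (0 - a - b) +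
        z * conj z * chain (L₀ := L₀) i ρ JE JM c (0 - b - b) := by
  rw [← integral_twoTerm_spaceReflect i ρ JE JM c hρ 0 a b z]
  set F : Config (d' + 1) L₀ (2 * n + 2) G → ℂ := fun U => sliceObs i ρ c a U + z * sliceObs i ρ c b U with hF
  have hFc : Continuous F := (continuous_sliceObs i ρ c hρ a).add (continuous_const.mul (continuous_sliceObs i ρ c hρ b))
  obtain ⟨K, hK⟩ := exists_forall_norm_le_of_continuous hFc
  exact siteRP_core i ρ JE JM hρu hρ hFc.measurable hK
    (dependsOn_twoTerm i ρ c a b z (timeLinks_subset_site i a ha) (timeLinks_subset_site i b hb))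

/-- Change of variables by the gauge decoupling. [folklore] -/
theorem integral_comp_decouple {E : Type*} [NormedAddCommGroup E] [NormedSpace ℝ E]
    {f : Config (d' + 1) L₀ (2 * n + 2) G → E} (hf : Continuous f) :
    ∫ U, f (decouple i U) ∂haar (d' + 1) L₀ (2 * n + 2) G = ∫ U, f U ∂haar (d' + 1) L₀ (2 * n + 2) G := by
  have hmp := measurePreserving_decouple (L₀ := L₀) (G := G) (n := n) i
  rw [← integral_map hmp.measurable.aemeasurable, hmp.map_eq]
  rw [hmp.map_eq]
  exact hf.aestronglyMeasurable

/-- **The link-reflection form of the chain is positive**: for slices `a, b ∈ {1, …, n + 1}`,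
`J_E, J_M ≥ 0`, `1 ≤ n` and `z ∈ ℂ`, `0 ≤ g(1−2a) + z̄ g(1−a−b) + z g(1−a−b) + |z|² g(1−2b)`
(reflection positivity in the hyperplanes half-way between lattice planes, after the gauge
decoupling of the crossing links). [cite: BorgsSeiler1983, §II.2 (pp. 331–332)] -/
theorem linkForm_nonneg (hρu : ∀ g, ρ g ∈ Matrix.unitaryGroup (Fin N) ℂ) (hρ : Continuous ρ) (hn : 1 ≤ n)
    (hJE : 0 ≤ JE) (hJM : 0 ≤ JM)
    (a b : ZMod (2 * n + 2)) (ha1 : 1 ≤ a.val) (ha : a.val ≤ n + 1) (hb1 : 1 ≤ b.val) (hb : b.val ≤ n + 1) (z : ℂ) :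
    0 ≤ chain (L₀ := L₀) i ρ JE JM c (1 - a - a) + conj z * chain (L₀ := L₀) i ρ JE JM c (1 - b - a) +
        z * chain (L₀ := L₀) i ρ JE JM c (1 - a - b) +
        z * conj z * chain (L₀ := L₀) i ρ JE JM c (1 - b - b) := by
  rw [← integral_twoTerm_spaceReflect i ρ JE JM c hρ 1 a b z]
  set F : Config (d' + 1) L₀ (2 * n + 2) G → ℂ := fun U => sliceObs i ρ c a U + z * sliceObs i ρ c b U with hF
  have hFc : Continuous F := (continuous_sliceObs i ρ c hρ a).add (continuous_const.mul (continuous_sliceObs i ρ c hρ b))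
  obtain ⟨K, hK⟩ := exists_forall_norm_le_of_continuous hFc
  have hFdep : DependsOn F ((posLinks (L₀ := L₀) (n := n) i : Finset (Site (d' + 1) L₀ (2 * n + 2) × Dir (d' + 1))) :
      Set (Site (d' + 1) L₀ (2 * n + 2) × Dir (d' + 1))) :=
    dependsOn_twoTerm i ρ c a b z (timeLinks_subset_link i a ha1 ha) (timeLinks_subset_link i b hb1 hb)
  -- the decoupled integral is the `linkRP_core` integral
  have hpos := linkRP_core i ρ JE JM hρu hρ hn (Jw JE JM) (crossE i ∪ crossM i ∪ crossH i)
    (cross_subset_posLinks i hn) (fun e _ => Jw_nonneg JE JM hJE hJM e) hFc.measurable hK hFdep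
  have hFθ : ∀ U, F (spaceReflect i 1 U) = sliceObs i ρ c a (spaceReflect i 1 U) + z * sliceObs i ρ c b (spaceReflect i 1 U) :=
    fun U => rfl
  have hcont : Continuous fun U : Config (d' + 1) L₀ (2 * n + 2) G =>
      F U * conj (F (spaceReflect i 1 U)) * (weight ρ JE JM U : ℂ) :=
    (hFc.mul (Complex.continuous_conj.comp (hFc.comp (continuous_spaceReflect i 1)))).mul
      (Complex.continuous_ofReal.comp (continuous_weight ρ hρ JE JM))
  have key : ∀ U : Config (d' + 1) L₀ (2 * n + 2) G,
      F (decouple i U) * conj (F (spaceReflect i 1 (decouple i U))) * (weight ρ JE JM (decouple i U) : ℂ) =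
      F U * conj (F (spaceReflect i 1 U)) *
        ((Real.exp (bPlus i ρ JE JM U) * Real.exp (bPlus i ρ JE JM (spaceReflect i 1 U)) *
          Real.exp (linkCoupling i ρ (Jw JE JM) (crossE i ∪ crossM i ∪ crossH i) U) : ℝ) : ℂ) := by
    intro U
    have h1 : F (decouple i U) = F U := by simp only [hF, sliceObs_decouple]
    have h2 : F (spaceReflect i 1 (decouple i U)) = F (spaceReflect i 1 U) := by
      simp only [hF, sliceObs_spaceReflect, sliceObs_decouple]
    rw [h1, h2, weight, minusAction_decouple i ρ JE JM hρu hn, xCross_eq' i ρ JE JM hρu hn, Real.exp_add,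
      Real.exp_add]
  simp only [← hFθ]
  rw [← integral_comp_decouple i hcont]
  simp_rw [key]
  exact hpos

/-! ### Reality and convexity of the chain -/

omit [SecondCountableTopology G] in
/-- Casting `n + 1 − j` into `ℤ_{2n+2}`. [folklore] -/
theorem natCast_sub_eq (j : ℕ) (hj : j ≤ n + 1) :
    ((n + 1 - j : ℕ) : ZMod (2 * n + 2)) = (n + 1 : ZMod (2 * n + 2)) - (j : ZMod (2 * n + 2)) := by
  rw [Nat.cast_sub hj]; push_cast; ring

omit [SecondCountableTopology G] in
/-- `2(n + 1) = 0` in `ℤ_{2n+2}`. [folklore] -/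
theorem two_mul_natCast_add_one : (2 : ZMod (2 * n + 2)) * (n + 1) = 0 := by
  have h := ZMod.natCast_self (2 * n + 2)
  push_cast at h
  linear_combination h

/-- **The chain is real**: `Im g(m) = 0` for all `m` (from the `1 × 1` forms of both reflections:
even `m = −2a`, odd `m = 1 − 2a`). [cite: BorgsSeiler1983, §II.3 (II.22) (p. 337)] -/
theorem chain_im_eq_zero (hρu : ∀ g, ρ g ∈ Matrix.unitaryGroup (Fin N) ℂ) (hρ : Continuous ρ) (hn : 1 ≤ n)
    (hJE : 0 ≤ JE) (hJM : 0 ≤ JM) (m : ZMod (2 * n + 2)) :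
    (chain (L₀ := L₀) i ρ JE JM c m).im = 0 ∧ 0 ≤ (chain (L₀ := L₀) i ρ JE JM c m).re := by
  have hmlt := ZMod.val_lt m
  obtain ⟨j, hj | hj⟩ := Nat.even_or_odd' m.val
  · -- even: site form with `a = n + 1 − j`, `z = 0`
    have hjn : j ≤ n := by omega
    set a : ZMod (2 * n + 2) := ((n + 1 - j : ℕ) : ZMod (2 * n + 2)) with ha
    have hav : a.val ≤ n + 1 := by rw [ha, ZMod.val_cast_of_lt (by omega)]; omega
    have hm : (0 : ZMod (2 * n + 2)) - a - a = m := by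
      rw [← ZMod.natCast_zmod_val m, hj, ha, natCast_sub_eq j (by omega)]
      push_cast
      linear_combination (-1 : ZMod (2 * n + 2)) * two_mul_natCast_add_one
    have h := siteForm_nonneg (L₀ := L₀) i ρ JE JM c hρu hρ a a hav hav 0
    simp only [map_zero, zero_mul, add_zero, hm] at h
    exact ⟨(Complex.nonneg_iff.1 h).2.symm, (Complex.nonneg_iff.1 h).1⟩
  · -- odd: link form with `a = n + 1 − j`, `z = 0`
    have hjn : j ≤ n := by omega
    set a : ZMod (2 * n + 2) := ((n + 1 - j : ℕ) : ZMod (2 * n + 2)) with ha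
    have hav : a.val = n + 1 - j := by rw [ha, ZMod.val_cast_of_lt (by omega)]
    have hm : (1 : ZMod (2 * n + 2)) - a - a = m := by
      rw [← ZMod.natCast_zmod_val m, hj, ha, natCast_sub_eq j (by omega)]
      push_cast
      linear_combination (-1 : ZMod (2 * n + 2)) * two_mul_natCast_add_one
    have h := linkForm_nonneg (L₀ := L₀) i ρ JE JM c hρu hρ hn hJE hJM a a (by omega) (by omega) (by omega) (by omega) 0
    simp only [map_zero, zero_mul, add_zero, hm] at h
    exact ⟨(Complex.nonneg_iff.1 h).2.symm, (Complex.nonneg_iff.1 h).1⟩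

/-- **The chain is convex away from the origin**: `g(m+1) − 2g(m) + g(m−1) ≥ 0` for `m ≠ 0`
(odd centres from the site forms, even non-zero centres from the link forms, both with
`F = A_a − A_{a+1}`). [cite: BorgsSeiler1983, §III.2 Lemma III.8 (p. 349)] -/
theorem chain_laplacian_nonneg (hρu : ∀ g, ρ g ∈ Matrix.unitaryGroup (Fin N) ℂ) (hρ : Continuous ρ) (hn : 1 ≤ n)
    (hJE : 0 ≤ JE) (hJM : 0 ≤ JM) (m : ZMod (2 * n + 2)) (hm0 : m ≠ 0) :
    0 ≤ cycleLaplacian (fun m => (chain (L₀ := L₀) i ρ JE JM c m).re) m := by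
  have hmlt := ZMod.val_lt m
  haveI : Fact (1 < 2 * n + 2) := ⟨by omega⟩
  unfold cycleLaplacian
  obtain ⟨j, hj | hj⟩ := Nat.even_or_odd' m.val
  · -- even non-zero centre `m = 2j`, `1 ≤ j ≤ n`: link form with `a = n + 1 − j`, `b = a + 1`, `z = −1`
    have hj0 : j ≠ 0 := by
      rintro rfl
      exact hm0 ((ZMod.val_eq_zero m).1 (by omega))
    have hjn : j ≤ n := by omega
    set a : ZMod (2 * n + 2) := ((n + 1 - j : ℕ) : ZMod (2 * n + 2)) with ha
    have hav : a.val = n + 1 - j := by rw [ha, ZMod.val_cast_of_lt (by omega)]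
    have hbv : (a + 1).val = n + 2 - j := by
      rw [ZMod.val_add_of_lt (by rw [hav, ZMod.val_one]; omega), hav, ZMod.val_one]; omega
    have hm : (1 : ZMod (2 * n + 2)) - (a + 1) - a = m := by
      rw [← ZMod.natCast_zmod_val m, hj, ha, natCast_sub_eq j (by omega)]
      push_cast
      linear_combination (-1 : ZMod (2 * n + 2)) * two_mul_natCast_add_one
    have hm1 : (1 : ZMod (2 * n + 2)) - a - a = m + 1 := by rw [← hm]; ring
    have hm2 : (1 : ZMod (2 * n + 2)) - a - (a + 1) = m := by rw [← hm]; ring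
    have hm3 : (1 : ZMod (2 * n + 2)) - (a + 1) - (a + 1) = m - 1 := by rw [← hm]; ring
    have h := linkForm_nonneg (L₀ := L₀) i ρ JE JM c hρu hρ hn hJE hJM a (a + 1) (by omega) (by omega) (by omega) (by omega) (-1)
    rw [hm, hm1, hm2, hm3] at h
    have h' := (Complex.nonneg_iff.1 h).1
    simp only [map_neg, map_one, neg_mul, one_mul, mul_neg, mul_one, neg_neg, Complex.add_re, Complex.neg_re] at h'
    linarith
  · -- odd centre `m = 2j + 1`, `0 ≤ j ≤ n`: site form with `a = n − j`, `b = a + 1`, `z = −1`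
    have hjn : j ≤ n := by omega
    set a : ZMod (2 * n + 2) := ((n - j : ℕ) : ZMod (2 * n + 2)) with ha
    have hav : a.val = n - j := by rw [ha, ZMod.val_cast_of_lt (by omega)]
    have hbv : (a + 1).val = n + 1 - j := by
      rw [ZMod.val_add_of_lt (by rw [hav, ZMod.val_one]; omega), hav, ZMod.val_one]; omega
    have hm : (0 : ZMod (2 * n + 2)) - (a + 1) - a = m := by
      rw [← ZMod.natCast_zmod_val m, hj, ha, Nat.cast_sub hjn]
      push_cast
      linear_combination (-1 : ZMod (2 * n + 2)) * two_mul_natCast_add_one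
    have hm1 : (0 : ZMod (2 * n + 2)) - a - a = m + 1 := by rw [← hm]; ring
    have hm2 : (0 : ZMod (2 * n + 2)) - a - (a + 1) = m := by rw [← hm]; ring
    have hm3 : (0 : ZMod (2 * n + 2)) - (a + 1) - (a + 1) = m - 1 := by rw [← hm]; ring
    have h := siteForm_nonneg (L₀ := L₀) i ρ JE JM c hρu hρ a (a + 1) (by omega) (by omega) (-1)
    rw [hm, hm1, hm2, hm3] at h
    have h' := (Complex.nonneg_iff.1 h).1
    simp only [map_neg, map_one, neg_mul, one_mul, mul_neg, mul_one, neg_neg, Complex.add_re, Complex.neg_re] at h'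
    linarith

end Forms

end SliceRP

end FiniteTemperature

end Literature.Barriers.QuantumFields

/-! ## Assembly, part IV: the slice data as real coordinates; electric energy as a heat kernel -/

namespace Literature.Barriers.QuantumFields

namespace FiniteTemperature

namespace SliceRP

open Literature.Probability.LatticeModels
open Literature.MathematicalPhysics.QuantumFieldTheory
open scoped NNReal

variable {d' L₀ : ℕ} {G : Type*} [Group G] {N : ℕ} {n : ℕ}
variable [TopologicalSpace G] [IsTopologicalGroup G] [CompactSpace G] [MeasurableSpace G] [BorelSpace G]
variable (i : Fin (d' + 1)) (ρ : G →* Matrix (Fin N) (Fin N) ℂ)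

section SliceData

variable {L : ℕ} [NeZero L]

/-- The time coordinate of the layer `m ∈ {0, …, L₀ − 1}`. [folklore] -/
def tOf (m : Fin L₀) : ZMod L₀ := ((m : ℕ) : ZMod L₀)

omit [NeZero L] in
/-- `tOf` is a bijection `Fin L₀ ≃ ℤ_{L₀}`. [folklore] -/
theorem tOf_bijective [NeZero L₀] : Function.Bijective (tOf (L₀ := L₀)) := by
  rw [Fintype.bijective_iff_injective_and_card, ZMod.card, Fintype.card_fin]
  refine ⟨fun m m' h => ?_, rfl⟩
  have h' := congrArg ZMod.val h
  simp only [tOf, ZMod.val_natCast, Nat.mod_eq_of_lt m.2, Nat.mod_eq_of_lt m'.2] at h'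
  exact Fin.ext h'

/-- The matrices of the time-like links of the slice `s`: `M_s(U)(y, m) = ρ(U((m, ins_i(s, y)), 0))`.
[folklore] -/
def sliceMat (s : ZMod L) (U : Config (d' + 1) L₀ L G) (y : Fin d' → ZMod L) (m : Fin L₀) :
    Matrix (Fin N) (Fin N) ℂ :=
  ρ (U ((tOf m, Torus.ins i s y), none))

/-- The real coordinates of the slice data (Borgs–Seiler's "we imbed `G` in the real vector space
`𝒱 = 𝒱_χ^ℝ ≃ ℝ^{2χ(1)²}`", p. 344). [cite: BorgsSeiler1983, §III.1 (p. 344)] -/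
def wv (s : ZMod L) (U : Config (d' + 1) L₀ L G) : PIdx (Fin d' → ZMod L) L₀ N → ℝ :=
  realify (sliceMat i ρ s U)

omit [TopologicalSpace G] [IsTopologicalGroup G] [CompactSpace G] [MeasurableSpace G] [BorelSpace G] [NeZero L] in
/-- The layer matrices of the slice data. [folklore] -/
@[simp] theorem matOf_wv (s : ZMod L) (U : Config (d' + 1) L₀ L G) (y : Fin d' → ZMod L) (m : Fin L₀) :
    matOf (wv i ρ s U) y m = ρ (U ((tOf m, Torus.ins i s y), none)) := by
  simp [wv, sliceMat]

omit [TopologicalSpace G] [IsTopologicalGroup G] [CompactSpace G] [MeasurableSpace G] [BorelSpace G] [NeZero L] in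
/-- The layer matrices are unitary for a unitary `ρ`. [folklore] -/
theorem matOf_wv_mem (hρu : ∀ g, ρ g ∈ Matrix.unitaryGroup (Fin N) ℂ) (s : ZMod L) (U : Config (d' + 1) L₀ L G)
    (y : Fin d' → ZMod L) (m : Fin L₀) : matOf (wv i ρ s U) y m ∈ Matrix.unitaryGroup (Fin N) ℂ := by
  rw [matOf_wv]; exact hρu _

omit [TopologicalSpace G] [IsTopologicalGroup G] [CompactSpace G] [MeasurableSpace G] [BorelSpace G] [NeZero L] in
/-- **The Polyakov loop as an ordered product of layer matrices**:
`ρ(timeHolonomy U k (0, ins_i(s,y))) = Q_k(wv_s(U))(y)` for `k ≤ L₀`. [folklore] -/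
theorem rep_timeHolonomy_eq_layerProd (s : ZMod L) (U : Config (d' + 1) L₀ L G) (y : Fin d' → ZMod L) :
    ∀ k, k ≤ L₀ → ρ (timeHolonomy U k ((0 : ZMod L₀), Torus.ins i s y)) = layerProd (wv i ρ s U) y k := by
  intro k
  induction k with
  | zero => intro _; simp [timeHolonomy]
  | succ k ih =>
      intro hk
      rw [timeHolonomy_succ_right, map_mul, ih (Nat.le_of_succ_le hk), layerProd_succ _ _ (Nat.lt_of_succ_le hk),
        matOf_wv, zero_add]
      rfl

omit [TopologicalSpace G] [IsTopologicalGroup G] [CompactSpace G] [MeasurableSpace G] [BorelSpace G] [NeZero L] in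
/-- **Traced Polyakov loops of the slice `s` are the Polyakov-type traces of the slice data.**
[folklore] -/
theorem polyakovTrace_eq_polyTrace (s : ZMod L) (U : Config (d' + 1) L₀ L G) (y : Fin d' → ZMod L) :
    polyakovTrace ρ U (Torus.ins i s y) = polyTrace (wv i ρ s U) y := by
  unfold polyakovTrace polyakovLine polyTrace
  rw [rep_timeHolonomy_eq_layerProd i ρ s U y L₀ le_rfl]

omit [TopologicalSpace G] [IsTopologicalGroup G] [CompactSpace G] [MeasurableSpace G] [BorelSpace G] in
/-- **The slice observable is the smeared Polyakov trace of the slice data**: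
`A_s(U) = F_c(wv_s(U))`. [folklore] -/
theorem sliceObs_eq_smearedPoly (c : (Fin d' → ZMod L) → ℂ) (s : ZMod L) (U : Config (d' + 1) L₀ L G) :
    sliceObs i ρ c s U = smearedPoly c (wv i ρ s U) := by
  unfold sliceObs smearedPoly
  simp_rw [polyakovTrace_eq_polyTrace]

omit [IsTopologicalGroup G] [CompactSpace G] [MeasurableSpace G] [BorelSpace G] [NeZero L] in
/-- The slice data depend continuously on the configuration. [folklore] -/
theorem continuous_wv (hρ : Continuous ρ) (s : ZMod L) : Continuous fun U : Config (d' + 1) L₀ L G => wv i ρ s U := by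
  refine continuous_pi fun idx => ?_
  have hc : Continuous fun U : Config (d' + 1) L₀ L G =>
      ρ (U ((tOf idx.2.1, Torus.ins i s idx.1), none)) idx.2.2.1 idx.2.2.2.1 :=
    ((continuous_apply _).comp ((continuous_apply _).comp (hρ.comp (continuous_apply _))))
  unfold wv realify sliceMat
  split_ifs
  · exact Complex.continuous_re.comp hc
  · exact Complex.continuous_im.comp hc

omit [TopologicalSpace G] [IsTopologicalGroup G] [CompactSpace G] [MeasurableSpace G] [BorelSpace G] in
/-- The slice data of a unitary `ρ` lie in the unit cube: `‖wv_s(U)‖ ≤ 1`. [folklore] -/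
theorem norm_wv_le (hρu : ∀ g, ρ g ∈ Matrix.unitaryGroup (Fin N) ℂ) (s : ZMod L) (U : Config (d' + 1) L₀ L G) :
    ‖wv i ρ s U‖ ≤ 1 := by
  refine (pi_norm_le_iff_of_nonneg zero_le_one).2 fun idx => ?_
  have h := entry_norm_bound_of_unitary (hρu (U ((tOf idx.2.1, Torus.ins i s idx.1), none))) idx.2.2.1 idx.2.2.2.1
  unfold wv realify sliceMat
  split_ifs
  · exact (Complex.abs_re_le_norm _).trans h
  · exact (Complex.abs_im_le_norm _).trans h

omit [TopologicalSpace G] [IsTopologicalGroup G] [CompactSpace G] [MeasurableSpace G] [BorelSpace G] [NeZero L] in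
/-- **The link reflection swaps the slice data of the slices `0` and `1`**: `wv₁(θ₁U) = wv₀(U)`.
[folklore] -/
theorem wv_one_spaceReflect (U : Config (d' + 1) L₀ L G) : wv i ρ 1 (spaceReflect i 1 U) = wv i ρ 0 U := by
  unfold wv sliceMat
  congr 1
  funext y m
  rw [spaceReflect_apply_of_ne i 1 U _ (by simp), hatSite, sigma_ins, sub_self]

omit [TopologicalSpace G] [IsTopologicalGroup G] [CompactSpace G] [MeasurableSpace G] [BorelSpace G] [NeZero L] in
/-- The slice data of the slice `s` depend only on the time-like links of that slice. [folklore] -/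
theorem dependsOn_wv (s : ZMod L) :
    DependsOn (fun U : Config (d' + 1) L₀ L G => wv i ρ s U)
      {e : Site (d' + 1) L₀ L × Dir (d' + 1) | e.2 = none ∧ e.1.2 i = s} := by
  intro U V hUV
  unfold wv sliceMat
  exact congrArg realify (funext fun y => funext fun m => by rw [hUV _ ⟨rfl, Torus.ins_apply_same i s y⟩])

end SliceData

/-! ### The electric crossing energy as a heat kernel -/

section Electric

variable [NeZero L₀] (JE : ℝ)

omit [Group G] [TopologicalSpace G] [IsTopologicalGroup G] [CompactSpace G] [MeasurableSpace G] [BorelSpace G] in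
/-- Sums over the slice `0` as sums over time and transverse coordinates. [folklore] -/
theorem sum_slice_zero_eq (h : Site (d' + 1) L₀ (2 * n + 2) → ℝ) :
    ∑ x ∈ Finset.univ.filter (fun x : Site (d' + 1) L₀ (2 * n + 2) => slice i x = 0), h x =
      ∑ m : Fin L₀, ∑ y : Fin d' → ZMod (2 * n + 2), h (tOf m, Torus.ins i 0 y) := by
  rw [Finset.sum_filter, Fintype.sum_prod_type]
  rw [← (tOf_bijective (L₀ := L₀)).sum_comp (g := fun t => ∑ y' : Fin (d' + 1) → ZMod (2 * n + 2),
    if slice i (t, y') = 0 then h (t, y') else 0)]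
  refine Finset.sum_congr rfl fun m _ => ?_
  rw [sum_torus_eq_sum_sum i]
  simp only [slice, Torus.ins_apply_same]
  rw [Finset.sum_comm]
  refine Finset.sum_congr rfl fun y _ => ?_
  rw [Finset.sum_ite_eq' Finset.univ (0 : ZMod (2 * n + 2)) (fun s => h (tOf m, Torus.ins i s y)), if_pos (Finset.mem_univ _)]

omit [TopologicalSpace G] [IsTopologicalGroup G] [CompactSpace G] [MeasurableSpace G] [BorelSpace G] in
/-- **The electric crossing energy is a heat kernel in the slice data** (unitary `ρ`): with
`c₀ = J_E N L₀ L^{d'}`, `E₀(U) = c₀ − (J_E/2) Σ (wv₀(U) − wv₁(U))²`, i.e.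
`e^{E₀(U)} = e^{c₀} T_{J_E}(wv₀(U), wv₁(U))` (the Gaussian kernel (III.34)–(III.35)).
[cite: BorgsSeiler1983, §III.2 (III.34)–(III.35) (p. 349)] -/
theorem elec0_eq (hρu : ∀ g, ρ g ∈ Matrix.unitaryGroup (Fin N) ℂ) (U : Config (d' + 1) L₀ (2 * n + 2) G) :
    elec0 i ρ JE U = JE * (∑ _y : Fin d' → ZMod (2 * n + 2), ∑ _m : Fin L₀, (N : ℝ)) -
      JE / 2 * ∑ idx, (wv i ρ 0 U idx - wv i ρ 1 U idx) ^ 2 := by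
  unfold elec0
  rw [sum_slice_zero_eq i, Finset.sum_comm, wv, wv, sum_sq_realify_sub]
  have hterm : ∀ (y : Fin d' → ZMod (2 * n + 2)) (m : Fin L₀),
      ∑ a, ∑ b, Complex.normSq (sliceMat i ρ 0 U y m a b - sliceMat i ρ 1 U y m a b) =
        2 * N - 2 * eTerm i ρ U (tOf m, Torus.ins i 0 y) none := by
    intro y m
    unfold sliceMat
    rw [sum_normSq_sub_of_unitary (hρu _) (hρu _), eTerm]
    simp only [Site.shift, Torus.ins_add_single_self, zero_add]
  simp_rw [hterm]
  have hsplit : ∑ y : Fin d' → ZMod (2 * n + 2), ∑ m : Fin L₀, (2 * (N : ℝ) - 2 * eTerm i ρ U (tOf m, Torus.ins i 0 y) none) =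
      2 * (∑ _y : Fin d' → ZMod (2 * n + 2), ∑ _m : Fin L₀, (N : ℝ)) -
        2 * ∑ y : Fin d' → ZMod (2 * n + 2), ∑ m : Fin L₀, eTerm i ρ U (tOf m, Torus.ins i 0 y) none := by
    simp only [Finset.sum_sub_distrib, Finset.mul_sum]
  rw [hsplit]
  ring

omit [TopologicalSpace G] [IsTopologicalGroup G] [CompactSpace G] [MeasurableSpace G] [BorelSpace G] in
/-- The heat-kernel form: `e^{E₀(U)} = e^{c₀} · T_J(wv₀(U), wv₁(U))` for `J_E = J ≥ 0`. [cite: BorgsSeiler1983, §III.2 (III.34)–(III.35) (p. 349)] -/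
theorem exp_elec0_eq (hρu : ∀ g, ρ g ∈ Matrix.unitaryGroup (Fin N) ℂ) (J : ℝ≥0) (U : Config (d' + 1) L₀ (2 * n + 2) G) :
    Real.exp (elec0 i ρ (J : ℝ) U) =
      Real.exp ((J : ℝ) * ∑ _y : Fin d' → ZMod (2 * n + 2), ∑ _m : Fin L₀, (N : ℝ)) *
        heatKernel J (wv i ρ 0 U) (wv i ρ 1 U) := by
  rw [elec0_eq i ρ (J : ℝ) hρu, heatKernel, ← Real.exp_add]
  congr 1
  ring

end Electric

end SliceRP

end FiniteTemperature

end Literature.Barriers.QuantumFields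

/-! ## Assembly, part V: the Gram term is positive (Fubini + link reflection positivity) -/



namespace Literature.Barriers.QuantumFields

namespace FiniteTemperature

namespace SliceRP

open Literature.Probability.LatticeModels
open Literature.MathematicalPhysics.QuantumFieldTheory
open scoped NNReal

variable {d' L₀ : ℕ} {G : Type*} [Group G] {N : ℕ} {n : ℕ}
variable [TopologicalSpace G] [IsTopologicalGroup G] [CompactSpace G] [MeasurableSpace G] [BorelSpace G]
variable (i : Fin (d' + 1)) (ρ : G →* Matrix (Fin N) (Fin N) ℂ)

section Gram

variable [NeZero L₀] [SecondCountableTopology G] (J : ℝ≥0) (JM : ℝ) (c : (Fin d' → ZMod (2 * n + 2)) → ℂ)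

/-- The REDUCED exponent of the decoupled weight: `B'(U) = B₊(U) + B₊(θ₁U) + X_{crossM ∪ crossH}(U)`
(everything except the electric crossing energy of the plane between the slices `0` and `1`).
[folklore] -/
def bRest (U : Config (d' + 1) L₀ (2 * n + 2) G) : ℝ :=
  bPlus i ρ (J : ℝ) JM U + bPlus i ρ (J : ℝ) JM (spaceReflect i 1 U) +
    linkCoupling i ρ (Jw (J : ℝ) JM) (crossM i ∪ crossH i) U

omit [NeZero L₀] [CompactSpace G] [MeasurableSpace G] [BorelSpace G] [SecondCountableTopology G] in
/-- Link couplings are continuous. [folklore] -/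
theorem continuous_linkCoupling (hρ : Continuous ρ) (Jl : Site (d' + 1) L₀ (2 * n + 2) × Dir (d' + 1) → ℝ)
    (S : Finset (Site (d' + 1) L₀ (2 * n + 2) × Dir (d' + 1))) :
    Continuous (linkCoupling (G := G) i ρ Jl S) := by
  unfold linkCoupling
  refine continuous_finsetSum _ fun ℓ _ => continuous_const.mul ?_
  exact Complex.continuous_re.comp (Continuous.matrix_trace
    ((hρ.comp ((continuous_apply ℓ).comp (continuous_spaceReflect i 1))).mul
      (hρ.comp (continuous_apply ℓ)).matrix_conjTranspose))

omit [CompactSpace G] [MeasurableSpace G] [BorelSpace G] [SecondCountableTopology G] in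
/-- `B'` is continuous. [folklore] -/
theorem continuous_bRest (hρ : Continuous ρ) : Continuous (bRest (L₀ := L₀) (n := n) i ρ J JM) := by
  unfold bRest
  exact ((continuous_bPlus i ρ _ JM hρ).add ((continuous_bPlus i ρ _ JM hρ).comp (continuous_spaceReflect i 1))).add
    (continuous_linkCoupling i ρ hρ _ _)

/-- The joint integrand `W(η, U) = e^{B'(U)} conj Ψ_η(wv₀(U)) Ψ_η(wv₁(U))`. [folklore] -/
def gramIntegrand (η : PIdx (Fin d' → ZMod (2 * n + 2)) L₀ N → ℝ) (U : Config (d' + 1) L₀ (2 * n + 2) G) : ℂ :=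
  (Real.exp (bRest i ρ J JM U) : ℂ) *
    (conj (dcFeature J (smearedPoly c) η (wv i ρ 0 U)) * dcFeature J (smearedPoly c) η (wv i ρ 1 U))

omit [CompactSpace G] [MeasurableSpace G] [BorelSpace G] [SecondCountableTopology G] in
/-- The joint integrand is continuous. [folklore] -/
theorem continuous_gramIntegrand (hρ : Continuous ρ) :
    Continuous (Function.uncurry (gramIntegrand (L₀ := L₀) (n := n) i ρ J JM c)) := by
  have hF := continuous_smearedPoly (L₀ := L₀) (N := N) c
  have hdc := continuous_dcFeature J hF
  have h1 : Continuous fun p : (PIdx (Fin d' → ZMod (2 * n + 2)) L₀ N → ℝ) × Config (d' + 1) L₀ (2 * n + 2) G =>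
      (Real.exp (bRest i ρ J JM p.2) : ℂ) :=
    Complex.continuous_ofReal.comp (Real.continuous_exp.comp ((continuous_bRest i ρ J JM hρ).comp continuous_snd))
  have h2 : ∀ s : ZMod (2 * n + 2), Continuous fun p : (PIdx (Fin d' → ZMod (2 * n + 2)) L₀ N → ℝ) × Config (d' + 1) L₀ (2 * n + 2) G =>
      dcFeature J (smearedPoly c) p.1 (wv i ρ s p.2) := fun s =>
    hdc.comp₂ continuous_fst ((continuous_wv i ρ hρ s).comp continuous_snd)
  have h : Function.uncurry (gramIntegrand (L₀ := L₀) (n := n) i ρ J JM c) =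
      fun p => (Real.exp (bRest i ρ J JM p.2) : ℂ) *
        (conj (dcFeature J (smearedPoly c) p.1 (wv i ρ 0 p.2)) * dcFeature J (smearedPoly c) p.1 (wv i ρ 1 p.2)) := by
    funext p; rfl
  rw [h]
  exact h1.mul ((Complex.continuous_conj.comp (h2 0)).mul (h2 1))

/-- **The joint integrand is integrable** on `γ × ∏dg` (exponential Gaussian moments dominate it
uniformly in the compact configuration). [folklore] -/
theorem integrable_gramIntegrand (hρu : ∀ g, ρ g ∈ Matrix.unitaryGroup (Fin N) ℂ) (hρ : Continuous ρ) :
    Integrable (Function.uncurry (gramIntegrand (L₀ := L₀) (n := n) i ρ J JM c))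
      ((gaussianPi (PIdx (Fin d' → ZMod (2 * n + 2)) L₀ N) J).prod (haar (d' + 1) L₀ (2 * n + 2) G)) := by
  obtain ⟨KB, hKB⟩ := exists_forall_norm_le_of_continuous (continuous_bRest (L₀ := L₀) (n := n) i ρ J JM hρ)
  set C : ℝ := (∑ x, ‖c x‖) * (N * (2 * N) ^ L₀) with hCdef
  have hC : 0 ≤ C := by positivity
  have hFb : ∀ v : PIdx (Fin d' → ZMod (2 * n + 2)) L₀ N → ℝ, ‖smearedPoly c v‖ ≤ C * (1 + ‖v‖) ^ L₀ :=
    norm_smearedPoly_le c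
  set C₁ : ℝ := 2 * C * (2 + (J : ℝ)⁻¹) ^ L₀ with hC₁
  set κ : ℝ := 2 * ((L₀ : ℝ) + 1) with hκ
  -- domination
  have hdom : ∀ (η : PIdx (Fin d' → ZMod (2 * n + 2)) L₀ N → ℝ) (U : Config (d' + 1) L₀ (2 * n + 2) G),
      ‖gramIntegrand i ρ J JM c η U‖ ≤ Real.exp KB * C₁ ^ 2 * Real.exp (κ * ∑ idx, |η idx|) := by
    intro η U
    have h0 := norm_dcFeature_le J hC hFb η (wv i ρ 0 U) (norm_wv_le i ρ hρu 0 U)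
    have h1 := norm_dcFeature_le J hC hFb η (wv i ρ 1 U) (norm_wv_le i ρ hρu 1 U)
    have hB : ‖(Real.exp (bRest i ρ J JM U) : ℂ)‖ ≤ Real.exp KB := by
      rw [Complex.norm_real, Real.norm_of_nonneg (Real.exp_pos _).le]
      exact Real.exp_le_exp.2 ((Real.le_norm_self _).trans (hKB U))
    have hC₁0 : 0 ≤ C₁ := by
      have : 0 ≤ (J : ℝ)⁻¹ := inv_nonneg.2 J.coe_nonneg
      positivity
    unfold gramIntegrand
    rw [norm_mul, norm_mul, Complex.norm_conj]
    calc ‖(Real.exp (bRest i ρ J JM U) : ℂ)‖ *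
          (‖dcFeature J (smearedPoly c) η (wv i ρ 0 U)‖ * ‖dcFeature J (smearedPoly c) η (wv i ρ 1 U)‖)
        ≤ Real.exp KB * ((C₁ * Real.exp ((L₀ + 1) * ∑ idx, |η idx|)) * (C₁ * Real.exp ((L₀ + 1) * ∑ idx, |η idx|))) :=
          mul_le_mul hB (mul_le_mul h0 h1 (norm_nonneg _) (by positivity)) (by positivity) (by positivity)
      _ = Real.exp KB * C₁ ^ 2 * Real.exp (κ * ∑ idx, |η idx|) := by
          rw [hκ, show 2 * ((L₀ : ℝ) + 1) * ∑ idx, |η idx| = (L₀ + 1) * ∑ idx, |η idx| + (L₀ + 1) * ∑ idx, |η idx| by ring,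
            Real.exp_add]; ring
  have hint : Integrable (fun p : (PIdx (Fin d' → ZMod (2 * n + 2)) L₀ N → ℝ) × Config (d' + 1) L₀ (2 * n + 2) G =>
      Real.exp KB * C₁ ^ 2 * Real.exp (κ * ∑ idx, |p.1 idx|) * (1 : ℝ))
      ((gaussianPi (PIdx (Fin d' → ZMod (2 * n + 2)) L₀ N) J).prod (haar (d' + 1) L₀ (2 * n + 2) G)) :=
    Integrable.mul_prod (((integrable_exp_mul_sum_abs J κ).const_mul (Real.exp KB * C₁ ^ 2)))
      (integrable_const (1 : ℝ))
  refine hint.mono' (continuous_gramIntegrand i ρ J JM c hρ).aestronglyMeasurable (Eventually.of_forall fun p => ?_)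
  rw [mul_one]
  exact hdom p.1 p.2

/-- **The `U`-integral of the joint integrand is a link-reflection form, hence positive** (for every
`η`): `0 ≤ ∫ W(η, U) ∏dg` (`linkRP_core` with `F_η = Ψ_η ∘ wv₁`, using `wv₁(θ₁U) = wv₀(U)`).
[cite: BorgsSeiler1983, §III.2 (III.41) (p. 350)] -/
theorem integral_gramIntegrand_nonneg (hρu : ∀ g, ρ g ∈ Matrix.unitaryGroup (Fin N) ℂ) (hρ : Continuous ρ) (hn : 1 ≤ n)
    (hJM : 0 ≤ JM) (η : PIdx (Fin d' → ZMod (2 * n + 2)) L₀ N → ℝ) :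
    0 ≤ ∫ U, gramIntegrand i ρ J JM c η U ∂haar (d' + 1) L₀ (2 * n + 2) G := by
  obtain ⟨Fη, hFη⟩ : ∃ Fη : Config (d' + 1) L₀ (2 * n + 2) G → ℂ,
      ∀ U, Fη U = dcFeature J (smearedPoly c) η (wv i ρ 1 U) := ⟨_, fun U => rfl⟩
  have hFc : Continuous Fη := by
    have h : Fη = fun U => (fun p : (PIdx (Fin d' → ZMod (2 * n + 2)) L₀ N → ℝ) × (PIdx (Fin d' → ZMod (2 * n + 2)) L₀ N → ℝ) =>
        dcFeature J (smearedPoly c) p.1 p.2) ((fun _ => η) U, wv i ρ 1 U) := funext fun U => hFη U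
    rw [h]
    exact (continuous_dcFeature J (continuous_smearedPoly c)).comp₂ continuous_const (continuous_wv i ρ hρ 1)
  obtain ⟨K, hK⟩ := exists_forall_norm_le_of_continuous hFc
  haveI : Fact (1 < 2 * n + 2) := ⟨by omega⟩
  have hFdep : DependsOn Fη ((posLinks (L₀ := L₀) (n := n) i : Finset (Site (d' + 1) L₀ (2 * n + 2) × Dir (d' + 1))) :
      Set (Site (d' + 1) L₀ (2 * n + 2) × Dir (d' + 1))) := by
    intro U V hUV
    have e : wv i ρ 1 U = wv i ρ 1 V := dependsOn_wv i ρ 1 fun e he =>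
      hUV e (timeLinks_subset_link i 1 (by rw [ZMod.val_one]) (by rw [ZMod.val_one]; omega) he)
    rw [hFη, hFη, e]
  have hpos := linkRP_core i ρ (J : ℝ) JM hρu hρ hn (Jw (J : ℝ) JM) (crossM i ∪ crossH i)
    (cross'_subset_posLinks i hn) (fun e _ => Jw_nonneg (J : ℝ) JM J.coe_nonneg hJM e) hFc.measurable hK hFdep
  have key : ∀ U : Config (d' + 1) L₀ (2 * n + 2) G, gramIntegrand i ρ J JM c η U =
      Fη U * conj (Fη (spaceReflect i 1 U)) *
        ((Real.exp (bPlus i ρ (J : ℝ) JM U) * Real.exp (bPlus i ρ (J : ℝ) JM (spaceReflect i 1 U)) *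
          Real.exp (linkCoupling i ρ (Jw (J : ℝ) JM) (crossM i ∪ crossH i) U) : ℝ) : ℂ) := by
    intro U
    rw [hFη, hFη, wv_one_spaceReflect, gramIntegrand, bRest, Real.exp_add, Real.exp_add]
    push_cast
    ring
  simp_rw [key]
  exact hpos

/-- **The Gram term is positive**: `Re ∫ e^{B'(U)} 𝒦(wv₀(U), wv₁(U)) ∏dg ≥ 0` for the Gram
kernel `𝒦 = dcKernel J F` (Fubini over `γ × ∏dg` and `integral_gramIntegrand_nonneg`), and the
integrand is integrable; the positivity (III.41) `(Ψ, 𝕋(B) T Ψ) ≥ 0` in Gram form.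
[cite: BorgsSeiler1983, §III.2 (III.36)–(III.41) (p. 350)] -/
theorem re_integral_exp_bRest_mul_dcKernel_nonneg (hρu : ∀ g, ρ g ∈ Matrix.unitaryGroup (Fin N) ℂ)
    (hρ : Continuous ρ) (hn : 1 ≤ n) (hJM : 0 ≤ JM) :
    Integrable (fun U => (Real.exp (bRest i ρ J JM U) : ℂ) *
        dcKernel J (smearedPoly c) (wv i ρ 0 U) (wv i ρ 1 U)) (haar (d' + 1) L₀ (2 * n + 2) G) ∧
      0 ≤ (∫ U, (Real.exp (bRest i ρ J JM U) : ℂ) * dcKernel J (smearedPoly c) (wv i ρ 0 U) (wv i ρ 1 U)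
        ∂haar (d' + 1) L₀ (2 * n + 2) G).re := by
  have hW := integrable_gramIntegrand (L₀ := L₀) (n := n) i ρ J JM c hρu hρ
  -- the `U`-integrand is the `η`-integral of `W`
  have hD : ∀ U : Config (d' + 1) L₀ (2 * n + 2) G,
      (Real.exp (bRest i ρ J JM U) : ℂ) * dcKernel J (smearedPoly c) (wv i ρ 0 U) (wv i ρ 1 U) =
        ∫ η, gramIntegrand i ρ J JM c η U ∂gaussianPi (PIdx (Fin d' → ZMod (2 * n + 2)) L₀ N) J := by
    intro U
    unfold dcKernel gramIntegrand
    rw [integral_const_mul]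
  simp_rw [hD]
  refine ⟨hW.swap.integral_prod_left, ?_⟩
  -- Fubini
  have hswap := integral_integral_swap hW
  rw [← hswap]
  -- positivity of the inner integrals
  have hinner : Integrable (fun η => ∫ U, gramIntegrand i ρ J JM c η U ∂haar (d' + 1) L₀ (2 * n + 2) G)
      (gaussianPi (PIdx (Fin d' → ZMod (2 * n + 2)) L₀ N) J) := hW.integral_prod_left
  have hre := integral_re hinner
  simp only [RCLike.re_to_complex] at hre
  rw [← hre]
  exact integral_nonneg fun η => (Complex.nonneg_iff.1 (integral_gramIntegrand_nonneg i ρ J JM c hρu hρ hn hJM η)).1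

end Gram

end SliceRP

end FiniteTemperature

end Literature.Barriers.QuantumFields

/-! ## Assembly, part VI: Step B — `⟨|A₀ − A₁|²⟩ ≤ ((1 + 2N/J_E)^{L₀} − 1) Σ|c|²` -/

namespace Literature.Barriers.QuantumFields

namespace FiniteTemperature

namespace SliceRP

open Literature.Probability.LatticeModels
open Literature.MathematicalPhysics.QuantumFieldTheory
open scoped NNReal

variable {d' L₀ : ℕ} {G : Type*} [Group G] {N : ℕ} {n : ℕ}
variable [TopologicalSpace G] [IsTopologicalGroup G] [CompactSpace G] [MeasurableSpace G] [BorelSpace G]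
variable (i : Fin (d' + 1)) (ρ : G →* Matrix (Fin N) (Fin N) ℂ)

section StepB

variable [NeZero L₀] [SecondCountableTopology G] (J : ℝ≥0) (JM : ℝ) (c : (Fin d' → ZMod (2 * n + 2)) → ℂ)

/-- The constant `c₀ = J N L₀ L^{d'}` of the electric crossing energy. [folklore] -/
def c0 (d' L₀ N n : ℕ) (J : ℝ≥0) : ℝ := (J : ℝ) * ∑ _y : Fin d' → ZMod (2 * n + 2), ∑ _m : Fin L₀, (N : ℝ)

/-- The decoupled weight in closed form: `w_T(U) = e^{B'(U)} e^{c₀} T_J(wv₀(U), wv₁(U))`. [folklore] -/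
def wT (U : Config (d' + 1) L₀ (2 * n + 2) G) : ℝ :=
  Real.exp (bRest i ρ J JM U) * (Real.exp (c0 d' L₀ N n J) * heatKernel J (wv i ρ 0 U) (wv i ρ 1 U))

omit [Group G] [TopologicalSpace G] [IsTopologicalGroup G] [CompactSpace G] [MeasurableSpace G] [BorelSpace G]
  [SecondCountableTopology G] in
/-- The magnetic crossing links of the slice `1` and the crossing links of the slice `n + 1` are
disjoint (`1 ≤ n`). [folklore] -/
theorem disjoint_crossM_crossH (hn : 1 ≤ n) : Disjoint (crossM (L₀ := L₀) (n := n) i) (crossH i) := by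
  have hne1 : (1 : ZMod (2 * n + 2)) ≠ ((n + 1 : ℕ) : ZMod (2 * n + 2)) := by
    intro h
    haveI : Fact (1 < 2 * n + 2) := ⟨by omega⟩
    have h1 := congrArg ZMod.val h
    rw [ZMod.val_one, ZMod.val_cast_of_lt (by omega)] at h1
    omega
  rw [Finset.disjoint_left]
  rintro ⟨x, ν⟩ h1 h2
  simp only [crossM, crossH, Finset.mem_product, Finset.mem_filter, Finset.mem_univ, true_and] at h1 h2
  exact hne1 (h1.1.symm.trans h2.1)

omit [TopologicalSpace G] [IsTopologicalGroup G] [CompactSpace G] [MeasurableSpace G] [BorelSpace G]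
  [SecondCountableTopology G] in
/-- **The weight of the decoupled configuration in closed form** (unitary `ρ`, `1 ≤ n`):
`e^{−S(T U)} = e^{B'(U)} e^{c₀} T_J(wv₀(U), wv₁(U))`. [cite: BorgsSeiler1983, §III.2 (III.33)–(III.35) (p. 349)] -/
theorem weight_decouple (hρu : ∀ g, ρ g ∈ Matrix.unitaryGroup (Fin N) ℂ) (hn : 1 ≤ n) (U : Config (d' + 1) L₀ (2 * n + 2) G) :
    weight ρ (J : ℝ) JM (decouple i U) = wT i ρ J JM U := by
  rw [weight, minusAction_decouple i ρ (J : ℝ) JM hρu hn, xCross_eq i ρ (J : ℝ) JM hρu hn, wT, bRest,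
    linkCoupling_union i ρ _ (disjoint_crossM_crossH i hn), c0, ← exp_elec0_eq i ρ hρu J U, ← Real.exp_add]
  congr 1
  ring

omit [CompactSpace G] [MeasurableSpace G] [BorelSpace G] [SecondCountableTopology G] in
/-- `w_T` is continuous. [folklore] -/
theorem continuous_wT (hρ : Continuous ρ) : Continuous (wT (L₀ := L₀) (n := n) i ρ J JM) := by
  unfold wT heatKernel
  have h0 := continuous_wv (L₀ := L₀) i ρ hρ (0 : ZMod (2 * n + 2))
  have h1 := continuous_wv (L₀ := L₀) i ρ hρ (1 : ZMod (2 * n + 2))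
  refine (Real.continuous_exp.comp (continuous_bRest i ρ J JM hρ)).mul (continuous_const.mul
    (Real.continuous_exp.comp (continuous_const.mul (continuous_finsetSum _ fun idx _ => ?_))))
  exact (((continuous_apply idx).comp h0).sub ((continuous_apply idx).comp h1)).pow 2

omit [TopologicalSpace G] [IsTopologicalGroup G] [CompactSpace G] [MeasurableSpace G] [BorelSpace G]
  [SecondCountableTopology G] in
/-- `w_T > 0`. [folklore] -/
theorem wT_pos (U : Config (d' + 1) L₀ (2 * n + 2) G) : 0 < wT i ρ J JM U := by
  unfold wT
  exact mul_pos (Real.exp_pos _) (mul_pos (Real.exp_pos _) (heatKernel_pos J _ _))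

omit [TopologicalSpace G] [IsTopologicalGroup G] [CompactSpace G] [MeasurableSpace G] [BorelSpace G]
  [SecondCountableTopology G] in
/-- **The pointwise double-commutator identity in the gauge-theory variables** (`J ≠ 0`):
`|A₀ − A₁|²(U) · w_T(U) + e^{c₀} e^{B'(U)} 𝒦(wv₀ U, wv₁ U) = w_T(U) · B(wv₀ U, wv₁ U)`.
[cite: BorgsSeiler1983, §III.2 (III.36)–(III.42) (p. 350)] -/
theorem stepB_pointwise (hJ : J ≠ 0) (U : Config (d' + 1) L₀ (2 * n + 2) G) :
    ((Complex.normSq (sliceObs i ρ c 0 U - sliceObs i ρ c 1 U) * wT i ρ J JM U : ℝ) : ℂ) +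
        (Real.exp (c0 d' L₀ N n J) : ℂ) *
          ((Real.exp (bRest i ρ J JM U) : ℂ) * dcKernel J (smearedPoly c) (wv i ρ 0 U) (wv i ρ 1 U)) =
      (wT i ρ J JM U : ℂ) * covKernel J (smearedPoly c) (wv i ρ 0 U) (wv i ρ 1 U) := by
  classical
  have h := dcKernel_identity_smearedPoly J hJ c (wv i ρ 0 U) (wv i ρ 1 U)
  rw [sliceObs_eq_smearedPoly, sliceObs_eq_smearedPoly, wT]
  simp only [Complex.ofReal_mul]
  linear_combination ((Real.exp (bRest i ρ J JM U) : ℂ) * (Real.exp (c0 d' L₀ N n J) : ℂ)) * h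

/-- **`⟨|A₀ − A₁|²⟩` in terms of the chain**: `∫ |A₀ − A₁|² e^{−S} = 2g(0) − g(1) − g(−1)`. [folklore] -/
theorem integral_normSq_sub_eq (hρ : Continuous ρ) :
    ((∫ U, Complex.normSq (sliceObs i ρ c 0 U - sliceObs i ρ c 1 U) * weight ρ (J : ℝ) JM U
        ∂haar (d' + 1) L₀ (2 * n + 2) G : ℝ) : ℂ) =
      2 * chain (L₀ := L₀) i ρ (J : ℝ) JM c 0 - chain (L₀ := L₀) i ρ (J : ℝ) JM c 1 -
        chain (L₀ := L₀) i ρ (J : ℝ) JM c (-1) := by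
  rw [← integral_complex_ofReal]
  have hI := integrable_pairIntegrand (L₀ := L₀) (G := G) i ρ (J : ℝ) JM c hρ
  have hexp : ∀ U : Config (d' + 1) L₀ (2 * n + 2) G,
      ((Complex.normSq (sliceObs i ρ c 0 U - sliceObs i ρ c 1 U) * weight ρ (J : ℝ) JM U : ℝ) : ℂ) =
      sliceObs i ρ c 0 U * conj (sliceObs i ρ c 0 U) * (weight ρ (J : ℝ) JM U : ℂ) -
        sliceObs i ρ c 0 U * conj (sliceObs i ρ c 1 U) * (weight ρ (J : ℝ) JM U : ℂ) -
        sliceObs i ρ c 1 U * conj (sliceObs i ρ c 0 U) * (weight ρ (J : ℝ) JM U : ℂ) +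
        sliceObs i ρ c 1 U * conj (sliceObs i ρ c 1 U) * (weight ρ (J : ℝ) JM U : ℂ) := by
    intro U
    push_cast
    rw [← Complex.mul_conj, map_sub]
    ring
  simp_rw [hexp]
  rw [integral_add, integral_sub, integral_sub]
  · rw [← pair, ← pair, ← pair, ← pair, pair_eq_chain, pair_eq_chain, pair_eq_chain, pair_eq_chain]
    simp only [sub_zero, sub_self, zero_sub]
    ring
  · exact hI 0 0
  · exact hI 0 1
  · exact (hI 0 0).sub (hI 0 1)
  · exact hI 1 0
  · exact ((hI 0 0).sub (hI 0 1)).sub (hI 1 0)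
  · exact hI 1 1

/-- **Step B (Borgs–Seiler (III.42)–(III.59))**: for a continuous unitary `ρ`, `J_E = J > 0`,
`J_M ≥ 0`, `1 ≤ n` and every transverse smearing `c`,
`Re(2g(0) − g(1) − g(−1)) = ∫ |A₀ − A₁|² e^{−S} ≤ ((1 + 2N/J)^{L₀} − 1) (Σ_y ‖c(y)‖²) Z`.
[cite: BorgsSeiler1983, §III.2 Lemma III.6 proof, (III.42)–(III.59) (pp. 350–353)] -/
theorem stepB (hρu : ∀ g, ρ g ∈ Matrix.unitaryGroup (Fin N) ℂ) (hρ : Continuous ρ) (hn : 1 ≤ n) (hJ : J ≠ 0)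
    (hJM : 0 ≤ JM) :
    (2 * chain (L₀ := L₀) i ρ (J : ℝ) JM c 0 - chain (L₀ := L₀) i ρ (J : ℝ) JM c 1 -
        chain (L₀ := L₀) i ρ (J : ℝ) JM c (-1)).re ≤
      ((1 + 2 * N / (J : ℝ)) ^ L₀ - 1) * (∑ y, ‖c y‖ ^ 2) *
        ∫ U, weight ρ (J : ℝ) JM U ∂haar (d' + 1) L₀ (2 * n + 2) G := by
  classical
  set f : ℝ := ((1 + 2 * N / (J : ℝ)) ^ L₀ - 1) * ∑ y, ‖c y‖ ^ 2 with hf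
  have hΔc : Continuous fun U : Config (d' + 1) L₀ (2 * n + 2) G =>
      Complex.normSq (sliceObs i ρ c 0 U - sliceObs i ρ c 1 U) :=
    Complex.continuous_normSq.comp ((continuous_sliceObs i ρ c hρ 0).sub (continuous_sliceObs i ρ c hρ 1))
  -- (1) the left-hand side as a real integral, moved to the decoupled variables
  have h1 : (2 * chain (L₀ := L₀) i ρ (J : ℝ) JM c 0 - chain (L₀ := L₀) i ρ (J : ℝ) JM c 1 -
      chain (L₀ := L₀) i ρ (J : ℝ) JM c (-1)).re =
      ∫ U, Complex.normSq (sliceObs i ρ c 0 U - sliceObs i ρ c 1 U) * wT i ρ J JM U ∂haar (d' + 1) L₀ (2 * n + 2) G := by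
    rw [← integral_normSq_sub_eq i ρ J JM c hρ, Complex.ofReal_re,
      ← integral_comp_decouple i (f := fun U => Complex.normSq (sliceObs i ρ c 0 U - sliceObs i ρ c 1 U) *
        weight ρ (J : ℝ) JM U) (hΔc.mul (continuous_weight ρ hρ _ JM))]
    refine integral_congr_ae (Eventually.of_forall fun U => ?_)
    simp only [sliceObs_decouple, weight_decouple i ρ J JM hρu hn]
  rw [h1]
  -- (2) the three integrands
  set P : Config (d' + 1) L₀ (2 * n + 2) G → ℂ := fun U =>
    ((Complex.normSq (sliceObs i ρ c 0 U - sliceObs i ρ c 1 U) * wT i ρ J JM U : ℝ) : ℂ) with hP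
  set D : Config (d' + 1) L₀ (2 * n + 2) G → ℂ := fun U =>
    (Real.exp (bRest i ρ J JM U) : ℂ) * dcKernel J (smearedPoly c) (wv i ρ 0 U) (wv i ρ 1 U) with hD
  obtain ⟨hDint, hDre⟩ := re_integral_exp_bRest_mul_dcKernel_nonneg (L₀ := L₀) (n := n) i ρ J JM c hρu hρ hn hJM
  have hPint : Integrable P (haar (d' + 1) L₀ (2 * n + 2) G) :=
    integrable_of_continuous_complex (Complex.continuous_ofReal.comp (hΔc.mul (continuous_wT i ρ J JM hρ)))
  have hQint : Integrable (fun U => P U + (Real.exp (c0 d' L₀ N n J) : ℂ) * D U) (haar (d' + 1) L₀ (2 * n + 2) G) :=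
    hPint.add (hDint.const_mul _)
  -- (3) the pointwise bound `‖P + e^{c₀} D‖ ≤ w_T · f`
  have hbound : ∀ U, ‖P U + (Real.exp (c0 d' L₀ N n J) : ℂ) * D U‖ ≤ wT i ρ J JM U * f := by
    intro U
    rw [hP, hD]
    simp only
    rw [stepB_pointwise i ρ J JM c hJ U, norm_mul, Complex.norm_real, Real.norm_of_nonneg (wT_pos i ρ J JM U).le]
    exact mul_le_mul_of_nonneg_left
      (norm_covKernel_smearedPoly_le J hJ c _ _ (matOf_wv_mem i ρ hρu 0 U) (matOf_wv_mem i ρ hρu 1 U)) (wT_pos i ρ J JM U).le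
  -- (4) the integral of `w_T` is the partition function
  have hZ : ∫ U, wT i ρ J JM U ∂haar (d' + 1) L₀ (2 * n + 2) G = ∫ U, weight ρ (J : ℝ) JM U ∂haar (d' + 1) L₀ (2 * n + 2) G := by
    rw [← integral_comp_decouple i (continuous_weight ρ hρ (J : ℝ) JM)]
    exact integral_congr_ae (Eventually.of_forall fun U => (weight_decouple i ρ J JM hρu hn U).symm)
  -- (5) assemble
  have hre : (∫ U, P U ∂haar (d' + 1) L₀ (2 * n + 2) G).re =
      ∫ U, Complex.normSq (sliceObs i ρ c 0 U - sliceObs i ρ c 1 U) * wT i ρ J JM U ∂haar (d' + 1) L₀ (2 * n + 2) G := by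
    simp only [hP]
    rw [integral_complex_ofReal, Complex.ofReal_re]
  have hsum : ∫ U, (P U + (Real.exp (c0 d' L₀ N n J) : ℂ) * D U) ∂haar (d' + 1) L₀ (2 * n + 2) G =
      (∫ U, P U ∂haar (d' + 1) L₀ (2 * n + 2) G) +
        (Real.exp (c0 d' L₀ N n J) : ℂ) * ∫ U, D U ∂haar (d' + 1) L₀ (2 * n + 2) G := by
    rw [integral_add hPint (hDint.const_mul _), integral_const_mul]
  have hnorm : ‖∫ U, (P U + (Real.exp (c0 d' L₀ N n J) : ℂ) * D U) ∂haar (d' + 1) L₀ (2 * n + 2) G‖ ≤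
      f * ∫ U, weight ρ (J : ℝ) JM U ∂haar (d' + 1) L₀ (2 * n + 2) G := by
    rw [← hZ, ← integral_const_mul]
    refine (norm_integral_le_integral_norm _).trans (integral_mono hQint.norm
      ((integrable_of_continuous (continuous_wT i ρ J JM hρ)).const_mul f) fun U => ?_)
    rw [mul_comm f]
    exact hbound U
  have hreQ := (Complex.re_le_norm _).trans hnorm
  rw [hsum, Complex.add_re, hre, Complex.re_ofReal_mul] at hreQ
  have hpos : 0 ≤ Real.exp (c0 d' L₀ N n J) * (∫ U, D U ∂haar (d' + 1) L₀ (2 * n + 2) G).re :=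
    mul_nonneg (Real.exp_pos _).le hDre
  linarith

end StepB

end SliceRP

end FiniteTemperature

end Literature.Barriers.QuantumFields

/-! ## Assembly, part VII: plane waves, the complex structure factor, and the infrared bound -/

namespace Literature.Barriers.QuantumFields

namespace FiniteTemperature

namespace SliceRP

open Literature.Probability.LatticeModels
open Literature.MathematicalPhysics.QuantumFieldTheory
open scoped NNReal

variable {d' L₀ : ℕ} {G : Type*} [Group G] {N : ℕ}
variable [TopologicalSpace G] [IsTopologicalGroup G] [CompactSpace G] [MeasurableSpace G] [BorelSpace G]
variable (i : Fin (d' + 1)) (ρ : G →* Matrix (Fin N) (Fin N) ℂ)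

section Structure

variable {L : ℕ} [NeZero L₀] [NeZero L] (JE JM : ℝ)

/-- The complex structure factor `κ̂(k) = Σ_x K(0, x) conj χ_k(x)` of the Polyakov two-point
kernel. [cite: BorgsSeiler1983, §III.2 (III.28) (p. 348)] -/
def hatK (k : Fin (d' + 1) → ZMod L) : ℂ :=
  ∑ x, polyakovKernel (L₀ := L₀) ρ JE JM 0 x * conj (torusChar k x)

/-- The plane-wave observable `Â_k(U) = Σ_x χ_k(x) χ(g_{L_x})`. [folklore] -/
def planeObs (k : Fin (d' + 1) → ZMod L) (U : Config (d' + 1) L₀ L G) : ℂ :=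
  ∑ x, torusChar k x * polyakovTrace ρ U x

omit [TopologicalSpace G] [IsTopologicalGroup G] [CompactSpace G] [MeasurableSpace G] [BorelSpace G] [NeZero L₀] in
/-- **Slicing the plane wave**: `Σ_m e(kᵢ m) A_m = Â_k` for the transverse smearing
`c = χ_{k⊥}`, `k⊥ = removeNth i k`. [folklore] -/
theorem sum_stdAddChar_mul_sliceObs (k : Fin (d' + 1) → ZMod L) (U : Config (d' + 1) L₀ L G) :
    ∑ m : ZMod L, (ZMod.stdAddChar (k i * m) : ℂ) * sliceObs i ρ (torusChar (i.removeNth k)) m U = planeObs ρ k U := by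
  unfold planeObs sliceObs
  rw [sum_torus_eq_sum_sum i]
  refine Finset.sum_congr rfl fun m _ => ?_
  rw [Finset.mul_sum]
  refine Finset.sum_congr rfl fun y _ => ?_
  rw [torusChar_ins, mul_assoc]

variable [SecondCountableTopology G]

/-- `∫ P_x conj(P_y) e^{−S} = Z · K(x, y)`. [folklore] -/
theorem integral_polyakov_pair_eq (hρ : Continuous ρ) (x y : Fin (d' + 1) → ZMod L) :
    ∫ U, polyakovTrace ρ U x * conj (polyakovTrace ρ U y) * (weight ρ JE JM U : ℂ) ∂haar (d' + 1) L₀ L G =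
      ((∫ U, weight ρ JE JM U ∂haar (d' + 1) L₀ L G : ℝ) : ℂ) * polyakovKernel (L₀ := L₀) ρ JE JM x y := by
  have hZ : ((∫ U, weight ρ JE JM U ∂haar (d' + 1) L₀ L G : ℝ) : ℂ) ≠ 0 :=
    Complex.ofReal_ne_zero.2 (partitionFunction_pos ρ hρ JE JM).ne'
  unfold polyakovKernel
  rw [mul_div_cancel₀ _ hZ]

/-- **The chain in Fourier variables**: for `c = χ_{k⊥}`,
`Σ_m e(−kᵢ m) g(m) = Z · L^{d'} · κ̂(k)` (transverse translation invariance of the kernel).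
[cite: BorgsSeiler1983, §III.2 (III.28)–(III.30) (p. 348)] -/
theorem sum_stdAddChar_mul_chain (hρ : Continuous ρ) (k : Fin (d' + 1) → ZMod L) :
    ∑ m : ZMod L, (ZMod.stdAddChar (-(k i * m)) : ℂ) * chain (L₀ := L₀) i ρ JE JM (torusChar (i.removeNth k)) m =
      ((∫ U, weight ρ JE JM U ∂haar (d' + 1) L₀ L G : ℝ) : ℂ) * (Fintype.card (Fin d' → ZMod L) : ℂ) *
        hatK (L₀ := L₀) ρ JE JM k := by
  set c : (Fin d' → ZMod L) → ℂ := torusChar (i.removeNth k) with hc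
  set Z : ℝ := ∫ U, weight ρ JE JM U ∂haar (d' + 1) L₀ L G with hZ
  have hI := integrable_pairIntegrand (L₀ := L₀) (G := G) i ρ JE JM c hρ
  -- `Σ_m e(−kᵢ m) g(m) = ∫ A_0 conj(Â_k) e^{−S}`
  have h1 : ∑ m : ZMod L, (ZMod.stdAddChar (-(k i * m)) : ℂ) * chain (L₀ := L₀) i ρ JE JM c m =
      ∫ U, sliceObs i ρ c 0 U * conj (planeObs ρ k U) * (weight ρ JE JM U : ℂ) ∂haar (d' + 1) L₀ L G := by
    unfold chain pair
    simp_rw [← integral_const_mul]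
    rw [← integral_finsetSum _ fun m _ => (hI 0 m).const_mul _]
    refine integral_congr_ae (Eventually.of_forall fun U => ?_)
    beta_reduce
    rw [← sum_stdAddChar_mul_sliceObs i ρ k U, map_sum, Finset.mul_sum, Finset.sum_mul]
    refine Finset.sum_congr rfl fun m _ => ?_
    rw [map_mul, ← stdAddChar_neg_eq_conj]
    ring
  -- `∫ P_{ins 0 y} conj(Â_k) e^{−S} = Z conj(χ_k(ins 0 y)) κ̂(k)`
  have h2 : ∀ y : Fin d' → ZMod L,
      ∫ U, polyakovTrace ρ U (Torus.ins i 0 y) * conj (planeObs ρ k U) * (weight ρ JE JM U : ℂ) ∂haar (d' + 1) L₀ L G =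
        (Z : ℂ) * conj (torusChar k (Torus.ins i 0 y)) * hatK (L₀ := L₀) ρ JE JM k := by
    intro y
    set a : Fin (d' + 1) → ZMod L := Torus.ins i 0 y with ha
    have hIp : ∀ x : Fin (d' + 1) → ZMod L, Integrable (fun U : Config (d' + 1) L₀ L G =>
        polyakovTrace ρ U a * conj (polyakovTrace ρ U x) * (weight ρ JE JM U : ℂ)) (haar (d' + 1) L₀ L G) :=
      fun x => integrable_polyakovKernel_integrand (L₀ := L₀) ρ hρ JE JM a x
    have hexp : ∀ U : Config (d' + 1) L₀ L G,
        polyakovTrace ρ U a * conj (planeObs ρ k U) * (weight ρ JE JM U : ℂ) =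
          ∑ x, conj (torusChar k x) * (polyakovTrace ρ U a * conj (polyakovTrace ρ U x) * (weight ρ JE JM U : ℂ)) := by
      intro U
      unfold planeObs
      rw [map_sum, Finset.mul_sum, Finset.sum_mul]
      refine Finset.sum_congr rfl fun x _ => ?_
      rw [map_mul]; ring
    simp_rw [hexp]
    rw [integral_finsetSum _ fun x _ => (hIp x).const_mul _]
    simp_rw [integral_const_mul, integral_polyakov_pair_eq ρ JE JM hρ]
    -- translate: `K(a, x) = K(0, x − a)` and reindex `x ↦ x + a`
    have hK : ∀ x, polyakovKernel (L₀ := L₀) ρ JE JM a x = polyakovKernel (L₀ := L₀) ρ JE JM 0 (x - a) := by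
      intro x
      rw [← polyakovKernel_add ρ JE JM 0 (x - a) a, zero_add, sub_add_cancel]
    simp_rw [hK]
    rw [← Equiv.sum_comp (Equiv.addRight a)]
    simp only [Equiv.coe_addRight, add_sub_cancel_right, torusChar_add_right, map_mul]
    unfold hatK
    rw [Finset.mul_sum]
    refine Finset.sum_congr rfl fun x _ => ?_
    ring
  rw [h1]
  -- expand `A_0 = Σ_y χ_{k⊥}(y) P_{ins 0 y}`
  have hexp0 : ∀ U : Config (d' + 1) L₀ L G, sliceObs i ρ c 0 U * conj (planeObs ρ k U) * (weight ρ JE JM U : ℂ) =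
      ∑ y, c y * (polyakovTrace ρ U (Torus.ins i 0 y) * conj (planeObs ρ k U) * (weight ρ JE JM U : ℂ)) := by
    intro U
    unfold sliceObs
    rw [Finset.sum_mul, Finset.sum_mul]
    refine Finset.sum_congr rfl fun y _ => ?_
    ring
  have hIy : ∀ y : Fin d' → ZMod L, Integrable (fun U : Config (d' + 1) L₀ L G =>
      polyakovTrace ρ U (Torus.ins i 0 y) * conj (planeObs ρ k U) * (weight ρ JE JM U : ℂ)) (haar (d' + 1) L₀ L G) := by
    intro y
    refine integrable_of_continuous_complex (((continuous_polyakovTrace ρ hρ _).mul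
      (Complex.continuous_conj.comp ?_)).mul (Complex.continuous_ofReal.comp (continuous_weight ρ hρ JE JM)))
    exact continuous_finsetSum _ fun x _ => continuous_const.mul (continuous_polyakovTrace ρ hρ _)
  simp_rw [hexp0]
  rw [integral_finsetSum _ fun y _ => (hIy y).const_mul _]
  simp_rw [integral_const_mul, h2]
  have hcy : ∀ y : Fin d' → ZMod L, c y * ((Z : ℂ) * conj (torusChar k (Torus.ins i 0 y)) * hatK (L₀ := L₀) ρ JE JM k) =
      (Z : ℂ) * hatK (L₀ := L₀) ρ JE JM k := by
    intro y
    rw [torusChar_ins, mul_zero, AddChar.map_zero_eq_one, one_mul, hc]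
    have := torusChar_mul_conj (i.removeNth k) y
    linear_combination ((Z : ℂ) * hatK (L₀ := L₀) ρ JE JM k) * this
  simp_rw [hcy]
  rw [Finset.sum_const, Finset.card_univ, nsmul_eq_mul]
  ring

/-- **The real Fourier transform of `G_L = Re K(0, ·)` is the symmetrisation of `κ̂`**:
`Re Ĝ_L(k) = (Re κ̂(k) + Re κ̂(−k))/2`. [folklore] -/
theorem re_torusFourier_polyakovCorrelation (hρ : Continuous ρ) (k : Fin (d' + 1) → ZMod L) :
    (torusFourier (fun x => (polyakovCorrelation (L₀ := L₀) ρ JE JM x : ℂ)) k).re =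
      ((hatK (L₀ := L₀) ρ JE JM k).re + (hatK (L₀ := L₀) ρ JE JM (-k)).re) / 2 := by
  rw [torusFourier_eq_sum_torusChar]
  unfold hatK
  simp_rw [polyakovCorrelation_eq_re_polyakovKernel ρ hρ]
  rw [Complex.re_sum, Complex.re_sum, Complex.re_sum, ← Finset.sum_add_distrib, Finset.sum_div]
  refine Finset.sum_congr rfl fun x _ => ?_
  have hneg : torusChar (-k) x = conj (torusChar k x) := by
    rw [torusChar_comm, torusChar_neg_right, torusChar_comm]
  rw [hneg, Complex.conj_conj]
  simp only [Complex.mul_re, Complex.ofReal_re, Complex.ofReal_im, Complex.conj_re, Complex.conj_im]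
  ring

end Structure

/-! ### The infrared bound -/

section Main

variable {n : ℕ} [NeZero L₀] [SecondCountableTopology G]

/-- **The infrared bound for the complex structure factor** (Borgs–Seiler's (III.30) before
symmetrisation): for a continuous unitary `ρ`, `L = 2n + 2` with `n ≥ 1`, `J_E > 0`, `J_M > 0`
and every `k`, `(1 − Re e(kᵢ)) Re κ̂(k) ≤ (1 + 2N/J_E)^{L₀} − 1`.
[cite: BorgsSeiler1983, §III.2 Lemma III.6 (III.30) (p. 348)] -/
theorem infrared_hatK (hρu : ∀ g, ρ g ∈ Matrix.unitaryGroup (Fin N) ℂ) (hρ : Continuous ρ) (hn : 1 ≤ n)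
    (J : ℝ≥0) (hJ : J ≠ 0) {JM : ℝ} (hJM : 0 < JM) (k : Fin (d' + 1) → ZMod (2 * n + 2)) :
    (1 - (ZMod.stdAddChar (k i) : ℂ).re) * (hatK (L₀ := L₀) ρ (J : ℝ) JM k).re ≤
      (1 + 2 * N / (J : ℝ)) ^ L₀ - 1 := by
  set c : (Fin d' → ZMod (2 * n + 2)) → ℂ := torusChar (i.removeNth k) with hc
  set g : ZMod (2 * n + 2) → ℝ := fun m => (chain (L₀ := L₀) i ρ (J : ℝ) JM c m).re with hg
  have hJE : 0 ≤ (J : ℝ) := J.coe_nonneg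
  -- Step A: convexity bound for the real chain
  have hconv : ∀ m : ZMod (2 * n + 2), m ≠ 0 → 0 ≤ cycleLaplacian g m := fun m hm =>
    chain_laplacian_nonneg (L₀ := L₀) i ρ (J : ℝ) JM c hρu hρ hn hJE hJM.le m hm
  have hA := one_sub_re_stdAddChar_mul_re_sum_le g hconv (k i)
  -- the chain is real, so the real sum is the complex sum
  have hreal : ∀ m : ZMod (2 * n + 2), ((g m : ℝ) : ℂ) = chain (L₀ := L₀) i ρ (J : ℝ) JM c m := fun m =>
    Complex.ext (by simp [hg]) (by simp [hg, (chain_im_eq_zero (L₀ := L₀) i ρ (J : ℝ) JM c hρu hρ hn hJE hJM.le m).1])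
  simp_rw [hreal] at hA
  rw [sum_stdAddChar_mul_chain (L₀ := L₀) i ρ (J : ℝ) JM hρ k] at hA
  -- Step B
  have hB := stepB (L₀ := L₀) i ρ J JM c hρu hρ hn hJ hJM.le
  have hcn : ∑ y, ‖c y‖ ^ 2 = (Fintype.card (Fin d' → ZMod (2 * n + 2)) : ℝ) := by
    simp [hc, Finset.card_univ]
  rw [hcn] at hB
  -- combine and divide by `Z · L^{d'} > 0`
  have hZ := partitionFunction_pos (d := d' + 1) (L₀ := L₀) (L := 2 * n + 2) ρ hρ (J : ℝ) JM
  have hcard : (0 : ℝ) < Fintype.card (Fin d' → ZMod (2 * n + 2)) := Nat.cast_pos.2 Fintype.card_pos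
  have hre : ((((∫ U, weight ρ (J : ℝ) JM U ∂haar (d' + 1) L₀ (2 * n + 2) G : ℝ) : ℂ) *
      (Fintype.card (Fin d' → ZMod (2 * n + 2)) : ℂ) * hatK (L₀ := L₀) ρ (J : ℝ) JM k).re) =
      (∫ U, weight ρ (J : ℝ) JM U ∂haar (d' + 1) L₀ (2 * n + 2) G) * Fintype.card (Fin d' → ZMod (2 * n + 2)) *
        (hatK (L₀ := L₀) ρ (J : ℝ) JM k).re := by
    rw [← Complex.ofReal_natCast, ← Complex.ofReal_mul, Complex.re_ofReal_mul]
  rw [hre] at hA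
  have hg0 : 2 * g 0 - g 1 - g (-1) = (2 * chain (L₀ := L₀) i ρ (J : ℝ) JM c 0 - chain (L₀ := L₀) i ρ (J : ℝ) JM c 1 -
      chain (L₀ := L₀) i ρ (J : ℝ) JM c (-1)).re := by
    simp [hg]
  rw [hg0] at hA
  have hkey : (∫ U, weight ρ (J : ℝ) JM U ∂haar (d' + 1) L₀ (2 * n + 2) G) * Fintype.card (Fin d' → ZMod (2 * n + 2)) *
      ((1 - (ZMod.stdAddChar (k i) : ℂ).re) * (hatK (L₀ := L₀) ρ (J : ℝ) JM k).re) ≤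
      (∫ U, weight ρ (J : ℝ) JM U ∂haar (d' + 1) L₀ (2 * n + 2) G) * Fintype.card (Fin d' → ZMod (2 * n + 2)) *
        ((1 + 2 * N / (J : ℝ)) ^ L₀ - 1) := by
    nlinarith [hA, hB]
  exact le_of_mul_le_mul_left hkey (mul_pos hZ hcard)

/-- **The infrared bound (III.30)/(III.31) for the real two-point function**, even side
`L = 2n + 2 ≥ 4`: `(1 − cos pᵢ) Re Ĝ_L(k) ≤ (1 + 2N/J_E)^{L₀} − 1`.
[cite: BorgsSeiler1983, §III.2 Lemma III.6 (III.30) and Cor. III.7 (III.31) (pp. 348–349)] -/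
theorem infrared_bound_even (hρu : ∀ g, ρ g ∈ Matrix.unitaryGroup (Fin N) ℂ) (hρ : Continuous ρ) (hn : 1 ≤ n)
    {JE JM : ℝ} (hJE : 0 < JE) (hJM : 0 < JM) (k : Fin (d' + 1) → ZMod (2 * n + 2)) :
    (1 - Real.cos (latticeMomentum (2 * n + 2) k i)) *
        (torusFourier (fun x => (polyakovCorrelation (L₀ := L₀) ρ JE JM x : ℂ)) k).re ≤
      (1 + 2 * N / JE) ^ L₀ - 1 := by
  lift JE to ℝ≥0 using hJE.le with J
  have hJ : J ≠ 0 := fun h => by rw [h] at hJE; exact lt_irrefl _ hJE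
  have hk := infrared_hatK (L₀ := L₀) i ρ hρu hρ hn J hJ hJM k
  have hk' := infrared_hatK (L₀ := L₀) i ρ hρu hρ hn J hJ hJM (-k)
  have hcos : Real.cos (latticeMomentum (2 * n + 2) k i) = (ZMod.stdAddChar (k i) : ℂ).re := by
    rw [re_stdAddChar_eq_cos, latticeMomentum]
  have hcos' : (ZMod.stdAddChar ((-k) i) : ℂ).re = (ZMod.stdAddChar (k i) : ℂ).re := by
    rw [Pi.neg_apply, stdAddChar_neg_eq_conj, Complex.conj_re]
  rw [hcos'] at hk'
  rw [re_torusFourier_polyakovCorrelation ρ _ JM hρ, hcos]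
  nlinarith [hk, hk']

end Main

end SliceRP

end FiniteTemperature

/-! ### The named fact -/

open FiniteTemperature FiniteTemperature.SliceRP Literature.Probability.LatticeModels in
/-- **Borgs–Seiler's infrared bound with its printed rate holds** (`BorgsSeilerInfraredBoundExplicit`):
for every compact `G` with a continuous unitary `N × N` representation `ρ`, all `d`, `L₀ ≥ 1`, every
even `L ≥ 4`, `J_E, J_M > 0`, every `k` and direction `i`, `(1 − cos pᵢ) Re Ĝ_L(k) ≤ (1 + 2N/J_E)^{L₀} − 1`.
Proof: §III.2 of the paper, with Lemma III.8 obtained from reflection positivity through convexity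
of the two-point chain and the `J_E⁻¹`-expansion organised as the exact Gaussian identity
`|ΔF|² T = B T − 𝒦` (module docstring); faithfulness of `ρ` and `N ≥ 1` are not used.
[cite: BorgsSeiler1983, §III.2 Lemma III.6 (III.29)–(III.30), Cor. III.7 (III.31) (pp. 348–349); proof (III.32)–(III.60) (pp. 349–353)] -/
theorem BorgsSeilerInfraredBoundExplicit_holds : BorgsSeilerInfraredBoundExplicit := by
  intro G _ _ _ _ _ _ _ N d L₀ _ ρ _hN hρ _hinj hρu L _ hL h4 JE JM hJE hJM k i _hk
  obtain ⟨d', rfl⟩ : ∃ d', d = d' + 1 := ⟨d - 1, (Nat.succ_pred_eq_of_pos (Fin.pos i)).symm⟩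
  obtain ⟨m, hm⟩ := hL
  obtain ⟨n, hn, rfl⟩ : ∃ n, 1 ≤ n ∧ L = 2 * n + 2 := ⟨m - 1, by omega, by omega⟩
  exact infrared_bound_even (L₀ := L₀) i ρ hρu hρ hn hJE hJM k

end Literature.Barriers.QuantumFields

end
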